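import Summits.PneNP.PneNP.Theses.SymmetryBudget
import Literature.Computability.Complexity.SymmetricCircuit
import Literature.Computability.Complexity.CircuitProofs
import Literature.Computability.Complexity.CircuitDAG
import Literature.Computability.Complexity.CircuitRestriction
import Literature.Combinatorics.SimpleGraph.HamiltonianCycleListings
import Literature.Computability.Complexity.ClayProblemProofs
import Literature.Computability.Complexity.CircuitClassesUniformProofs
import Summits.PneNP.PneNP.Theorems.NPNotSubsetPPoly
import Mathlib.Data.Nat.Size
import Mathlib.GroupTheory.Perm.Cycle.Type
import Mathlib.GroupTheory.Perm.List
import Mathlib.NumberTheory.Bertrand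
import Mathlib.Dynamics.PeriodicPts.Defs
import Literature.Computability.Complexity.CircuitReduce
import Literature.Computability.Complexity.PPolyReductions
import Literature.Computability.Complexity.KarpProblemsProofs
import Literature.Computability.Complexity.CircuitClassesProofs
import Literature.Computability.Complexity.TM2PassThrough
import Literature.Computability.Complexity.DeMorganSimulation
import Literature.Computability.Complexity.GraphEncodings
import Literature.Computability.Complexity.ConstantDepth
import Literature.Computability.Complexity.TC0SubsetNC1

/-!
# Disproof of `HamCompiles` (crux stmt-PneNP-10637, route PneNP/SymmetryBudget) — standing adversary file

FINDINGS (cdisprove seats refuter-cdisprove-stmt-PneNP-10637-0 (cycle 1, §0–§8),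
refuter-cdisprove-stmt-PneNP-10637-g2-0 (cycle 2, §9–§13) and refuter-cdisprove-stmt-PneNP-10637-g3-0
(cycle 3, §14–§16 + §Lib-14/§Lib-16), 2026-08-16; extends the crux-attack of refuter-rattack-stmt-PneNP-10637-0,
evidence Logic.lean / Witness.lean on the item):

* §0 Vocabulary. The inline `let Sym/HasSym/Bud/Gr` of the route are, by `Iff.rfl`, the named
  `Circuit.IsSymmetricUnder` / `HasSymCircuit tcBasis` / `pointStabiliserBudget` of
  `Literature/Computability/Complexity/SymmetricCircuit.lean`; `Concl` below is the bare conclusion.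
* §1 IRREFUTABILITY (kernel-checked): `PneNP → HamCompiles` and `¬HamCompiles → NP Bool ⊆ P Bool`.
  Any disproof of the crux is a proof of P = NP in Cook's model. No unconditional kill exists.
* §2 LOGICAL POSITION: `HamCompiles ↔ PneNP ∨ Concl`; `Concl → ¬WindowHam`; hence
  `WindowHam → (HamCompiles ↔ PneNP)`: modulo crux #2 this crux IS the summit; its only
  independent content is a uniform equivariant compilation.
* §3 NON-UNIFORM STRENGTHENING (new): `HamCompilesNU := HamPolySize → Concl` (poly-size GENERAL
  tcBasis circuits for HAM at every m ⇒ poly-size Bud(m,⌊log₂ m⌋)-symmetric ones). Every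
  circuit-based compilation (NP ⊆ P ⇒ HAMCIRCUIT ∈ P ⇒ P ⊆ P/poly ⇒ compile) proves it, and
  `HamCompilesNU ↔ (HamPolySize ↔ Concl)`: for HAM, window-symmetric poly-size = general poly-size.
  Consequence `HamCompilesNU → WindowHam → ¬HamPolySize`: under such a proof crux #2 (WindowHam)
  is *equivalent* to a general (non-symmetric) circuit lower bound for HAM, i.e. the symmetric
  window buys no logical room — a proof of HamCompiles that leaves room must use UNIFORMITY of the
  P-machine essentially (no mechanism for that is known; Anderson–Dawar's compilation uses logical
  definability, not uniformity).
* §4 PADDING: `∀ m` versus `∀ᶠ m` in the conclusion, and `∃ m` versus `∃ᶠ m` in WindowHam, are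
  interchangeable given per-m existence of SOME Bud-symmetric circuit for HAM_m (item Symmetrise /
  symmetric DNF); corners m ≤ 2 are constants of symmetric size 1, Bud(m,⌊log₂ m⌋) = {1} for m ≤ 3.
* §7 SYMMETRIC DNF (new, sorry-free): every Γ-invariant matrix function has a Γ-symmetric
  `{¬,∧,∨}`-circuit of size ≤ 2^(m²)+m²+1 (`hasSymCircuit_of_invariant`, via `GateDAG.compile`);
  hence `perMExists`, `Concl ↔ eventually-Concl`, `WindowHam ↔ ¬Concl`, and the one-line
  characterisation `HamCompiles ↔ (WindowHam → PneNP)`: crux #3 IS the claim "crux #2 suffices".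
* §8 POSITIVE LINES UNDER TEST (cycle 1): two ideators' Kotzig-interface + GF(2) cut-rank compilation
  survives paper scrutiny and an independent toy check (36 832 instances, 0 disagreements; job
  j009638); expected outcome: crux PROVED non-uniformly ⇒ (§6) WindowHam ↔ HamHardIO unconditionally.
* §9 BUDGET SCALE (cycle 2, sorry-free): the budget `g` is the crux's only parameter and the claim
  is ANTITONE in it (`hamCompilesAt_anti`); at EVERY budget `HamCompilesAt g ↔ (WindowHamAt g →
  PneNP)` (`hamCompilesAt_iff`, via `WindowHamAt g ↔ ¬ConclAt g`); budget 0 is the bare bridge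
  `NP ⊆ P → HAM ∈ SIZE^tc(poly)` (`hamCompilesAt_zero_iff`, theorem-level); the over-budget
  `⌊log₂ m⌋²` is the SUMMIT ITSELF given the support item PolylogHam (`hamCompilesAt_logSq_iff_pneNP`).
  Sandwich `HamCompilesAt log² → HamCompiles → HamCompilesAt 0`: all content is in the scale.
* §10 WINDOW ARITHMETIC (cycle 2, sorry-free): `2^{⌊log₂ m⌋}·⌊log₂ m⌋^a ≤ m^{a+1}` (subset-indexed
  gate families fit) but `⌊log₂ m⌋!` beats every polynomial along `m = 2^n`
  (`log_factorial_superpoly`, `symmetrise_bound_superpoly`): the naive compilation through item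
  `Symmetrise` proves `HamCompilesAt g` exactly when `(g m)! ≤ poly` (`conclAt_of_symmetrise`,
  kernel-checked plumbing) and is dead BY COUNT at the window — a refuted proof strategy, not a
  refuted statement.
* §11 P/POLY FORM (cycle 2, sorry-free): every surviving idea (kotzig-cutspan, cut-rank-twin-interface,
  hankel-forward-kernel, bbbkv-dialogue) uses `NP ⊆ P` only as `NP ⊆ P/poly`; that form
  `HamCompilesPPoly` implies the crux through the PROVED tree facts `NP_bool_eq_holds`,
  `P_bool_eq_holds`, `P_subset_PPoly_holds` (`hamCompiles_of_hamCompilesPPoly`) and is EQUIVALENT to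
  `WindowHam → NPNotSubsetPPoly` (`hamCompilesPPoly_iff`). So a landed line makes crux #2 at least
  the Karp–Lipton circuit lower bound; with the hardness bridge `NP ⊄ P/poly → HamHardIO` it is
  exactly it (`windowHam_iff_npNotSubsetPPoly`) — concordant with the sibling disprover's F10.
* §12 MECHANICAL SYM-CHECK OF THE LINES' TWO IDIOMS (cycle 2, toy `symcheck_rank.py`, evidence on
  the item): (i) rank canonisation of the free part by neighbourhood rows WITH MULTIPLICITIES
  (lexicographic comparisons indexed by the ordered part; ranks by MAJ gates with constant padding;
  sorted rows as Bud-invariant wires) and (ii) subset-indexed Held–Karp over the free part (gates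
  `(B ⊆ F, u, v)`) satisfy the VERBATIM inline `Sym` clauses (output fixed, labels equal, argument
  MULTISETS matched) under the naming-induced gate permutation, and compute the intended functions:
  (m,g) ∈ {(4,2),(5,2),(5,3),(6,3),(7,3),(7,4)}, up to 522 gates, 35 Sym checks on generators of
  Sym(F), 900 random inputs (planted twins) × 3 functional/invariance checks — 0 failures. No kill
  from the symmetric-realisation step either.
* §13 TARGETS = the 7 stubs of the PICKED line `Lines/kotzig-cutspan.lean` (cycle 2): attacked for
  misstatement with verbatim-definition brute force — `stub_kotzig` (formal KotzigPred vs HAM: all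
  graphs n ≤ 5 × every F; 31 664 checks + 400 random n ≤ 7), `stub_rref` (clauses (1),(2) on all 67
  subspaces of GF(2)^4 × all v, 2 400 random at g = 3; clause (3) for g ≤ 6), `stub_spanRecursion`
  (the EXACT dpLevel/Cspan/Ospan recursion vs WF: g ≤ 4, any graph on F, any rank function, every
  margin vector — 2 140 827 d-checks; kit j011383/j011386 sample g = 5): 0 failures each. Paper audit
  of `stub_cutspan`, `stub_symmetricA/F`, `stub_residueNP`: no misstatement found; pitfalls listed
  in §13 for the lead. NO TARGET BROKEN.
* §14 THE HARDNESS BRIDGE IS A THEOREM (cycle 3, gen 3; kernel-checked, sorry-free, axioms standard; §Lib-14 =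
  vendored copy of `Literature/Computability/Complexity/HamMatrixCircuits.lean`, PROPOSED p82679, review queue): poly-size matrix-input
  `tcBasis` circuits for HAM at every m (`HamPolySize`) ⟺ `HAMCIRCUIT ∈ P/poly` ⟺ `NP ⊆ P/poly`
  (`hamPolySize_iff_npsubPPoly`; string→matrix by hard-wiring the code header, matrix tc→B₂ by the Muroga gadget of
  TC⁰ ⊆ NC¹ — paying for unbounded majority multiplicities —, matrix→string by a validity check of graph codes, then
  Karp-completeness of HAMCIRCUIT + Karp-closure of P/poly, both proved tree facts). Hence UNCONDITIONALLY:
  `HamCompilesNU ↔ HamCompilesPPoly` (§3 = §11), `HamHardIO ↔ NPNotSubsetPPoly`, `NPNotSubsetPPoly → WindowHam`,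
  the budget-0 crux `hamCompilesAt_zero : HamCompilesAt 0` is a THEOREM, the sub-window crux needs only `Symmetrise`
  (`hamCompilesAt_subwindow_of_symmetrise`), and THE P/POLY FORM EVERY LINE PROVES IS LITERALLY
  `WindowHam ↔ NPNotSubsetPPoly` (`hamCompilesPPoly_iff_windowHam_iff_npNotSubsetPPoly`; dually
  `HamCompilesNU ↔ (WindowHam ↔ HamHardIO)`). A refutation of the crux = `NP ⊆ P ∧ HamPolySize ∧ ¬Concl`
  (`not_hamCompiles_iff_gap`): a superpolynomial symmetric-vs-general size gap for HAM inside P = NP.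
* §15 ROOM / SCALE / BASIS (cycle 3): KERNEL `HamCompilesPPoly ↔ HamCompiles ∧ (NP ⊆ P/poly → P ≠ NP → Concl)` — the
  lines exceed the crux exactly by the Karp–Lipton world; `HamCompilesNUAt g ↔ (WindowHamAt g ↔ HamHardIO)` at every
  budget. PAPER: the support-theorem lower bounds hold exactly for g = ω(log m) (AD 2017 Thm 21 quoted; DW Thm 4.10 as
  cited by the route), the lines cover every O(log m): no gap, no overlap, consistency constraint `a ≥ H(δ/c')` void;
  MAJ not load-bearing for the lines (acBasis suffices), unbounded fan-in IS (fan-in 2 + verbatim Sym ⇒ g! blow-up).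
* §16 BASIS MUTATION REFUTED (cycle 3; kernel-checked, §Lib-16 `FanInLib` =
  `Literature/Computability/Complexity/SymmetricCircuitFanIn.lean`, PROPOSED p83445, review queue): a Bud(m,g)-symmetric circuit with SYMMETRIC gates
  of FAN-IN ≤ 2 is blind to the free vertices (3 ≤ g ≤ m; reduce to rigid, then 3-cycles of free vertices fix every
  gate below the output: order 3 vs an involution on ≤ 2 children). Hence over `{∧₂,∨₂,¬}`: `¬HasSym` for HAM at EVERY
  size (m ≥ 8), `Concl` FALSE (`not_conclDeMorgan`), `WindowHam` TRUE, and the mutated crux ↔ PneNP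
  (`hamCompilesDeMorgan_iff_pneNP`); quantitatively (fan-in < a prime p ≤ g ⇒ blind; Bertrand) every window-symmetric
  threshold circuit for HAM_m has a gate of fan-in > ⌊log₂ m⌋/2 (`exists_wide_gate_of_sym_ham`). The unbounded fan-in of
  tcBasis is load-bearing in the strongest sense.
* WHY IT RESISTS: ¬HamCompiles ⊢ NP ⊆ P (§1). The honest target for an adversary is the PROOF
  STRATEGY: with r twin classes of free vertices, √(g/log g) ≲ r ≲ g/log g, both in-class ordering
  (∏|T_i|! gates) and endpoint-class count summaries ((g+1)^{r(r+1)/2} DP states) are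
  superpolynomial; a generic repair is Sym(F)-equivariant canonisation of a vertex-coloured graph on
  g = ⌊log₂ m⌋ vertices with 2^{O(g)} gates (circuit form of "CPT captures P on 2^n-padded
  structures"), open in print and it would also refute sibling crux WindowBarrier.
-/

-- `Summit.PneNP.PneNP.…` duplicates `PneNP` BY DESIGN (single-problem summit, D-0017); the Summits
-- library sets this option globally (lakefile), repeated here so a standalone `lean check` is warning-free.
set_option linter.dupNamespace false

/-! ## §Lib-14 (vendored) `HamMatrixLib`: matrix-input HAM circuits versus `HAMCIRCUIT ∈ P/poly`

Verbatim copy of the namespace `Literature.Computability.Complexity.HamMatrix` of the proposed Literature file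
`Literature/Computability/Complexity/HamMatrixCircuits.lean` (this seat, cycle 3), kept here until that module is
importable on the farm; §14 below uses it. -/

namespace Summit.PneNP.PneNP.Cruxes.HamCompiles.HamMatrixLib

open Literature.Computability.Complexity


open _root_.Computability Polynomial

open scoped Classical in
/-- `HAM_m`: Hamiltonicity of the simple graph read off an `m × m` Boolean matrix (symmetrised,
loops dropped — the decoding convention of `encodingGraphFin`), as a Boolean function; the target
function of the route `PneNP/SymmetryBudget`. [folklore] -/
noncomputable def hamFn (m : ℕ) : (Fin m × Fin m → Bool) → Bool :=
  fun x => decide (SimpleGraph.fromRel fun u v => x (u, v) = true : SimpleGraph (Fin m)).IsHamiltonian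

/-- The simple graph of a Boolean matrix (route convention). [folklore] -/
abbrev grOf (m : ℕ) (x : Fin m × Fin m → Bool) : SimpleGraph (Fin m) :=
  SimpleGraph.fromRel fun u v => x (u, v) = true

/-- "HAM has polynomial-size matrix-input circuits over the basis `B`": one polynomial `p` and,
at every `m`, a `B`-circuit on the `m²` matrix entries with at most `p m` gates computing
`HAM_m`. [folklore] -/
def PolySize (B : Set GateFn) : Prop :=
  ∃ p : Polynomial ℕ, ∀ m : ℕ, ∃ C : Circuit (Fin m × Fin m),
    C.IsOver B ∧ C.size ≤ p.eval m ∧ C.Computes (hamFn m)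

/-! ### The code of an `m`-vertex graph: header and adjacency block -/

/-- The header of the code of an `m`-vertex graph: the doubled binary digits of `m` and the
separator `01` (the first component of `boolPair`). [cite: AroraBarak2009, §0.1] -/
def hdr (m : ℕ) : List Bool := ((encodeNat m).flatMap fun b => [b, b]) ++ [false, true]

/-- Length of the header. [folklore] -/
theorem length_hdr (m : ℕ) : (hdr m).length = 2 * (encodeNat m).length + 2 := by
  simp only [hdr, List.length_append, List.length_flatMap, List.length_cons, List.length_nil]
  induction encodeNat m with
  | nil => simp
  | cons b l ih => simp [List.sum_cons]; omega

/-- The length of the code of every `m`-vertex graph. [folklore] -/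
def codeLen (m : ℕ) : ℕ := (hdr m).length + m * m

open scoped Classical in
/-- The adjacency block of the code of `G`: bit `finProdFinEquiv (i, j)` is `[G.Adj i j]`.
[cite: AroraBarak2009, §0.1] -/
noncomputable def adjBlock {m : ℕ} (G : SimpleGraph (Fin m)) : Fin (m * m) → Bool :=
  fun k => decide (G.Adj (finProdFinEquiv.symm k).1 (finProdFinEquiv.symm k).2)

/-- The code of `⟨m, G⟩` is the header followed by the adjacency block. [cite: AroraBarak2009, §0.1] -/
theorem encode_eq (m : ℕ) (G : SimpleGraph (Fin m)) :
    encodingGraph.encode ⟨m, G⟩ = hdr m ++ List.ofFn (adjBlock G) := by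
  rw [encodingGraph_encode]
  rfl

/-- Every `m`-vertex graph has a code of length `codeLen m`. [folklore] -/
theorem length_encode (m : ℕ) (G : SimpleGraph (Fin m)) :
    (encodingGraph.encode ⟨m, G⟩).length = codeLen m := by
  rw [encode_eq, List.length_append, List.length_ofFn, codeLen]

/-- `codeLen m ≤ m² + 2m + 4`. [folklore] -/
theorem codeLen_le (m : ℕ) : codeLen m ≤ m * m + 2 * m + 4 := by
  have := TM2Pass.length_encodeNat_le_self m
  rw [codeLen, length_hdr]
  omega

/-- `m ≤ codeLen m`. [folklore] -/
theorem le_codeLen (m : ℕ) : m ≤ codeLen m := by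
  rw [codeLen]
  rcases Nat.eq_zero_or_pos m with rfl | hm
  · exact Nat.zero_le _
  · exact le_add_left (Nat.le_mul_of_pos_right m hm)

/-- `codeLen` is strictly monotone (so the length of a code determines the number of vertices).
[folklore] -/
theorem codeLen_strictMono : StrictMono codeLen := by
  refine strictMono_nat_of_lt_succ fun m => ?_
  have h1 : (encodeNat m).length ≤ (encodeNat (m + 1)).length := by
    rw [TM2Pass.length_encodeNat_eq_size, TM2Pass.length_encodeNat_eq_size]
    exact Nat.size_le_size (Nat.le_succ m)
  simp only [codeLen, length_hdr]
  nlinarith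

/-- The adjacency bit of the matrix graph at position `(u, v)`: off-diagonal symmetrised entry.
[folklore] -/
theorem adjBlock_grOf {m : ℕ} (x : Fin m × Fin m → Bool) (k : Fin (m * m)) :
    adjBlock (grOf m x) k =
      (if (finProdFinEquiv.symm k).1 = (finProdFinEquiv.symm k).2 then false
       else (x (finProdFinEquiv.symm k) || x ((finProdFinEquiv.symm k).2, (finProdFinEquiv.symm k).1))) := by
  unfold adjBlock
  set u := (finProdFinEquiv.symm k).1
  set v := (finProdFinEquiv.symm k).2
  by_cases huv : u = v
  · rw [if_pos huv, decide_eq_false_iff_not]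
    intro h
    exact h.ne huv
  · rw [if_neg huv]
    have hk : finProdFinEquiv.symm k = (u, v) := rfl
    rw [hk]
    by_cases h1 : x (u, v) = true
    · simp [SimpleGraph.fromRel_adj, huv, h1]
    · by_cases h2 : x (v, u) = true
      · simp [SimpleGraph.fromRel_adj, huv, h2]
      · simp [SimpleGraph.fromRel_adj, h1, h2]

/-! ### From string circuits to matrix circuits -/

/-- Bit `j` of the code of the matrix graph of `x`, as an explicit function of `x`: a header
constant, or an off-diagonal symmetrised entry, or the constant `0` on the diagonal. [folklore] -/
noncomputable def codeBit (m : ℕ) (j : Fin (codeLen m)) (x : Fin m × Fin m → Bool) : Bool :=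
  if h : (j : ℕ) < (hdr m).length then (hdr m)[(j : ℕ)]'h
  else adjBlock (grOf m x) ⟨(j : ℕ) - (hdr m).length, by
    have hj : (j : ℕ) < (hdr m).length + m * m := j.2
    omega⟩

/-- `codeBit` is bit `j` of the code. [folklore] -/
theorem codeBit_eq_getElem (m : ℕ) (j : Fin (codeLen m)) (x : Fin m × Fin m → Bool) :
    codeBit m j x = (encodingGraph.encode ⟨m, grOf m x⟩)[(j : ℕ)]'(by rw [length_encode]; exact j.2) := by
  simp only [codeBit, encode_eq, List.getElem_append, List.getElem_ofFn]

/-- Each code bit costs at most one `B₂` gate. [folklore] -/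
theorem cktSize_codeBit (m : ℕ) (j : Fin (codeLen m)) :
    CktSize B2 (fun (x : Fin m × Fin m → Bool) (_ : Unit) => codeBit m j x) 1 := by
  unfold codeBit
  split_ifs with h
  · exact cktSize_const _ _
  · set k : Fin (m * m) := ⟨(j : ℕ) - (hdr m).length, _⟩
    by_cases huv : (finProdFinEquiv.symm k).1 = (finProdFinEquiv.symm k).2
    · refine (cktSize_const _ false).congr fun x _ => ?_
      rw [adjBlock_grOf, if_pos huv]
    · refine (cktSize_or (finProdFinEquiv.symm k)
        ((finProdFinEquiv.symm k).2, (finProdFinEquiv.symm k).1)).congr fun x _ => ?_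
      rw [adjBlock_grOf, if_neg huv]

/-- All code bits together: `codeLen m` gates. [folklore] -/
theorem cktSize_codeBits (m : ℕ) :
    CktSize B2 (fun (x : Fin m × Fin m → Bool) (j : Fin (codeLen m)) => codeBit m j x) (codeLen m) := by
  have h := CktSize.pi_const (B := B2) (κ := Fin (codeLen m))
    (f := fun (x : Fin m × Fin m → Bool) (j : Fin (codeLen m)) => codeBit m j x) (s := 1)
    (fun j => cktSize_codeBit m j)
  simpa using h

/-- Evaluating a family at a vector presented with a cast length. [folklore] -/
theorem eval_family_cast (D : CircuitFamily) (s : List Bool) {N : ℕ} (h : s.length = N) :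
    (D N).eval (fun j : Fin N => s[(j : ℕ)]'(by rw [h]; exact j.2)) = (D s.length).eval s.get := by
  subst h
  rfl

open scoped Classical in
/-- The value of `HAMCIRCUIT.boolIndicator` at the code of the matrix graph is `HAM_m x`.
[cite: Karp1972, §4 Main Theorem problem 10] -/
theorem boolIndicator_encode (m : ℕ) (x : Fin m × Fin m → Bool) :
    HAMCIRCUIT.boolIndicator (encodingGraph.encode ⟨m, grOf m x⟩) = hamFn m x := by
  have hiff : encodingGraph.encode ⟨m, grOf m x⟩ ∈ HAMCIRCUIT ↔ (grOf m x).IsHamiltonian :=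
    encodingGraph.mem_toLanguage_iff _ _
  unfold hamFn
  by_cases hH : (grOf m x).IsHamiltonian
  · rw [show HAMCIRCUIT.boolIndicator (encodingGraph.encode ⟨m, grOf m x⟩) = true from
      (Set.mem_iff_boolIndicator _ _).1 (hiff.2 hH)]
    exact (decide_eq_true hH).symm
  · have h1 : HAMCIRCUIT.boolIndicator (encodingGraph.encode ⟨m, grOf m x⟩) ≠ true :=
      fun h => hH (hiff.1 ((Set.mem_iff_boolIndicator _ _).2 h))
    rw [Bool.eq_false_iff.2 h1]
    exact (decide_eq_false hH).symm

/-- Evaluation of a polynomial over `ℕ` is monotone in the argument. [folklore] -/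
theorem natPoly_eval_mono (p : Polynomial ℕ) {a b : ℕ} (h : a ≤ b) : p.eval a ≤ p.eval b := by
  rw [Polynomial.eval_eq_sum_range, Polynomial.eval_eq_sum_range]
  exact Finset.sum_le_sum fun i _ => Nat.mul_le_mul_left _ (Nat.pow_le_pow_left h i)

/-- The constant-`0` gate is the arity-`0` disjunction, a gate of `tcBasis`. [folklore] -/
theorem const_false_mem_tcBasis : (⟨0, fun _ => false⟩ : GateFn) ∈ tcBasis := by
  have : (⟨0, fun _ => false⟩ : GateFn) = GateFn.or 0 := by
    simp only [GateFn.or]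
    exact Sigma.ext rfl (heq_of_eq (funext fun v => by simp))
  rw [this]
  exact acBasis_subset_tcBasis (Or.inr (Set.mem_iUnion.2 ⟨0, Or.inr rfl⟩))

/-- `{∧₂, ∨₂, ¬} ⊆ tcBasis`. [folklore] -/
theorem deMorganBasis_subset_tcBasis : deMorganBasis ⊆ tcBasis := by
  intro f hf
  simp only [deMorganBasis, Set.mem_insert_iff, Set.mem_singleton_iff] at hf
  refine acBasis_subset_tcBasis ?_
  rcases hf with rfl | rfl | rfl
  · exact Or.inr (Set.mem_iUnion.2 ⟨2, Or.inl rfl⟩)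
  · exact Or.inr (Set.mem_iUnion.2 ⟨2, Or.inr rfl⟩)
  · exact Or.inl rfl

/-- `HAM_0 ≡ false` (the graph on no vertices is not Hamiltonian in Mathlib). [folklore] -/
theorem hamFn_zero (x : Fin 0 × Fin 0 → Bool) : hamFn 0 x = false := by
  unfold hamFn
  rw [decide_eq_false_iff_not]
  intro h
  obtain ⟨a, -⟩ := h (by simp)
  exact a.elim0

/-- The constant-`b` gate is in `B₂`. [folklore] -/
theorem const_gate_mem_B2 (b : Bool) : (⟨0, fun _ => b⟩ : GateFn) ∈ B2 := by
  show (0 : ℕ) ≤ 2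
  omega

/-- The constant circuit is over `B₂` and over `tcBasis`. [folklore] -/
theorem const_isOver_B2 (ι : Type*) (b : Bool) : (Circuit.const ι b).IsOver B2 := by
  intro g hg
  simp only [Circuit.const, List.mem_singleton] at hg
  subst hg
  exact const_gate_mem_B2 b

/-- The constant-`true` gate is the arity-`0` conjunction, a gate of `tcBasis`. [folklore] -/
theorem const_true_mem_tcBasis : (⟨0, fun _ => true⟩ : GateFn) ∈ tcBasis := by
  have : (⟨0, fun _ => true⟩ : GateFn) = GateFn.and 0 := by
    simp only [GateFn.and]
    exact Sigma.ext rfl (heq_of_eq (funext fun v => by simp))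
  rw [this]
  exact acBasis_subset_tcBasis (Or.inr (Set.mem_iUnion.2 ⟨0, Or.inl rfl⟩))

/-- The constant circuit is over `tcBasis`. [folklore] -/
theorem const_isOver_tcBasis (ι : Type*) (b : Bool) : (Circuit.const ι b).IsOver tcBasis := by
  intro g hg
  simp only [Circuit.const, List.mem_singleton] at hg
  subst hg
  cases b
  · exact const_false_mem_tcBasis
  · exact const_true_mem_tcBasis

/-- **String circuits give matrix circuits (over `B₂`).** If `HAMCIRCUIT ∈ P/poly` then `HAM_m`
has polynomial-size matrix-input `B₂`-circuits: hard-wire the header of the code, read the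
adjacency block off the matrix (one `∨₂` per off-diagonal entry, the constant `0` on the
diagonal), and run the string circuit of length `codeLen m`. [cite: AroraBarak2009, Def. 6.5 and §0.1] -/
theorem polySize_B2_of_mem_PPoly (h : HAMCIRCUIT ∈ PPoly) : PolySize B2 := by
  obtain ⟨p, hp⟩ := Set.mem_iUnion.1 h
  obtain ⟨D, hD, hdec⟩ := hp
  -- size polynomial: `q + p ∘ q` with `q = X² + 2X + 4 ≥ codeLen`
  let q : Polynomial ℕ := X * X + 2 * X + 4
  have hq : ∀ m, codeLen m ≤ q.eval m := fun m => by
    simp only [q, eval_add, eval_mul, eval_X, eval_ofNat]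
    exact codeLen_le m
  refine ⟨q + p.comp q, fun m => ?_⟩
  set N := codeLen m with hN
  have hcomp := (cktSize_codeBits m).comp (Circuit.cktSize_eval (D N) (hD N).1)
  -- the composite computes `HAM_m`
  have hval : ∀ x : Fin m × Fin m → Bool,
      (D N).eval (fun j : Fin N => codeBit m j x) = hamFn m x := by
    intro x
    have h1 : (fun j : Fin N => codeBit m j x) =
        fun j : Fin N => (encodingGraph.encode ⟨m, grOf m x⟩)[(j : ℕ)]'(by
          rw [length_encode]; exact j.2) := funext fun j => codeBit_eq_getElem m j x
    rw [h1, eval_family_cast D _ (length_encode m (grOf m x)), hdec, boolIndicator_encode]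
  obtain ⟨C, hCB, hCs, hCe⟩ := (hcomp.congr fun x _ => hval x).toCircuit
  refine ⟨C, hCB, hCs.trans ?_, hCe⟩
  rw [eval_add, eval_comp]
  exact Nat.add_le_add (hq m) (((hD N).2).trans (natPoly_eval_mono p (hq m)))

/-- Matrix `B₂`-circuits give matrix `tcBasis`-circuits (`{∧₂, ∨₂, ¬} ⊆ tcBasis`, Jukna's
`12 s + 3` simulation of `B₂` by `{∧₂, ∨₂, ¬}`; at `m = 0` the constant circuit). [cite: Jukna2012, §1.2] -/
theorem polySize_tcBasis_of_polySize_B2 (h : PolySize B2) : PolySize tcBasis := by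
  obtain ⟨p, hp⟩ := h
  refine ⟨12 * p + 3, fun m => ?_⟩
  obtain ⟨C, hCB, hCs, hCe⟩ := hp m
  rcases Nat.eq_zero_or_pos m with rfl | hm
  · refine ⟨Circuit.const _ false, const_isOver_tcBasis _ false, ?_, fun x => ?_⟩
    · simp
    · rw [Circuit.eval_const, hamFn_zero]
  · obtain ⟨C', hB', hf', hs'⟩ := C.exists_deMorgan_of_B2 hCB (⟨0, hm⟩, ⟨0, hm⟩) hCe
    refine ⟨C', hB'.mono deMorganBasis_subset_tcBasis, hs'.trans ?_, hf'⟩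
    simp only [eval_add, eval_mul, eval_ofNat]
    omega

/-! ### From matrix circuits over `tcBasis` to `B₂`-circuits on `Fin (m * m)` (Muroga) -/

/-- "HAM has polynomial-size `B`-circuits on the linearised matrix `Fin (m * m)`". [folklore] -/
def PolySizeLin (B : Set GateFn) : Prop :=
  ∃ p : Polynomial ℕ, ∀ m : ℕ, ∃ C : Circuit (Fin (m * m)),
    C.IsOver B ∧ C.size ≤ p.eval m ∧
      C.Computes fun y => hamFn m fun q => y (finProdFinEquiv q)

/-- The threshold-gadget size of `TC0SubsetNC1.lean` (Muroga weights + carry-save addition).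
[cite: Vollmer1999, Theorem 1.24] -/
noncomputable def gadgetSize (N : ℕ) : ℕ := N * 1 + wsumSize N (Nat.log 2 (N + 1).factorial + 1)

/-- **Threshold circuits with few GATES are `B₂`-circuits with few gates** (on `Fin n` inputs):
a `tcBasis`-circuit with `s` gates on `n` inputs — whose majority gates may read wires with
arbitrary multiplicities, i.e. are arbitrary-weight thresholds of `≤ n + s` distinct wires — is
simulated by a `B₂`-circuit with `≤ s · (gadgetSize (n + s) + 1)` gates, by Muroga's weight bound
and iterated addition (the size half of `TC⁰ ⊆ NC¹`). [cite: Vollmer1999, §4.5.2 Cor. 4.35] -/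
theorem exists_B2_of_tcBasis {n : ℕ} (C : Circuit (Fin n)) (hC : C.IsOver tcBasis) :
    ∃ C' : Circuit (Fin n), C'.IsOver B2 ∧ C'.size ≤ C.size * (gadgetSize (n + C.size) + 1) ∧
      C'.Computes C.eval := by
  have h := Circuit.acRealOver_B2_of_tcBasis_of_gadget
    (fun N => 1 + wsumDepth N (Nat.log 2 (N + 1).factorial + 1)) gadgetSize
    (fun N M hM w θ => ncVec_threshold_logDepth N M hM w θ) C hC (le_refl (n + C.size))
  obtain ⟨C', hB, -, hs, hf⟩ := h.toCircuit
  exact ⟨C', hB, hs, hf⟩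

/-- `gadgetSize` is polynomially bounded. [cite: Vollmer1999, Theorem 1.24] -/
theorem exists_poly_gadgetSize : ∃ q : Polynomial ℕ, ∀ N, gadgetSize N ≤ q.eval N :=
  threshold_gadget_size_bound

/-- **Matrix `tcBasis`-circuits give linearised `B₂`-circuits of polynomial size.** [folklore] -/
theorem polySizeLin_B2_of_polySize_tcBasis (h : PolySize tcBasis) : PolySizeLin B2 := by
  obtain ⟨p, hp⟩ := h
  obtain ⟨g, hg⟩ := exists_poly_gadgetSize
  -- `N₁ = m² + |C₁| ≤ r m`, total `≤ p m · (g (r m) + 1)`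
  let r : Polynomial ℕ := X * X + p
  refine ⟨p * (g.comp r + 1), fun m => ?_⟩
  obtain ⟨C, hCB, hCs, hCe⟩ := hp m
  -- A1: rewire the matrix circuit to the linearised inputs
  have h1 : CktSize tcBasis (fun (y : Fin (m * m) → Bool) (_ : Unit) =>
      C.eval fun q => y (finProdFinEquiv q)) C.size :=
    (Circuit.cktSize_eval C hCB).rewire fun q => finProdFinEquiv q
  obtain ⟨C₁, h₁B, h₁s, h₁e⟩ := h1.toCircuit
  -- A2: Muroga simulation over `B₂`
  obtain ⟨C₂, h₂B, h₂s, h₂e⟩ := exists_B2_of_tcBasis C₁ h₁B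
  refine ⟨C₂, h₂B, h₂s.trans ?_, fun y => ?_⟩
  · have hN : m * m + C₁.size ≤ r.eval m := by
      simp only [r, eval_add, eval_mul, eval_X]
      exact Nat.add_le_add_left (h₁s.trans hCs) _
    have hgad : gadgetSize (m * m + C₁.size) ≤ (g.comp r).eval m := by
      rw [eval_comp]
      exact (hg _).trans (natPoly_eval_mono g hN)
    rw [eval_mul, eval_add, eval_one]
    exact Nat.mul_le_mul (h₁s.trans hCs) (Nat.succ_le_succ hgad)
  · rw [h₂e y, h₁e y, hCe]


/-! ### From linearised `B₂`-circuits to string circuits: `HAMCIRCUIT ∈ P/poly` -/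

section Strings

variable (m : ℕ)

/-- `codeLen m = |hdr m| + m²` (definitional). [folklore] -/
theorem codeLen_eq : codeLen m = (hdr m).length + m * m := rfl

/-- The position of adjacency bit `k` in a code of length `codeLen m`. [folklore] -/
def blkPos (k : Fin (m * m)) : Fin (codeLen m) :=
  ⟨(hdr m).length + k, by rw [codeLen_eq]; omega⟩

/-- The position of header bit `j`. [folklore] -/
def hdrPos (j : Fin (hdr m).length) : Fin (codeLen m) :=
  ⟨j, by rw [codeLen_eq]; omega⟩

/-- The adjacency block read off a bit vector of code length. [folklore] -/
def blk (s : Fin (codeLen m) → Bool) : Fin (m * m) → Bool := fun k => s (blkPos m k)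

/-- Index type of the validity tests: header positions, ordered pairs (symmetry), vertices
(no loops). [folklore] -/
abbrev TestIdx (m : ℕ) : Type := Fin (hdr m).length ⊕ (Fin m × Fin m) ⊕ Fin m

/-- The validity tests of a purported code: the header is that of `m`, the adjacency block is
symmetric, its diagonal is `0`. [folklore] -/
def test (s : Fin (codeLen m) → Bool) : TestIdx m → Bool
  | Sum.inl j => (s (hdrPos m j) == (hdr m)[(j : ℕ)])
  | Sum.inr (Sum.inl q) => (blk m s (finProdFinEquiv q) == blk m s (finProdFinEquiv (q.2, q.1)))
  | Sum.inr (Sum.inr u) => !blk m s (finProdFinEquiv (u, u))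

/-- A bit vector of code length is VALID if it passes every test (then it is the code of a simple
graph on `m` vertices). [folklore] -/
def valid (s : Fin (codeLen m) → Bool) : Bool := decide (∀ t : TestIdx m, test m s t = true)

/-- The matrix read off a bit vector of code length. [folklore] -/
def mat (s : Fin (codeLen m) → Bool) : Fin m × Fin m → Bool := fun q => blk m s (finProdFinEquiv q)

/-! #### Circuits for the tests -/

/-- Each test costs one `B₂` gate. [folklore] -/
theorem cktSize_test (t : TestIdx m) :
    CktSize B2 (fun (s : Fin (codeLen m) → Bool) (_ : Unit) => test m s t) 1 := by
  rcases t with j | q | u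
  · exact (CktSize.gate (B := B2) ⟨1, fun v => (v 0 == (hdr m)[(j : ℕ)])⟩ (by show (1 : ℕ) ≤ 2; omega)
      fun _ => hdrPos m j).congr fun s _ => rfl
  · exact (CktSize.gate (B := B2) ⟨2, fun v => (v 0 == v 1)⟩ (by show (2 : ℕ) ≤ 2; omega)
      ![blkPos m (finProdFinEquiv q), blkPos m (finProdFinEquiv (q.2, q.1))]).congr fun s _ => rfl
  · exact (cktSize_not (blkPos m (finProdFinEquiv (u, u)))).congr fun s _ => rfl

/-- The conjunction of `M` given bits costs `M + 1` gates over `B₂` (a chain of `∧₂`, seeded by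
the constant `1`). [folklore] -/
theorem cktSize_all (M : ℕ) :
    CktSize B2 (fun (y : Fin M → Bool) (_ : Unit) => decide (∀ j, y j = true)) (M + 1) := by
  induction M with
  | zero => exact (cktSize_const _ true).congr fun y _ => by simp
  | succ M ih =>
    have h1 : CktSize B2 (fun (y : Fin (M + 1) → Bool) (_ : Unit) =>
        decide (∀ j : Fin M, y (Fin.castSucc j) = true)) (M + 1) := ih.rewire Fin.castSucc
    have h2 := h1.pair (CktSize.proj B2 fun _ : Unit => Fin.last M)
    have h3 := h2.comp (cktSize_and (Sum.inl ()) (Sum.inr ()))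
    refine (h3.congr fun y _ => ?_).of_le (by omega)
    simp only [Sum.elim_inl, Sum.elim_inr]
    have key : (∀ j : Fin (M + 1), y j = true) ↔
        (∀ j : Fin M, y (Fin.castSucc j) = true) ∧ y (Fin.last M) = true := Fin.forall_fin_succ'
    rw [show decide (∀ j : Fin (M + 1), y j = true) =
        decide ((∀ j : Fin M, y (Fin.castSucc j) = true) ∧ y (Fin.last M) = true) from
      decide_eq_decide.2 key, Bool.decide_and, Bool.decide_eq_true]

/-- The conjunction of finitely many given bits costs `#κ + 1` gates over `B₂`. [folklore] -/
theorem cktSize_all_fintype (κ : Type*) [Fintype κ] :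
    CktSize B2 (fun (y : κ → Bool) (_ : Unit) => decide (∀ k, y k = true)) (Fintype.card κ + 1) := by
  classical
  let e := Fintype.equivFin κ
  refine ((cktSize_all (Fintype.card κ)).rewire e.symm).congr fun y _ => ?_
  refine decide_eq_decide.2 ⟨fun h k => ?_, fun h j => h _⟩
  simpa using h (e k)

/-- The validity test costs `2 #TestIdx + 1` gates. [folklore] -/
theorem cktSize_valid :
    CktSize B2 (fun (s : Fin (codeLen m) → Bool) (_ : Unit) => valid m s)
      (Fintype.card (TestIdx m) * 1 + (Fintype.card (TestIdx m) + 1)) :=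
  ((CktSize.pi_const (B := B2) (κ := TestIdx m)
      (f := fun (s : Fin (codeLen m) → Bool) (t : TestIdx m) => test m s t) (s := 1)
      (cktSize_test m)).comp (cktSize_all_fintype (TestIdx m))).congr fun _ _ => rfl

/-- The number of tests: `|hdr m| + m² + m ≤ 2 · codeLen m`. [folklore] -/
theorem card_testIdx_le : Fintype.card (TestIdx m) ≤ 2 * codeLen m := by
  simp only [TestIdx, Fintype.card_sum, Fintype.card_fin, Fintype.card_prod, codeLen_eq]
  nlinarith

/-- The string function of length `codeLen m`: valid AND the linearised HAM circuit accepts the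
block. [folklore] -/
def strFn (C₂ : Circuit (Fin (m * m))) (s : Fin (codeLen m) → Bool) : Bool :=
  valid m s && C₂.eval (blk m s)

/-- Its circuit: tests, conjunction, the HAM circuit on the block, one `∧₂`. [folklore] -/
theorem cktSize_strFn (C₂ : Circuit (Fin (m * m))) (hB : C₂.IsOver B2) :
    CktSize B2 (fun (s : Fin (codeLen m) → Bool) (_ : Unit) => strFn m C₂ s)
      (Fintype.card (TestIdx m) * 1 + (Fintype.card (TestIdx m) + 1) + C₂.size + 1) := by
  have h1 := (cktSize_valid m).pair ((Circuit.cktSize_eval C₂ hB).rewire (blkPos m))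
  exact (h1.comp (cktSize_and (Sum.inl ()) (Sum.inr ()))).congr fun s _ => rfl

/-! #### Semantics of the tests -/

/-- Header bits of a code. [folklore] -/
theorem getElem_encode_hdrPos (G : SimpleGraph (Fin m)) (j : Fin (hdr m).length) :
    (encodingGraph.encode ⟨m, G⟩)[(hdrPos m j : ℕ)]'(by rw [length_encode]; exact (hdrPos m j).2) =
      (hdr m)[(j : ℕ)] := by
  simp only [encode_eq, hdrPos]
  rw [List.getElem_append_left]

/-- Block bits of a code. [folklore] -/
theorem getElem_encode_blkPos (G : SimpleGraph (Fin m)) (k : Fin (m * m)) :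
    (encodingGraph.encode ⟨m, G⟩)[(blkPos m k : ℕ)]'(by rw [length_encode]; exact (blkPos m k).2) =
      adjBlock G k := by
  simp only [encode_eq, blkPos]
  rw [List.getElem_append_right (by omega)]
  simp

open scoped Classical in
/-- The adjacency block of a graph at `(u, v)` is `[G.Adj u v]`. [folklore] -/
theorem adjBlock_apply (G : SimpleGraph (Fin m)) (u v : Fin m) :
    adjBlock G (finProdFinEquiv (u, v)) = decide (G.Adj u v) := by
  simp [adjBlock]

/-- **Codes are valid.** [folklore] -/
theorem valid_encode (G : SimpleGraph (Fin m)) :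
    valid m (fun j => (encodingGraph.encode ⟨m, G⟩)[(j : ℕ)]'(by rw [length_encode]; exact j.2)) = true := by
  classical
  unfold valid
  rw [decide_eq_true_eq]
  rintro (j | q | u)
  · simp only [test, getElem_encode_hdrPos, beq_self_eq_true]
  · obtain ⟨u, v⟩ := q
    simp only [test, blk, getElem_encode_blkPos, adjBlock_apply]
    rw [show decide (G.Adj v u) = decide (G.Adj u v) from decide_eq_decide.2 (G.adj_comm v u)]
    exact beq_self_eq_true _
  · simp only [test, blk, getElem_encode_blkPos, adjBlock_apply]
    simp

/-- `blkPos` after `hdrPos`: every position is a header position or a block position. [folklore] -/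
theorem pos_cases (j : Fin (codeLen m)) :
    (∃ j' : Fin (hdr m).length, j = hdrPos m j') ∨ ∃ k : Fin (m * m), j = blkPos m k := by
  by_cases h : (j : ℕ) < (hdr m).length
  · exact Or.inl ⟨⟨j, h⟩, Fin.ext rfl⟩
  · refine Or.inr ⟨⟨(j : ℕ) - (hdr m).length, ?_⟩, Fin.ext ?_⟩
    · have := j.2; have e := codeLen_eq m; omega
    · simp only [blkPos]; omega

/-- **Valid bit vectors are codes**: a valid `s` is, bit by bit, the code of the graph of its
block. [folklore] -/
theorem encode_mat_of_valid {s : Fin (codeLen m) → Bool} (hv : valid m s = true) (j : Fin (codeLen m)) :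
    (encodingGraph.encode ⟨m, grOf m (mat m s)⟩)[(j : ℕ)]'(by rw [length_encode]; exact j.2) = s j := by
  unfold valid at hv
  rw [decide_eq_true_eq] at hv
  rcases pos_cases m j with ⟨j', rfl⟩ | ⟨k, rfl⟩
  · have h := hv (Sum.inl j')
    simp only [test, beq_iff_eq] at h
    rw [getElem_encode_hdrPos, h]
  · rw [getElem_encode_blkPos, adjBlock_grOf]
    set u := (finProdFinEquiv.symm k).1 with hu
    set v := (finProdFinEquiv.symm k).2 with hv'
    have hk : finProdFinEquiv (u, v) = k := by
      rw [hu, hv', Prod.mk.eta, Equiv.apply_symm_apply]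
    by_cases huv : u = v
    · rw [if_pos huv]
      have h := hv (Sum.inr (Sum.inr u))
      simp only [test, Bool.not_eq_true'] at h
      rw [← huv] at hk
      rw [← hk]
      exact h.symm
    · rw [if_neg huv]
      have h := hv (Sum.inr (Sum.inl (u, v)))
      simp only [test, beq_iff_eq] at h
      show (blk m s (finProdFinEquiv (finProdFinEquiv.symm k)) || blk m s (finProdFinEquiv (v, u))) = blk m s k
      rw [Equiv.apply_symm_apply, ← h, hk, Bool.or_self]

/-- **Semantics of the string circuit on strings of length `codeLen m`.** [cite: AroraBarak2009, Def. 6.5 and §0.1] -/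
theorem strFn_eq_boolIndicator (C₂ : Circuit (Fin (m * m)))
    (hC : C₂.Computes fun y => hamFn m fun q => y (finProdFinEquiv q))
    (x : List Bool) (hx : x.length = codeLen m) :
    strFn m C₂ (fun j => x[(j : ℕ)]'(by rw [hx]; exact j.2)) = HAMCIRCUIT.boolIndicator x := by
  set s : Fin (codeLen m) → Bool := fun j => x[(j : ℕ)]'(by rw [hx]; exact j.2) with hs
  by_cases hv : valid m s = true
  · -- `x` is the code of the graph of its block
    have hxe : x = encodingGraph.encode ⟨m, grOf m (mat m s)⟩ := by
      refine List.ext_getElem (by rw [hx, length_encode]) fun j h1 h2 => ?_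
      have := encode_mat_of_valid m hv ⟨j, by rw [← hx]; exact h1⟩
      exact this.symm
    rw [strFn, hv, Bool.true_and, hC, hxe, boolIndicator_encode]
    rfl
  · -- `x` is not a code at all
    rw [strFn, Bool.eq_false_iff.2 hv, Bool.false_and]
    symm
    rw [← Bool.not_eq_true]
    intro hmem
    obtain ⟨⟨n', G'⟩, -, he⟩ := (Set.mem_iff_boolIndicator _ _).2 hmem
    have hn : n' = m := by
      apply codeLen_strictMono.injective
      rw [← length_encode n' G', he, hx]
    subst hn
    apply hv
    convert valid_encode _ G' using 2
    funext j
    simp only [hs, he]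

end Strings


/-! ### The circuit family deciding `HAMCIRCUIT` -/

/-- Transport of a circuit along an equality of input lengths: evaluation. [folklore] -/
theorem eval_transport {k n : ℕ} (E : Circuit (Fin k)) (h : k = n) (y : Fin n → Bool) :
    (h ▸ E).eval y = E.eval fun j => y (Fin.cast h j) := by
  subst h; rfl

/-- Transport of a circuit along an equality of input lengths: basis. [folklore] -/
theorem isOver_transport {k n : ℕ} (E : Circuit (Fin k)) (h : k = n) (B : Set GateFn) :
    (h ▸ E).IsOver B ↔ E.IsOver B := by
  subst h; exact Iff.rfl

/-- Transport of a circuit along an equality of input lengths: size. [folklore] -/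
theorem size_transport {k n : ℕ} (E : Circuit (Fin k)) (h : k = n) : (h ▸ E).size = E.size := by
  subst h; rfl

open scoped Classical in
/-- The circuit family: at a code length `codeLen m` the string circuit of `m`, elsewhere the
constant `0`. [cite: AroraBarak2009, Def. 6.2] -/
noncomputable def family (E : ∀ m, Circuit (Fin (codeLen m))) : CircuitFamily := fun n =>
  if h : ∃ m, codeLen m = n then h.choose_spec ▸ E h.choose else Circuit.const _ false

/-- **Linearised `B₂`-circuits for HAM give `HAMCIRCUIT ∈ P/poly`.** At length `codeLen m` the
circuit checks that the input is a graph code with the header of `m` (symmetric block, empty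
diagonal) and runs the HAM circuit on the block; other lengths carry no code. [cite: AroraBarak2009, Def. 6.5 and §0.1] -/
theorem mem_PPoly_of_polySizeLin_B2 (h : PolySizeLin B2) : HAMCIRCUIT ∈ PPoly := by
  obtain ⟨p, hp⟩ := h
  choose C hCB hCs hCe using hp
  let P : Polynomial ℕ := 4 * X + 3 + p
  -- the string circuit of each `m`
  have hstr : ∀ m, ∃ D : Circuit (Fin (codeLen m)), D.IsOver B2 ∧ D.size ≤ P.eval (codeLen m) ∧
      ∀ (x : List Bool) (hx : x.length = codeLen m),
        D.eval (fun j => x[(j : ℕ)]'(by rw [hx]; exact j.2)) = HAMCIRCUIT.boolIndicator x := by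
    intro m
    obtain ⟨D, hDB, hDs, hDe⟩ := (cktSize_strFn m (C m) (hCB m)).toCircuit
    refine ⟨D, hDB, hDs.trans ?_, fun x hx => ?_⟩
    · have h1 := card_testIdx_le m
      have h2 : (C m).size ≤ p.eval (codeLen m) := (hCs m).trans (natPoly_eval_mono p (le_codeLen m))
      simp only [P, eval_add, eval_mul, eval_ofNat, eval_X]
      omega
    · rw [hDe, strFn_eq_boolIndicator m (C m) (hCe m) x hx]
  choose D hDB hDs hDe using hstr
  refine Set.mem_iUnion.2 ⟨P + 1, family D, fun n => ?_, fun x => ?_⟩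
  · by_cases h : ∃ m, codeLen m = n
    · have hF : family D n = h.choose_spec ▸ D h.choose := dif_pos h
      rw [hF, isOver_transport, size_transport]
      refine ⟨hDB _, (hDs _).trans ?_⟩
      rw [h.choose_spec]
      simp only [P, eval_add, eval_one, eval_mul, eval_X, eval_ofNat]
      omega
    · have hF : family D n = Circuit.const _ false := dif_neg h
      rw [hF]
      exact ⟨const_isOver_B2 _ false, by simp⟩
  · by_cases h : ∃ m, codeLen m = x.length
    · have hF : family D x.length = h.choose_spec ▸ D h.choose := dif_pos h
      rw [hF, eval_transport]
      exact hDe h.choose x h.choose_spec.symm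
    · have hF : family D x.length = Circuit.const _ false := dif_neg h
      rw [hF, Circuit.eval_const]
      symm
      rw [← Bool.not_eq_true]
      intro hmem
      obtain ⟨⟨n', G'⟩, -, he⟩ := (Set.mem_iff_boolIndicator _ _).2 hmem
      exact h ⟨n', by rw [← he, length_encode]⟩

/-! ### Summary: the three forms of "HAM has small circuits" coincide with `NP ⊆ P/poly` -/

/-- **Matrix threshold circuits give `HAMCIRCUIT ∈ P/poly`** (Muroga + the code check). [cite: AroraBarak2009, Def. 6.5 and §0.1] -/
theorem mem_PPoly_of_polySize_tcBasis (h : PolySize tcBasis) : HAMCIRCUIT ∈ PPoly :=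
  mem_PPoly_of_polySizeLin_B2 (polySizeLin_B2_of_polySize_tcBasis h)

/-- **`HAMCIRCUIT ∈ P/poly` iff HAM has polynomial-size matrix-input threshold circuits**
(size = number of gates, arbitrary fan-in and multiplicities). [cite: AroraBarak2009, Def. 6.5 and §0.1] -/
theorem mem_PPoly_iff_polySize_tcBasis : HAMCIRCUIT ∈ PPoly ↔ PolySize tcBasis :=
  ⟨fun h => polySize_tcBasis_of_polySize_B2 (polySize_B2_of_mem_PPoly h), mem_PPoly_of_polySize_tcBasis⟩

/-- The same over `B₂`. [cite: AroraBarak2009, Def. 6.5 and §0.1] -/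
theorem mem_PPoly_iff_polySize_B2 : HAMCIRCUIT ∈ PPoly ↔ PolySize B2 :=
  ⟨polySize_B2_of_mem_PPoly, fun h => mem_PPoly_of_polySize_tcBasis (polySize_tcBasis_of_polySize_B2 h)⟩

/-- **`NP ⊆ P/poly` iff HAM has polynomial-size matrix-input threshold circuits** (Karp:
`HAMILTON CIRCUIT` is NP-complete, proved in the tree; `P/poly` is closed under Karp reductions). [cite: Karp1972, §4 Main Theorem problem 10] -/
theorem np_subset_PPoly_iff_polySize_tcBasis : Nondeterministic.NP ⊆ PPoly ↔ PolySize tcBasis :=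
  (NP_subset_PPoly_iff_of_isNPComplete isNPComplete_HAMCIRCUIT_holds).trans mem_PPoly_iff_polySize_tcBasis


open scoped Classical in
/-- **`NP ⊆ P/poly` iff Hamiltonicity of `m`-vertex graphs, read off the `m × m` Boolean matrix,
has threshold circuits with polynomially many gates at every `m`** — the matrix form used by the
symmetric-circuit routes, spelled out. [cite: AroraBarak2009, §6.4] -/
theorem np_subset_PPoly_iff_matrixCircuits :
    Nondeterministic.NP ⊆ PPoly ↔
      ∃ p : Polynomial ℕ, ∀ m : ℕ, ∃ C : Circuit (Fin m × Fin m),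
        C.IsOver tcBasis ∧ C.size ≤ p.eval m ∧
          C.Computes fun x : Fin m × Fin m → Bool =>
            decide (SimpleGraph.fromRel fun u v => x (u, v) = true : SimpleGraph (Fin m)).IsHamiltonian :=
  np_subset_PPoly_iff_polySize_tcBasis

open scoped Classical in
/-- The same for `HAMCIRCUIT ∈ P/poly`. [cite: AroraBarak2009, Def. 6.5 and §0.1] -/
theorem mem_PPoly_iff_matrixCircuits :
    HAMCIRCUIT ∈ PPoly ↔
      ∃ p : Polynomial ℕ, ∀ m : ℕ, ∃ C : Circuit (Fin m × Fin m),
        C.IsOver tcBasis ∧ C.size ≤ p.eval m ∧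
          C.Computes fun x : Fin m × Fin m → Bool =>
            decide (SimpleGraph.fromRel fun u v => x (u, v) = true : SimpleGraph (Fin m)).IsHamiltonian :=
  mem_PPoly_iff_polySize_tcBasis



end Summit.PneNP.PneNP.Cruxes.HamCompiles.HamMatrixLib

/-! ## §Lib-16 (vendored) `FanInLib`: bounded fan-in symmetric circuits are blind to the free vertices

Verbatim copy (names de-dotted) of the proposed Literature file
`Literature/Computability/Complexity/SymmetricCircuitFanIn.lean` (this seat, cycle 3), kept here until that module is
importable on the farm; §16 below uses it. -/

namespace Summit.PneNP.PneNP.Cruxes.HamCompiles.FanInLib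

open Literature.Computability.Complexity GateDAG



variable {ι Λ : Type*}

/-! ### A permutation of a list of length `≤ 2` onto its image is an involution on it -/

/-- If a list of length at most two is a permutation of its image under `r`, then `r ∘ r` fixes
every member. [folklore] -/
theorem apply_apply_eq_of_perm_map {α : Type*} [DecidableEq α] {L : List α} (hL : L.length ≤ 2)
    {r : α → α} (h : L.Perm (L.map r)) : ∀ a ∈ L, r (r a) = a := by
  rcases L with _ | ⟨a, _ | ⟨b, _ | ⟨c, L⟩⟩⟩
  · intro a ha; simp at ha
  · intro x hx
    simp only [List.map_cons, List.map_nil, List.perm_singleton, List.cons.injEq, and_true] at h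
    simp only [List.mem_singleton] at hx
    subst hx
    rw [← h, ← h]
  · -- `[a, b] ~ [r a, r b]`
    have hmem1 : r a ∈ [a, b] := h.symm.subset (by simp)
    have hmem2 : r b ∈ [a, b] := h.symm.subset (by simp)
    have hmem3 : a ∈ [r a, r b] := h.subset (by simp)
    have hmem4 : b ∈ [r a, r b] := h.subset (by simp)
    simp only [List.mem_cons, List.not_mem_nil, or_false] at hmem1 hmem2 hmem3 hmem4
    intro x hx
    simp only [List.mem_cons, List.not_mem_nil, or_false] at hx
    rcases hx with rfl | rfl
    · rcases hmem1 with h1 | h1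
      · rw [h1, h1]
      · rw [h1]
        rcases hmem3 with h3 | h3
        · rw [h1] at h3; rw [← h3, h1, ← h3]
        · exact h3.symm
    · rcases hmem2 with h2 | h2
      · rw [h2]
        rcases hmem4 with h4 | h4
        · exact h4.symm
        · rw [h2] at h4; rw [← h4, h2, ← h4]
      · rw [h2, h2]
  · simp at hL

/-! ### Automorphisms of a rigid DAG along a group of input permutations -/

section Rigid

variable (R : GateDAG ι Λ)

/-- An automorphism over the identity of a rigid DAG is the identity. [folklore] -/
theorem eq_refl_of_rigid (hR : R.IsRigidDAG) {θ : Λ ≃ Λ} (h : R.IsAut _root_.id θ) :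
    θ = Equiv.refl Λ :=
  hR _ _ _ h R.isAut_id_refl

/-- In a rigid DAG, the automorphism over a composite is the composite of the automorphisms.
[folklore] -/
theorem eq_trans_of_rigid (hR : R.IsRigidDAG) {π π' : ι → ι} {θ θ' θ'' : Λ ≃ Λ}
    (h : R.IsAut π θ) (h' : R.IsAut π' θ') (h'' : R.IsAut (π' ∘ π) θ'') :
    θ'' = θ.trans θ' :=
  hR _ _ _ h'' (IsAut.trans R h h')

variable {R}

/-- The wire relabelling of an automorphism. [folklore] -/
abbrev rel (π : ι → ι) (θ : Λ ≃ Λ) : ι ⊕ Λ → ι ⊕ Λ := Sum.map π θ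

/-- For an automorphism FIXING a gate of fan-in `≤ 2`, the relabelling is an involution on the
children of that gate. [folklore] -/
theorem rel_rel_args_of_isAut [DecidableEq ι] [DecidableEq Λ] {π : ι → ι} {θ : Λ ≃ Λ}
    (h : R.IsAut π θ) {l : Λ} (hl : θ l = l) (h2 : (R.fn l).1 ≤ 2) (a : Fin (R.fn l).1) :
    rel π θ (rel π θ (R.args l a)) = R.args l a := by
  have hp := h.args_perm l
  rw [hl] at hp
  exact apply_apply_eq_of_perm_map (by rw [List.length_ofFn]; exact h2) hp _
    (List.mem_ofFn.2 ⟨a, rfl⟩)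

/-- **Order three beats fan-in two.** Let `θ₁, θ₂, θ₃` be automorphisms over `π, π ∘ π, π ∘ π ∘ π`
of a rigid DAG, with `π ∘ π ∘ π = id` (so `θ₃ = 1`). If `θ₁` fixes a gate `l` of fan-in `≤ 2`, then
the relabelling `rel π θ₁` fixes every child wire of `l`: it is an involution on the children and
has order dividing three. [folklore] -/
theorem rel_args_eq_of_cube [DecidableEq ι] [DecidableEq Λ] (hR : R.IsRigidDAG)
    {π : ι → ι} (hπ : π ∘ π ∘ π = _root_.id) {θ : Λ ≃ Λ} (h : R.IsAut π θ)
    {l : Λ} (hl : θ l = l) (h2 : (R.fn l).1 ≤ 2) (a : Fin (R.fn l).1) :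
    rel π θ (R.args l a) = R.args l a := by
  -- `θ ∘ θ ∘ θ` is the automorphism over `π ∘ π ∘ π = id`, hence the identity
  have h3 : R.IsAut (π ∘ π ∘ π) ((θ.trans θ).trans θ) :=
    IsAut.trans R (IsAut.trans R h h) h
  rw [hπ] at h3
  have hid : (θ.trans θ).trans θ = Equiv.refl Λ := eq_refl_of_rigid R hR h3
  have hrel3 : ∀ w : ι ⊕ Λ, rel π θ (rel π θ (rel π θ w)) = w := by
    intro w
    rcases w with i | m
    · show Sum.inl (π (π (π i))) = Sum.inl i
      have := congrFun hπ i
      simp only [Function.comp_apply, id_eq] at this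
      rw [this]
    · show Sum.inr (θ (θ (θ m))) = Sum.inr m
      have := congrArg (fun e : Λ ≃ Λ => e m) hid
      simpa using this
  have hinv := rel_rel_args_of_isAut h hl h2 a
  -- `w = r³ w = r (r² w) = r w`
  calc rel π θ (R.args l a) = rel π θ (rel π θ (rel π θ (R.args l a))) := by rw [hinv]
    _ = R.args l a := hrel3 _

end Rigid

/-! ### Blindness: values of gates fixed by the order-three automorphisms -/

section Blind

variable {R : GateDAG ι Λ}

/-- **Induction down a rigid DAG of fan-in `≤ 2`.** Let `P` be a set of input maps `π` with
`π³ = id`, each carried by an automorphism `θ_π`. If two inputs `x, y` agree at every input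
position fixed by all `π ∈ P`, then every gate fixed by all `θ_π` has the same value on `x` and
`y` (its children are again fixed, by `rel_args_eq_of_cube`). [folklore] -/
theorem val_eq_of_fixed [DecidableEq ι] [DecidableEq Λ] (hR : R.IsRigidDAG)
    (h2 : ∀ l, (R.fn l).1 ≤ 2) {P : Set (ι → ι)} (hP : ∀ π ∈ P, π ∘ π ∘ π = _root_.id)
    (θ : ∀ π ∈ P, Λ ≃ Λ) (hθ : ∀ π (hπ : π ∈ P), R.IsAut π (θ π hπ))
    {x y : ι → Bool} (hxy : ∀ i, (∀ π ∈ P, π i = i) → x i = y i) :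
    ∀ l, (∀ π (hπ : π ∈ P), θ π hπ l = l) → R.val x l = R.val y l := by
  intro l
  induction l using R.wf.induction with
  | _ l ih =>
    intro hfix
    rw [R.val_eq, R.val_eq]
    refine congrArg (R.fn l).2 (funext fun a => ?_)
    have hchild : ∀ π (hπ : π ∈ P), rel π (θ π hπ) (R.args l a) = R.args l a :=
      fun π hπ => rel_args_eq_of_cube hR (hP π hπ) (hθ π hπ) (hfix π hπ) (h2 l) a
    cases ha : R.args l a with
    | inl i =>
      simp only [wire_inl]
      refine hxy i fun π hπ => ?_
      have := hchild π hπ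
      rw [ha] at this
      exact Sum.inl.inj this
    | inr m =>
      simp only [wire_inr]
      refine ih m ⟨a, ha⟩ fun π hπ => ?_
      have := hchild π hπ
      rw [ha] at this
      exact Sum.inr.inj this

/-- **Blindness of the output.** Under the hypotheses of `val_eq_of_fixed`, if moreover the output
wire is fixed by every `θ_π` / `π` (as it is for automorphisms), the DAG has the same output on `x`
and `y`. [folklore] -/
theorem evalOut_eq_of_fixed [DecidableEq ι] [DecidableEq Λ] (hR : R.IsRigidDAG)
    (h2 : ∀ l, (R.fn l).1 ≤ 2) {P : Set (ι → ι)} (hP : ∀ π ∈ P, π ∘ π ∘ π = _root_.id)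
    (θ : ∀ π ∈ P, Λ ≃ Λ) (hθ : ∀ π (hπ : π ∈ P), R.IsAut π (θ π hπ))
    {x y : ι → Bool} (hxy : ∀ i, (∀ π ∈ P, π i = i) → x i = y i) :
    R.evalOut x = R.evalOut y := by
  unfold evalOut
  cases ho : R.out with
  | inl i =>
    simp only [wire_inl]
    refine hxy i fun π hπ => ?_
    have := (hθ π hπ).out_eq
    rw [ho] at this
    exact Sum.inl.inj this
  | inr l =>
    simp only [wire_inr]
    refine val_eq_of_fixed hR h2 hP θ hθ hxy l fun π hπ => ?_
    have := (hθ π hπ).out_eq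
    rw [ho] at this
    exact Sum.inr.inj this

end Blind


/-! ### Matrix circuits symmetric under the point-stabiliser budget -/

section Matrix

open GateDAG

variable {m : ℕ}

/-- The diagonal action of a vertex permutation on matrix positions. [folklore] -/
def diagMap (ρ : Equiv.Perm (Fin m)) : Fin m × Fin m → Fin m × Fin m := fun q => (ρ q.1, ρ q.2)

/-- `diagMap` of a permutation of order dividing three cubes to the identity. [folklore] -/
theorem diagMap_comp_three {ρ : Equiv.Perm (Fin m)} (h : ρ ^ 3 = 1) :
    diagMap ρ ∘ diagMap ρ ∘ diagMap ρ = _root_.id := by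
  funext q
  have h' : ∀ i, ρ (ρ (ρ i)) = i := fun i => by
    have := congrArg (fun e : Equiv.Perm (Fin m) => e i) h
    simpa [pow_succ, Equiv.Perm.mul_apply] using this
  simp only [Function.comp_apply, diagMap, id_eq, h']

/-- **Fan-in two symmetric circuits see only budget-fixed positions.** Let `C` be a circuit on
`m × m` matrices whose gates are SYMMETRIC gate functions of fan-in `≤ 2`, symmetric under
`Bud(m,g)` (Anderson–Dawar automorphisms, not necessarily rigid). If two matrices agree at every
position `(u, v)` with `u, v` fixed by all elements of order dividing `3` of `Bud(m,g)`, then `C`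
has the same value on them. Proof: pass to the reduced (rigid) circuit, where every gate below the
output is fixed by the automorphism of every such element (order three versus an involution on at
most two children), so the output reads only fixed positions. [folklore] -/
theorem eval_eq_of_fanIn_two {g : ℕ} (C : Circuit (Fin m × Fin m))
    (h2 : ∀ gt ∈ C.gates, gt.arity ≤ 2) (hsym : ∀ gt ∈ C.gates, gt.fn.IsSymmetric)
    (hS : C.IsSymmetricUnder (pointStabiliserBudget m g)) {x y : Fin m × Fin m → Bool}
    (hxy : ∀ u v : Fin m,
      (∀ ρ ∈ pointStabiliserBudget m g, ρ ^ 3 = 1 → ρ u = u ∧ ρ v = v) → x (u, v) = y (u, v)) :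
    C.eval x = C.eval y := by
  classical
  let D := GateDAG.ofCircuit C
  have hfs : ∀ l, (D.fn l).IsSymmetric := fun l => hsym _ (List.getElem_mem _)
  have hDs : D.IsSymm (GateDAG.diagMaps (pointStabiliserBudget m g)) :=
    (GateDAG.isSymmetricUnder_iff_ofCircuit C _).1 hS
  let R := D.reduce
  have hR : R.IsRigidDAG := D.isRigidDAG_reduce
  have hR2 : ∀ l, (R.fn l).1 ≤ 2 := by
    rintro (q | c)
    · show (D.fn q.out.1).1 ≤ 2
      exact h2 _ (List.getElem_mem _)
    · show 1 ≤ 2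
      omega
  have hdiag : ∀ ρ : Equiv.Perm (Fin m),
      (⇑(Equiv.prodCongr ρ ρ) : Fin m × Fin m → Fin m × Fin m) = diagMap ρ :=
    fun ρ => funext fun q => rfl
  -- every budget element is carried by an automorphism of the reduced circuit
  have hAut : ∀ ρ ∈ pointStabiliserBudget m g, ∃ θ : D.RGate ≃ D.RGate, R.IsAut (diagMap ρ) θ := by
    intro ρ hρ
    obtain ⟨θ, hθ⟩ := hDs _ (GateDAG.diag_mem_diagMaps hρ)
    have hθ' : D.IsAut (⇑(Equiv.prodCongr ρ ρ)) θ := by rw [hdiag]; exact hθ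
    exact ⟨_, by have := hθ'.reduce; rwa [hdiag] at this⟩
  -- the order-three elements of the budget, as diagonal maps
  let P : Set (Fin m × Fin m → Fin m × Fin m) :=
    {π | ∃ ρ ∈ pointStabiliserBudget m g, ρ ^ 3 = 1 ∧ π = diagMap ρ}
  have hP : ∀ π ∈ P, π ∘ π ∘ π = _root_.id := by
    rintro π ⟨ρ, -, h3, rfl⟩
    exact diagMap_comp_three h3
  have hPaut : ∀ π ∈ P, ∃ θ : D.RGate ≃ D.RGate, R.IsAut π θ := by
    rintro π ⟨ρ, hρ, -, rfl⟩
    exact hAut ρ hρ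
  choose θ hθ using hPaut
  have hxy' : ∀ i : Fin m × Fin m, (∀ π ∈ P, π i = i) → x i = y i := by
    rintro ⟨u, v⟩ hi
    refine hxy u v fun ρ hρ h3 => ?_
    have := hi (diagMap ρ) ⟨ρ, hρ, h3, rfl⟩
    simp only [diagMap, Prod.mk.injEq] at this
    exact this
  have key := evalOut_eq_of_fixed hR hR2 hP θ hθ hxy'
  rw [← GateDAG.evalOut_ofCircuit C x, ← GateDAG.evalOut_ofCircuit C y,
    ← GateDAG.evalOut_reduce _ hfs x, ← GateDAG.evalOut_reduce _ hfs y]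
  exact key

end Matrix

/-! ### Free vertices are moved by three-cycles of the budget -/

section Free

variable {m : ℕ}

/-- A permutation moving only free vertices lies in the budget. [folklore] -/
theorem swap_mul_swap_mem_budget {g : ℕ} {a b c : Fin m} (ha : m ≤ (a : ℕ) + g)
    (hb : m ≤ (b : ℕ) + g) (hc : m ≤ (c : ℕ) + g) :
    Equiv.swap a b * Equiv.swap a c ∈ pointStabiliserBudget m g := by
  rw [mem_pointStabiliserBudget_iff]
  intro i hi
  have hia : i ≠ a := fun h => by subst h; omega
  have hib : i ≠ b := fun h => by subst h; omega
  have hic : i ≠ c := fun h => by subst h; omega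
  rw [Equiv.Perm.mul_apply, Equiv.swap_apply_of_ne_of_ne hia hic, Equiv.swap_apply_of_ne_of_ne hia hib]

/-- **Every free vertex is moved by an order-three element of the budget** (`3 ≤ g ≤ m`: there are
three free vertices). [folklore] -/
theorem exists_threeCycle_moving {g : ℕ} (hg : 3 ≤ g) (hgm : g ≤ m) {u : Fin m}
    (hu : m ≤ (u : ℕ) + g) :
    ∃ ρ ∈ pointStabiliserBudget m g, ρ ^ 3 = 1 ∧ ρ u ≠ u := by
  -- three distinct free vertices `m-1, m-2, m-3`; two of them differ from `u`
  have hm : 3 ≤ m := hg.trans hgm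
  obtain ⟨b, c, hb, hc, hub, huc, hbc⟩ : ∃ b c : Fin m, m ≤ (b : ℕ) + g ∧ m ≤ (c : ℕ) + g ∧
      u ≠ b ∧ u ≠ c ∧ b ≠ c := by
    let p : Fin m := ⟨m - 1, by omega⟩
    let q : Fin m := ⟨m - 2, by omega⟩
    let r : Fin m := ⟨m - 3, by omega⟩
    have hp : m ≤ (p : ℕ) + g := by show m ≤ m - 1 + g; omega
    have hq : m ≤ (q : ℕ) + g := by show m ≤ m - 2 + g; omega
    have hr : m ≤ (r : ℕ) + g := by show m ≤ m - 3 + g; omega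
    have hpq : p ≠ q := fun h => by have := congrArg Fin.val h; simp [p, q] at this; omega
    have hpr : p ≠ r := fun h => by have := congrArg Fin.val h; simp [p, r] at this; omega
    have hqr : q ≠ r := fun h => by have := congrArg Fin.val h; simp [q, r] at this; omega
    by_cases h1 : u = p
    · exact ⟨q, r, hq, hr, by rw [h1]; exact hpq, by rw [h1]; exact hpr, hqr⟩
    · by_cases h2 : u = q
      · exact ⟨p, r, hp, hr, by rw [h2]; exact hpq.symm, by rw [h2]; exact hqr, hpr⟩
      · exact ⟨p, q, hp, hq, h1, h2, hpq⟩
  refine ⟨Equiv.swap u b * Equiv.swap u c, swap_mul_swap_mem_budget hu hb hc, ?_, ?_⟩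
  · have h3 := (Equiv.Perm.isThreeCycle_swap_mul_swap_same hub huc hbc).orderOf
    rw [← h3]
    exact pow_orderOf_eq_one _
  · rw [Equiv.Perm.mul_apply, Equiv.swap_apply_left, Equiv.swap_apply_of_ne_of_ne huc.symm hbc.symm]
    exact huc.symm

/-- **Fan-in two symmetric circuits are blind to the free vertices.** For `3 ≤ g ≤ m`, a
`Bud(m,g)`-symmetric circuit with symmetric gates of fan-in `≤ 2` has the same value on any two
matrices that agree on the ORDERED block `{(u,v) : u + g < m, v + g < m}`. [folklore] -/
theorem eval_eq_of_fanIn_two_of_agree {g : ℕ} (hg : 3 ≤ g) (hgm : g ≤ m)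
    (C : Circuit (Fin m × Fin m))
    (h2 : ∀ gt ∈ C.gates, gt.arity ≤ 2) (hsym : ∀ gt ∈ C.gates, gt.fn.IsSymmetric)
    (hS : C.IsSymmetricUnder (pointStabiliserBudget m g)) {x y : Fin m × Fin m → Bool}
    (hxy : ∀ u v : Fin m, (u : ℕ) + g < m → (v : ℕ) + g < m → x (u, v) = y (u, v)) :
    C.eval x = C.eval y := by
  refine eval_eq_of_fanIn_two C h2 hsym hS fun u v huv => hxy u v ?_ ?_
  · by_contra hu
    obtain ⟨ρ, hρ, h3, hne⟩ := exists_threeCycle_moving hg hgm (u := u) (by omega)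
    exact hne (huv ρ hρ h3).1
  · by_contra hv
    obtain ⟨ρ, hρ, h3, hne⟩ := exists_threeCycle_moving hg hgm (u := v) (by omega)
    exact hne (huv ρ hρ h3).2

/-- **Fully symmetric fan-in two circuits compute constants** (`m ≥ 3`): a `Sym(Fin m)`-symmetric
circuit on `m × m` matrices with symmetric gates of fan-in `≤ 2` has the same value on all inputs.
[folklore] -/
theorem eval_eq_of_fanIn_two_univ (hm : 3 ≤ m) (C : Circuit (Fin m × Fin m))
    (h2 : ∀ gt ∈ C.gates, gt.arity ≤ 2) (hsym : ∀ gt ∈ C.gates, gt.fn.IsSymmetric)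
    (hS : C.IsSymmetricUnder Set.univ) (x y : Fin m × Fin m → Bool) : C.eval x = C.eval y := by
  rw [← pointStabiliserBudget_of_le (le_refl m)] at hS
  exact eval_eq_of_fanIn_two_of_agree hm le_rfl C h2 hsym hS fun u v hu _ => absurd hu (by omega)

end Free

/-! ### Hamiltonicity is not computed by fan-in two symmetric circuits -/

section Ham

open Literature.Combinatorics.SimpleGraph

variable {m : ℕ}

/-- The complete graph on `Fin m`, `m ≥ 3`, read off the all-ones matrix, is Hamiltonian
(listing `0, 1, …, m-1`). [folklore] -/
theorem isHamiltonian_fromRel_true (hm : 3 ≤ m) :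
    (SimpleGraph.fromRel fun u v : Fin m => (fun _ : Fin m × Fin m => true) (u, v) = true).IsHamiltonian := by
  have hl : IsHamCycleListing
      (SimpleGraph.fromRel fun u v : Fin m => (fun _ : Fin m × Fin m => true) (u, v) = true).Adj
      (List.finRange m) := by
    refine ⟨List.nodup_finRange m, List.mem_finRange, fun i hi => ?_⟩
    rw [SimpleGraph.fromRel_adj]
    refine ⟨fun h => ?_, Or.inl rfl⟩
    have hv := congrArg Fin.val h
    simp only [List.getElem_finRange, Fin.val_cast, List.length_finRange] at hv
    have hi' : i < m := by simpa using hi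
    by_cases h1 : i + 1 < m
    · rw [Nat.mod_eq_of_lt h1] at hv; omega
    · have : i + 1 = m := by omega
      rw [this, Nat.mod_self] at hv; omega
  exact hl.isHamiltonian (by rw [List.length_finRange]; exact hm)

/-- The matrix of the complete graph with the vertex `w` isolated. [folklore] -/
def isolateMat (w : Fin m) : Fin m × Fin m → Bool := fun q => decide (q.1 ≠ w ∧ q.2 ≠ w)

/-- The graph read off `isolateMat w` has `w` isolated, hence is not Hamiltonian (`m ≥ 3`).
[folklore] -/
theorem not_isHamiltonian_isolateMat (hm : 3 ≤ m) (w : Fin m) :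
    ¬ (SimpleGraph.fromRel fun u v : Fin m => isolateMat w (u, v) = true).IsHamiltonian := by
  intro hH
  have hcard : 3 ≤ Fintype.card (Fin m) := by rw [Fintype.card_fin]; exact hm
  obtain ⟨l, hl⟩ := (isHamiltonian_iff_of_three_le_card _ hcard).1 hH
  obtain ⟨i, hi, hiw⟩ := List.mem_iff_getElem.1 (hl.mem w)
  have hadj := hl.rel i hi
  rw [hiw, SimpleGraph.fromRel_adj] at hadj
  obtain ⟨-, h | h⟩ := hadj
  · simp [isolateMat] at h
  · simp [isolateMat] at h

open scoped Classical in
/-- **No `Bud(m,g)`-symmetric circuit with symmetric gates of fan-in `≤ 2` computes Hamiltonicity**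
(`3 ≤ g ≤ m`), at ANY size: the all-ones matrix and the matrix isolating the free vertex `m - 1`
agree on the ordered block and differ in Hamiltonicity. In particular the conclusions of the
route's cruxes `HamCompiles` / `¬WindowHam` become FALSE outright when the threshold basis is
replaced by a bounded fan-in basis such as `{∧₂, ∨₂, ¬}`: the unbounded fan-in of `tcBasis` is
load-bearing. [folklore] -/
theorem not_computes_ham_of_fanIn_two {g : ℕ} (hg : 3 ≤ g) (hgm : g ≤ m)
    (C : Circuit (Fin m × Fin m))
    (h2 : ∀ gt ∈ C.gates, gt.arity ≤ 2) (hsym : ∀ gt ∈ C.gates, gt.fn.IsSymmetric)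
    (hS : C.IsSymmetricUnder (pointStabiliserBudget m g)) :
    ¬ C.Computes (fun x : Fin m × Fin m → Bool =>
        decide (SimpleGraph.fromRel fun u v => x (u, v) = true : SimpleGraph (Fin m)).IsHamiltonian) := by
  intro hC
  have hm : 3 ≤ m := hg.trans hgm
  let w : Fin m := ⟨m - 1, by omega⟩
  have hw : m ≤ (w : ℕ) + g := by show m ≤ m - 1 + g; omega
  have hagree : ∀ u v : Fin m, (u : ℕ) + g < m → (v : ℕ) + g < m →
      true = isolateMat w (u, v) := by
    intro u v hu hv
    have huw : u ≠ w := fun h => by rw [h] at hu; omega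
    have hvw : v ≠ w := fun h => by rw [h] at hv; omega
    simp [isolateMat, huw, hvw]
  have key := eval_eq_of_fanIn_two_of_agree hg hgm C h2 hsym hS
    (x := fun _ => true) (y := isolateMat w) hagree
  rw [hC, hC] at key
  have h1 := isHamiltonian_fromRel_true hm
  have h0 := not_isHamiltonian_isolateMat hm w
  rw [Bool.eq_iff_iff, decide_eq_true_iff, decide_eq_true_iff] at key
  exact h0 (key.1 h1)

/-- Gates of a `{∧₂, ∨₂, ¬}`-circuit have fan-in `≤ 2`. [folklore] -/
theorem arity_le_two_of_isOver_deMorgan (C : Circuit (Fin m × Fin m)) (hB : C.IsOver deMorganBasis) :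
    ∀ gt ∈ C.gates, gt.arity ≤ 2 := by
  intro gt hgt
  have h := hB gt hgt
  simp only [deMorganBasis, Set.mem_insert_iff, Set.mem_singleton_iff] at h
  rcases h with h | h | h
  · have := congrArg Sigma.fst h; exact le_of_eq this
  · have := congrArg Sigma.fst h; exact le_of_eq this
  · have := congrArg Sigma.fst h
    show gt.fn.1 ≤ 2
    rw [this]; decide

/-- Gates of a `{∧₂, ∨₂, ¬}`-circuit are symmetric gate functions. [folklore] -/
theorem isSymmetric_of_isOver_deMorgan (C : Circuit (Fin m × Fin m)) (hB : C.IsOver deMorganBasis) :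
    ∀ gt ∈ C.gates, gt.fn.IsSymmetric := by
  intro gt hgt
  have h := hB gt hgt
  simp only [deMorganBasis, Set.mem_insert_iff, Set.mem_singleton_iff] at h
  rcases h with h | h | h
  · rw [h]; exact GateFn.isSymmetric_and 2
  · rw [h]; exact GateFn.isSymmetric_or 2
  · rw [h]; exact GateFn.isSymmetric_not

open scoped Classical in
/-- **Over `{∧₂, ∨₂, ¬}` no window-symmetric circuit of any size computes HAM** (`m ≥ 8`, so that
the window `⌊log₂ m⌋ ≥ 3`). [folklore] -/
theorem not_hasSymCircuit_deMorgan_ham (hm : 8 ≤ m) (s : ℕ) :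
    ¬ HasSymCircuit deMorganBasis (pointStabiliserBudget m (Nat.log 2 m)) s
      (fun x : Fin m × Fin m → Bool =>
        decide (SimpleGraph.fromRel fun u v => x (u, v) = true : SimpleGraph (Fin m)).IsHamiltonian) := by
  rintro ⟨C, hB, -, hS, hC⟩
  have hg : 3 ≤ Nat.log 2 m := Nat.le_log_of_pow_le (by norm_num) hm
  have hgm : Nat.log 2 m ≤ m := (Nat.log_lt_self 2 (by omega)).le
  exact not_computes_ham_of_fanIn_two hg hgm C (arity_le_two_of_isOver_deMorgan C hB)
    (isSymmetric_of_isOver_deMorgan C hB) hS hC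

end Ham

/-! ### Generalisation: fan-in below a prime `p` versus input maps of order `p` -/


variable {ι Λ : Type*}

/-- If a list shorter than a prime `p` is a permutation of its image under a map `r` with
`r^[p] = id` on it, then `r` fixes every member (the `r`-orbit of a member stays in the list and
has size `1` or `p`). [folklore] -/
theorem apply_eq_of_perm_map_of_prime {α : Type*} [DecidableEq α] {L : List α} {r : α → α}
    (h : L.Perm (L.map r)) {p : ℕ} (hp : p.Prime) (hL : L.length < p)
    (hr : ∀ a ∈ L, r^[p] a = a) : ∀ a ∈ L, r a = a := by
  intro a ha
  have hcl : ∀ b ∈ L, r b ∈ L := fun b hb => h.symm.subset (List.mem_map.2 ⟨b, hb, rfl⟩)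
  have hit : ∀ n, r^[n] a ∈ L := by
    intro n
    induction n with
    | zero => simpa using ha
    | succ n ih => rw [Function.iterate_succ_apply']; exact hcl _ ih
  have hper : Function.IsPeriodicPt r p a := hr a ha
  rcases (Nat.dvd_prime hp).1 hper.minimalPeriod_dvd with h1 | hpp
  · exact Function.minimalPeriod_eq_one_iff_isFixedPt.1 h1
  · exfalso
    have hinj : Set.InjOn (fun n => r^[n] a) (Set.Iio p) := by
      rw [← hpp]; exact Function.iterate_injOn_Iio_minimalPeriod
    have hcard : (Finset.range p).card ≤ L.toFinset.card := by
      refine Finset.card_le_card_of_injOn (fun n => r^[n] a) (fun n _ => List.mem_toFinset.2 (hit n)) ?_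
      intro n hn n' hn' he
      exact hinj (Set.mem_Iio.2 (Finset.mem_range.1 (Finset.mem_coe.1 hn)))
        (Set.mem_Iio.2 (Finset.mem_range.1 (Finset.mem_coe.1 hn'))) he
    rw [Finset.card_range] at hcard
    have := List.toFinset_card_le L
    omega

section RigidPrime

variable (R : GateDAG ι Λ)

/-- Iterating an automorphism: `θ ^ n` is an automorphism over `π^[n]`. [folklore] -/
theorem isAut_pow {π : ι → ι} {θ : Λ ≃ Λ} (h : R.IsAut π θ) : ∀ n : ℕ, R.IsAut (π^[n]) (θ ^ n)
  | 0 => by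
    rw [Function.iterate_zero, pow_zero]
    exact R.isAut_id_refl
  | n + 1 => by
    rw [Function.iterate_succ, pow_succ, Equiv.Perm.mul_def]
    exact IsAut.trans R h (isAut_pow h n)

/-- In a rigid DAG, an automorphism over an input map of order dividing `p` has order dividing `p`.
[folklore] -/
theorem pow_eq_one_of_rigid (hR : R.IsRigidDAG) {π : ι → ι} {p : ℕ} (hπ : π^[p] = _root_.id)
    {θ : Λ ≃ Λ} (h : R.IsAut π θ) : θ ^ p = 1 := by
  have hp := isAut_pow R h p
  rw [hπ] at hp
  exact hR _ _ _ hp R.isAut_id_refl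

variable {R}

/-- Iterates of the wire relabelling. [folklore] -/
theorem rel_iterate (π : ι → ι) (θ : Λ ≃ Λ) (n : ℕ) (w : ι ⊕ Λ) :
    (rel π θ)^[n] w = rel (π^[n]) (θ ^ n) w := by
  induction n generalizing w with
  | zero => rcases w with i | m <;> simp [rel]
  | succ n ih =>
    rw [Function.iterate_succ_apply, ih]
    rcases w with i | m
    · simp [rel]
    · simp only [rel, Sum.map_inr, Sum.inr.injEq]
      rw [pow_succ, Equiv.Perm.mul_apply]

/-- **Prime order beats small fan-in.** In a rigid DAG, if the automorphism `θ` over an input map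
`π` with `π^[p] = id` (`p` prime) fixes a gate of fan-in `< p`, then the relabelling `rel π θ`
fixes every child wire of that gate. [folklore] -/
theorem rel_args_eq_of_prime [DecidableEq ι] [DecidableEq Λ] (hR : R.IsRigidDAG)
    {p : ℕ} (hp : p.Prime) {π : ι → ι} (hπ : π^[p] = _root_.id) {θ : Λ ≃ Λ} (h : R.IsAut π θ)
    {l : Λ} (hl : θ l = l) (hlt : (R.fn l).1 < p) (a : Fin (R.fn l).1) :
    rel π θ (R.args l a) = R.args l a := by
  have hθp : θ ^ p = 1 := pow_eq_one_of_rigid R hR hπ h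
  have hperm := h.args_perm l
  rw [hl] at hperm
  refine apply_eq_of_perm_map_of_prime hperm hp (by rw [List.length_ofFn]; exact hlt)
    (fun w _ => ?_) _ (List.mem_ofFn.2 ⟨a, rfl⟩)
  rw [rel_iterate, hπ, hθp]
  rcases w with i | m <;> rfl

end RigidPrime

section BlindPrime

variable {R : GateDAG ι Λ}

/-- `val_eq_of_fixed` for fan-in `< p` and input maps of order dividing the prime `p`. [folklore] -/
theorem val_eq_of_fixed_prime [DecidableEq ι] [DecidableEq Λ] (hR : R.IsRigidDAG) {p : ℕ}
    (hp : p.Prime) (hlt : ∀ l, (R.fn l).1 < p) {P : Set (ι → ι)} (hP : ∀ π ∈ P, π^[p] = _root_.id)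
    (θ : ∀ π ∈ P, Λ ≃ Λ) (hθ : ∀ π (hπ : π ∈ P), R.IsAut π (θ π hπ))
    {x y : ι → Bool} (hxy : ∀ i, (∀ π ∈ P, π i = i) → x i = y i) :
    ∀ l, (∀ π (hπ : π ∈ P), θ π hπ l = l) → R.val x l = R.val y l := by
  intro l
  induction l using R.wf.induction with
  | _ l ih =>
    intro hfix
    rw [R.val_eq, R.val_eq]
    refine congrArg (R.fn l).2 (funext fun a => ?_)
    have hchild : ∀ π (hπ : π ∈ P), rel π (θ π hπ) (R.args l a) = R.args l a :=
      fun π hπ => rel_args_eq_of_prime hR hp (hP π hπ) (hθ π hπ) (hfix π hπ) (hlt l) a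
    cases ha : R.args l a with
    | inl i =>
      simp only [wire_inl]
      refine hxy i fun π hπ => ?_
      have := hchild π hπ
      rw [ha] at this
      exact Sum.inl.inj this
    | inr m =>
      simp only [wire_inr]
      refine ih m ⟨a, ha⟩ fun π hπ => ?_
      have := hchild π hπ
      rw [ha] at this
      exact Sum.inr.inj this

/-- `evalOut_eq_of_fixed` for fan-in `< p` and input maps of order dividing the prime `p`.
[folklore] -/
theorem evalOut_eq_of_fixed_prime [DecidableEq ι] [DecidableEq Λ] (hR : R.IsRigidDAG) {p : ℕ}
    (hp : p.Prime) (hlt : ∀ l, (R.fn l).1 < p) {P : Set (ι → ι)} (hP : ∀ π ∈ P, π^[p] = _root_.id)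
    (θ : ∀ π ∈ P, Λ ≃ Λ) (hθ : ∀ π (hπ : π ∈ P), R.IsAut π (θ π hπ))
    {x y : ι → Bool} (hxy : ∀ i, (∀ π ∈ P, π i = i) → x i = y i) :
    R.evalOut x = R.evalOut y := by
  unfold evalOut
  cases ho : R.out with
  | inl i =>
    simp only [wire_inl]
    refine hxy i fun π hπ => ?_
    have := (hθ π hπ).out_eq
    rw [ho] at this
    exact Sum.inl.inj this
  | inr l =>
    simp only [wire_inr]
    refine val_eq_of_fixed_prime hR hp hlt hP θ hθ hxy l fun π hπ => ?_
    have := (hθ π hπ).out_eq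
    rw [ho] at this
    exact Sum.inr.inj this

end BlindPrime


/-! ### Matrix circuits: fan-in below a prime `p ≤ g` -/

section MatrixPrime

open GateDAG

variable {m : ℕ}

/-- Iterates of the diagonal map. [folklore] -/
theorem diagMap_iterate (ρ : Equiv.Perm (Fin m)) (n : ℕ) : (diagMap ρ)^[n] = diagMap (ρ ^ n) := by
  induction n with
  | zero => funext q; simp [diagMap]
  | succ n ih =>
    funext q
    rw [Function.iterate_succ_apply', ih]
    simp [diagMap, pow_succ']

/-- **Symmetric circuits of fan-in `< p` see only the positions fixed by the budget elements of
order dividing `p`** (`p` prime). [folklore] -/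
theorem eval_eq_of_fanIn_lt_prime {g p : ℕ} (hp : p.Prime) (C : Circuit (Fin m × Fin m))
    (hlt : ∀ gt ∈ C.gates, gt.arity < p) (hsym : ∀ gt ∈ C.gates, gt.fn.IsSymmetric)
    (hS : C.IsSymmetricUnder (pointStabiliserBudget m g)) {x y : Fin m × Fin m → Bool}
    (hxy : ∀ u v : Fin m,
      (∀ ρ ∈ pointStabiliserBudget m g, ρ ^ p = 1 → ρ u = u ∧ ρ v = v) → x (u, v) = y (u, v)) :
    C.eval x = C.eval y := by
  classical
  let D := GateDAG.ofCircuit C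
  have hfs : ∀ l, (D.fn l).IsSymmetric := fun l => hsym _ (List.getElem_mem _)
  have hDs : D.IsSymm (GateDAG.diagMaps (pointStabiliserBudget m g)) :=
    (GateDAG.isSymmetricUnder_iff_ofCircuit C _).1 hS
  let R := D.reduce
  have hR : R.IsRigidDAG := D.isRigidDAG_reduce
  have hp2 : 2 ≤ p := hp.two_le
  have hRlt : ∀ l, (R.fn l).1 < p := by
    rintro (q | c)
    · show (D.fn q.out.1).1 < p
      exact hlt _ (List.getElem_mem _)
    · show 1 < p
      omega
  have hdiag : ∀ ρ : Equiv.Perm (Fin m),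
      (⇑(Equiv.prodCongr ρ ρ) : Fin m × Fin m → Fin m × Fin m) = diagMap ρ :=
    fun ρ => funext fun q => rfl
  have hAut : ∀ ρ ∈ pointStabiliserBudget m g, ∃ θ : D.RGate ≃ D.RGate, R.IsAut (diagMap ρ) θ := by
    intro ρ hρ
    obtain ⟨θ, hθ⟩ := hDs _ (GateDAG.diag_mem_diagMaps hρ)
    have hθ' : D.IsAut (⇑(Equiv.prodCongr ρ ρ)) θ := by rw [hdiag]; exact hθ
    exact ⟨_, by have := hθ'.reduce; rwa [hdiag] at this⟩
  let P : Set (Fin m × Fin m → Fin m × Fin m) :=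
    {π | ∃ ρ ∈ pointStabiliserBudget m g, ρ ^ p = 1 ∧ π = diagMap ρ}
  have hP : ∀ π ∈ P, π^[p] = _root_.id := by
    rintro π ⟨ρ, -, hρp, rfl⟩
    rw [diagMap_iterate, hρp]
    funext q; simp [diagMap]
  have hPaut : ∀ π ∈ P, ∃ θ : D.RGate ≃ D.RGate, R.IsAut π θ := by
    rintro π ⟨ρ, hρ, -, rfl⟩
    exact hAut ρ hρ
  choose θ hθ using hPaut
  have hxy' : ∀ i : Fin m × Fin m, (∀ π ∈ P, π i = i) → x i = y i := by
    rintro ⟨u, v⟩ hi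
    refine hxy u v fun ρ hρ hρp => ?_
    have := hi (diagMap ρ) ⟨ρ, hρ, hρp, rfl⟩
    simp only [diagMap, Prod.mk.injEq] at this
    exact this
  have key := evalOut_eq_of_fixed_prime hR hp hRlt hP θ hθ hxy'
  rw [← GateDAG.evalOut_ofCircuit C x, ← GateDAG.evalOut_ofCircuit C y,
    ← GateDAG.evalOut_reduce _ hfs x, ← GateDAG.evalOut_reduce _ hfs y]
  exact key

/-- **Every free vertex lies on a `p`-cycle of free vertices** (`p ≤ g ≤ m`, `2 ≤ p`): an element
of the budget of order dividing `p` moving it. [folklore] -/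
theorem exists_cycle_moving {g p : ℕ} (hp : 2 ≤ p) (hpg : p ≤ g) (hgm : g ≤ m) {u : Fin m}
    (hu : m ≤ (u : ℕ) + g) :
    ∃ ρ ∈ pointStabiliserBudget m g, ρ ^ p = 1 ∧ ρ u ≠ u := by
  classical
  -- a duplicate-free list of `p` free vertices containing `u`
  obtain ⟨l, hnd, hlen, hul, hfree⟩ : ∃ l : List (Fin m), l.Nodup ∧ l.length = p ∧ u ∈ l ∧
      ∀ v ∈ l, m ≤ (v : ℕ) + g := by
    by_cases hcase : m ≤ (u : ℕ) + p
    · -- `u` is among the last `p` vertices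
      refine ⟨List.ofFn fun j : Fin p => (⟨m - 1 - j, by omega⟩ : Fin m), ?_, by simp, ?_, ?_⟩
      · rw [List.nodup_ofFn]
        intro j j' h
        simp only [Fin.mk.injEq] at h
        exact Fin.ext (by omega)
      · rw [List.mem_ofFn]
        refine ⟨⟨m - 1 - u, by omega⟩, Fin.ext ?_⟩
        show m - 1 - (m - 1 - (u : ℕ)) = u
        omega
      · intro v hv
        rw [List.mem_ofFn] at hv
        obtain ⟨j, rfl⟩ := hv
        show m ≤ m - 1 - j + g
        omega
    · -- `u` is free but below the last `p` vertices: `u` followed by the last `p - 1` vertices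
      refine ⟨u :: List.ofFn fun j : Fin (p - 1) => (⟨m - 1 - j, by omega⟩ : Fin m), ?_, ?_,
        List.mem_cons_self, ?_⟩
      · rw [List.nodup_cons, List.mem_ofFn, List.nodup_ofFn]
        refine ⟨?_, fun j j' h => ?_⟩
        · rintro ⟨j, hj⟩
          have := congrArg Fin.val hj
          simp only at this
          omega
        · simp only [Fin.mk.injEq] at h
          exact Fin.ext (by omega)
      · rw [List.length_cons, List.length_ofFn]; omega
      · intro v hv
        rw [List.mem_cons, List.mem_ofFn] at hv
        rcases hv with rfl | ⟨j, rfl⟩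
        · exact hu
        · show m ≤ m - 1 - j + g
          omega
  refine ⟨l.formPerm, ?_, ?_, ?_⟩
  · rw [mem_pointStabiliserBudget_iff]
    intro i hi
    exact List.formPerm_apply_of_notMem fun him => by have := hfree i him; omega
  · rw [← hlen]
    exact List.formPerm_pow_length_eq_one_of_nodup l hnd
  · rw [List.formPerm_apply_mem_ne_self_iff l hnd u hul, hlen]
    exact hp

/-- **Symmetric circuits of fan-in `< p` are blind to the free vertices** (`p` prime,
`p ≤ g ≤ m`): two matrices agreeing on the ordered block get the same value. In particular
(Bertrand) fan-in `≤ g / 2` suffices. [folklore] -/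
theorem eval_eq_of_fanIn_lt_prime_of_agree {g p : ℕ} (hp : p.Prime) (hpg : p ≤ g)
    (hgm : g ≤ m) (C : Circuit (Fin m × Fin m))
    (hlt : ∀ gt ∈ C.gates, gt.arity < p) (hsym : ∀ gt ∈ C.gates, gt.fn.IsSymmetric)
    (hS : C.IsSymmetricUnder (pointStabiliserBudget m g)) {x y : Fin m × Fin m → Bool}
    (hxy : ∀ u v : Fin m, (u : ℕ) + g < m → (v : ℕ) + g < m → x (u, v) = y (u, v)) :
    C.eval x = C.eval y := by
  refine eval_eq_of_fanIn_lt_prime hp C hlt hsym hS fun u v huv => hxy u v ?_ ?_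
  · by_contra hu
    obtain ⟨ρ, hρ, h3, hne⟩ := exists_cycle_moving hp.two_le hpg hgm (u := u) (by omega)
    exact hne (huv ρ hρ h3).1
  · by_contra hv
    obtain ⟨ρ, hρ, h3, hne⟩ := exists_cycle_moving hp.two_le hpg hgm (u := v) (by omega)
    exact hne (huv ρ hρ h3).2

open scoped Classical in
/-- **A symmetric circuit for Hamiltonicity needs a gate of fan-in `≥ p` for every prime
`p ≤ g`** (`g ≤ m`, `3 ≤ g`): with all fan-ins below a prime `p ≤ g` the circuit is blind to the
free vertices. [folklore] -/
theorem exists_gate_arity_ge_prime_of_computes_ham {g p : ℕ} (hp : p.Prime) (hpg : p ≤ g)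
    (hg : 3 ≤ g) (hgm : g ≤ m) (C : Circuit (Fin m × Fin m))
    (hsym : ∀ gt ∈ C.gates, gt.fn.IsSymmetric) (hS : C.IsSymmetricUnder (pointStabiliserBudget m g))
    (hC : C.Computes (fun x : Fin m × Fin m → Bool =>
        decide (SimpleGraph.fromRel fun u v => x (u, v) = true : SimpleGraph (Fin m)).IsHamiltonian)) :
    ∃ gt ∈ C.gates, p ≤ gt.arity := by
  by_contra hno
  push Not at hno
  have hm : 3 ≤ m := hg.trans hgm
  let w : Fin m := ⟨m - 1, by omega⟩
  have hagree : ∀ u v : Fin m, (u : ℕ) + g < m → (v : ℕ) + g < m →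
      true = isolateMat w (u, v) := by
    intro u v hu hv
    have huw : u ≠ w := fun h => by rw [h] at hu; change m - 1 + g < m at hu; omega
    have hvw : v ≠ w := fun h => by rw [h] at hv; change m - 1 + g < m at hv; omega
    simp [isolateMat, huw, hvw]
  have key := eval_eq_of_fanIn_lt_prime_of_agree hp hpg hgm C hno hsym hS
    (x := fun _ => true) (y := isolateMat w) hagree
  rw [hC, hC] at key
  rw [Bool.eq_iff_iff, decide_eq_true_iff, decide_eq_true_iff] at key
  exact not_isHamiltonian_isolateMat hm w (key.1 (isHamiltonian_fromRel_true hm))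

open scoped Classical in
/-- **At the window, a symmetric threshold circuit for `HAM_m` has a gate of fan-in more than
`⌊log₂ m⌋ / 2`** (`m ≥ 8`; Bertrand's postulate supplies a prime in `(⌊log₂ m⌋/2, ⌊log₂ m⌋]`).
[folklore] -/
theorem exists_gate_arity_gt_half_log_of_computes_ham (hm : 8 ≤ m)
    (C : Circuit (Fin m × Fin m)) (hB : C.IsOver tcBasis)
    (hS : C.IsSymmetricUnder (pointStabiliserBudget m (Nat.log 2 m)))
    (hC : C.Computes (fun x : Fin m × Fin m → Bool =>
        decide (SimpleGraph.fromRel fun u v => x (u, v) = true : SimpleGraph (Fin m)).IsHamiltonian)) :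
    ∃ gt ∈ C.gates, Nat.log 2 m / 2 < gt.arity := by
  have hg : 3 ≤ Nat.log 2 m := Nat.le_log_of_pow_le (by norm_num) hm
  have hgm : Nat.log 2 m ≤ m := (Nat.log_lt_self 2 (by omega)).le
  obtain ⟨p, hp, hlp, hple⟩ := Nat.exists_prime_lt_and_le_two_mul (Nat.log 2 m / 2) (by omega)
  have hpg : p ≤ Nat.log 2 m := by omega
  obtain ⟨gt, hgt, hge⟩ := exists_gate_arity_ge_prime_of_computes_ham hp hpg hg hgm C
    (fun gt hgt => isSymmetric_of_mem_tcBasis (hB gt hgt)) hS hC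
  exact ⟨gt, hgt, by omega⟩

end MatrixPrime


end Summit.PneNP.PneNP.Cruxes.HamCompiles.FanInLib

namespace Summit.PneNP.PneNP.Cruxes.HamCompiles.Disproof

open Literature.Computability.Complexity
open Summit.PneNP.PneNP.Theses.SymmetryBudget (HamCompiles WindowHam PolylogHam Symmetrise)

/-! ### §0 Vocabulary (verbatim the route's inline `let`s) -/

open scoped Classical in
/-- `HAM_m`: the route's target function `x ↦ [Gr m x is Hamiltonian]` on `m × m` Boolean
matrices (classical `decide`, as in the route file). -/
noncomputable def hamFn (m : ℕ) : (Fin m × Fin m → Bool) → Bool :=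
  fun x : Fin m × Fin m → Bool =>
    decide (SimpleGraph.fromRel fun u v => x (u, v) = true : SimpleGraph (Fin m)).IsHamiltonian

/-- `Bud(m,g)`: the route's symmetry budget = `pointStabiliserBudget`. -/
abbrev Bud (m g : ℕ) : Set (Equiv.Perm (Fin m)) := pointStabiliserBudget m g

/-- The bare CONCLUSION of the crux (hypothesis `NP ⊆ P` dropped): poly-size
Bud(m,⌊log₂ m⌋)-symmetric threshold circuits for HAM at every `m`. -/
def Concl : Prop :=
  ∃ p : Polynomial ℕ, ∀ m : ℕ,
    HasSymCircuit tcBasis (Bud m (Nat.log 2 m)) (p.eval m) (hamFn m)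

/-- Cook's hypothesis of the crux. -/
def NPsubP : Prop := PNPWave0.NP Bool ⊆ PNPWave0.P Bool

/-- The crux unfolds, definitionally, to `NPsubP → Concl`. -/
theorem hamCompiles_iff : HamCompiles ↔ (NPsubP → Concl) := Iff.rfl

/-- Crux #2 unfolds, definitionally, to the frequently-often failure of `HasSymCircuit`. -/
theorem windowHam_iff :
    WindowHam ↔ ∀ p : Polynomial ℕ, ∃ᶠ m in Filter.atTop,
      ¬ HasSymCircuit tcBasis (Bud m (Nat.log 2 m)) (p.eval m) (hamFn m) := Iff.rfl

/-- The summit is, definitionally up to `Set.not_subset`, the negation of the hypothesis. -/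
theorem pneNP_iff_not_NPsubP : PneNP ↔ ¬ NPsubP :=
  (Set.not_subset (s := PNPWave0.NP Bool) (t := PNPWave0.P Bool)).symm

/-! ### §1 Irrefutability -/

/-- The summit implies the crux (vacuously): so `¬HamCompiles ⊢ ¬PneNP`. -/
theorem hamCompiles_of_pneNP (h : PneNP) : HamCompiles :=
  hamCompiles_iff.2 fun hsub => absurd hsub (pneNP_iff_not_NPsubP.1 h)

/-- Any refutation of the crux proves `NP ⊆ P` over `{0,1}` (Cook's classes). -/
theorem NPsubP_of_not_hamCompiles (h : ¬ HamCompiles) : NPsubP := by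
  by_contra hn
  exact h (hamCompiles_iff.2 fun hsub => absurd hsub hn)

/-- Exact content of a refutation: `NP ⊆ P` together with the failure of the compilation. -/
theorem not_hamCompiles_iff : ¬ HamCompiles ↔ NPsubP ∧ ¬ Concl := by
  rw [hamCompiles_iff]; exact Classical.not_imp

/-! ### §2 Logical position inside the route -/

/-- `HamCompiles ↔ PneNP ∨ Concl`. -/
theorem hamCompiles_iff_pneNP_or_concl : HamCompiles ↔ PneNP ∨ Concl := by
  rw [hamCompiles_iff, pneNP_iff_not_NPsubP]; exact imp_iff_not_or

/-- Load-bearing analysis: the conclusion with the hypothesis dropped is denied by crux #2. -/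
theorem not_windowHam_of_concl (h : Concl) : ¬ WindowHam := by
  intro hW
  obtain ⟨p, hp⟩ := h
  obtain ⟨m, hm⟩ := ((windowHam_iff.1 hW) p).exists
  exact hm (hp m)

/-- Equivalently: crux #2 refutes the hypothesis-free conclusion. -/
theorem not_concl_of_windowHam (hW : WindowHam) : ¬ Concl := fun h => not_windowHam_of_concl h hW

/-- Modulo crux #2, crux #3 IS the summit. -/
theorem hamCompiles_iff_pneNP_of_windowHam (hW : WindowHam) : HamCompiles ↔ PneNP := by
  rw [hamCompiles_iff_pneNP_or_concl]
  exact ⟨fun h => h.elim id fun hc => absurd hc (not_concl_of_windowHam hW), Or.inl⟩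

/-! ### §3 The non-uniform strengthening collapses the window onto general circuits -/

/-- Poly-size GENERAL (not necessarily symmetric) threshold circuits for HAM at every `m`
(the matrix-input form of `HAMCIRCUIT ∈ P/poly`). -/
def HamPolySize : Prop :=
  ∃ p : Polynomial ℕ, ∀ m : ℕ, ∃ C : Circuit (Fin m × Fin m),
    C.IsOver tcBasis ∧ C.size ≤ p.eval m ∧ C.Computes (hamFn m)

/-- The NON-UNIFORM strengthening of the crux: poly-size general circuits for HAM already compile
into poly-size Bud(m,⌊log₂ m⌋)-symmetric ones. Every circuit-based compilation of the intended
kind (NP ⊆ P ⇒ HAMCIRCUIT ∈ P ⇒ poly-size circuits ⇒ equivariant rewrite) proves this. -/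
def HamCompilesNU : Prop := HamPolySize → Concl

/-- Symmetric circuits are circuits. -/
theorem hamPolySize_of_concl (h : Concl) : HamPolySize := by
  obtain ⟨p, hp⟩ := h
  refine ⟨p, fun m => ?_⟩
  obtain ⟨C, hB, hs, -, hf⟩ := hp m
  exact ⟨C, hB, hs, hf⟩

/-- The non-uniform crux says exactly: for HAM, window-symmetric poly-size = general poly-size. -/
theorem hamCompilesNU_iff : HamCompilesNU ↔ (HamPolySize ↔ Concl) :=
  ⟨fun h => ⟨h, hamPolySize_of_concl⟩, fun h => h.1⟩

/-- With the (intended, non-uniform) bridge `NP ⊆ P → HamPolySize`, the NU form gives the crux. -/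
theorem hamCompiles_of_NU (bridge : NPsubP → HamPolySize) (h : HamCompilesNU) : HamCompiles :=
  hamCompiles_iff.2 fun hsub => h (bridge hsub)

/-- COLLAPSE: under the non-uniform compilation, crux #2 (a SYMMETRIC lower bound in the window)
is already a GENERAL circuit lower bound for HAM (`¬HamPolySize`, the `∃ m` form of
"HAM has no poly-size threshold circuits"). -/
theorem not_hamPolySize_of_NU_of_windowHam (h : HamCompilesNU) (hW : WindowHam) :
    ¬ HamPolySize := fun hP => not_concl_of_windowHam hW (h hP)

/-- … and conversely a general lower bound is trivially a symmetric one (`∃ m` form). -/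
theorem windowHamE_of_not_hamPolySize (h : ¬ HamPolySize) (p : Polynomial ℕ) :
    ∃ m, ¬ HasSymCircuit tcBasis (Bud m (Nat.log 2 m)) (p.eval m) (hamFn m) := by
  by_contra hall
  push Not at hall
  exact h (hamPolySize_of_concl ⟨p, hall⟩)

/-! ### §4 Padding: `∀ m` vs `∀ᶠ m`, `∃ m` vs `∃ᶠ m` -/

/-- Per-`m` existence of SOME Bud-symmetric threshold circuit for HAM_m (what item `Symmetrise`,
or a symmetric DNF, provides; HAM is Bud-invariant). -/
def PerMExists : Prop :=
  ∀ m : ℕ, ∃ s : ℕ, HasSymCircuit tcBasis (Bud m (Nat.log 2 m)) s (hamFn m)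

/-- Padding a polynomial by a constant that covers finitely many exceptional `m`. -/
theorem exists_poly_cover (p : Polynomial ℕ) (M : ℕ) (s : ℕ → ℕ) :
    ∃ p' : Polynomial ℕ, (∀ m, p.eval m ≤ p'.eval m) ∧ ∀ m < M, s m ≤ p'.eval m := by
  refine ⟨p + Polynomial.C (∑ i ∈ Finset.range M, s i), fun m => ?_, fun m hm => ?_⟩
  · simp
  · simp only [Polynomial.eval_add, Polynomial.eval_C]
    exact le_add_left (Finset.single_le_sum (f := s) (fun _ _ => Nat.zero_le _)
      (Finset.mem_range.2 hm))

/-- Given per-`m` existence, the conclusion for all `m` follows from the conclusion for all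
large `m` (provers may ignore small `m`). -/
theorem concl_of_eventually (hex : PerMExists)
    (h : ∃ p : Polynomial ℕ, ∀ᶠ m in Filter.atTop,
      HasSymCircuit tcBasis (Bud m (Nat.log 2 m)) (p.eval m) (hamFn m)) : Concl := by
  obtain ⟨p, hp⟩ := h
  obtain ⟨M, hM⟩ := Filter.eventually_atTop.1 hp
  choose s hs using hex
  obtain ⟨p', hpp', hsp'⟩ := exists_poly_cover p M s
  refine ⟨p', fun m => ?_⟩
  by_cases hm : m < M
  · exact (hs m).mono (hsp' m hm)
  · exact (hM m (Nat.not_lt.1 hm)).mono (hpp' m)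

/-- Given per-`m` existence, the `∃ m` form of crux #2 upgrades to its `∃ᶠ m` form. -/
theorem windowHam_of_windowHamE (hex : PerMExists)
    (h : ∀ p : Polynomial ℕ, ∃ m, ¬ HasSymCircuit tcBasis (Bud m (Nat.log 2 m)) (p.eval m) (hamFn m)) :
    WindowHam := by
  rw [windowHam_iff]
  intro p
  rw [Filter.frequently_atTop]
  intro M
  choose s hs using hex
  obtain ⟨p', hpp', hsp'⟩ := exists_poly_cover p M s
  obtain ⟨m, hm⟩ := h p'
  refine ⟨m, ?_, fun hms => hm (hms.mono (hpp' m))⟩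
  by_contra hlt
  exact hm ((hs m).mono (hsp' m (Nat.lt_of_not_le hlt)))

/-- Hence, under the non-uniform compilation and per-`m` existence, crux #2 is EQUIVALENT to the
general lower bound `¬HamPolySize`. -/
theorem windowHam_iff_not_hamPolySize (hNU : HamCompilesNU) (hex : PerMExists) :
    WindowHam ↔ ¬ HamPolySize :=
  ⟨not_hamPolySize_of_NU_of_windowHam hNU,
    fun h => windowHam_of_windowHamE hex (windowHamE_of_not_hamPolySize h)⟩

/-! ### §5 Degenerate parameters -/

/-- For `m ≤ 3` the budget `⌊log₂ m⌋ ≤ 1` frees at most one vertex: the group is trivial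
(first non-trivial instance: `m = 4`, `Bud(4,2) ∋ (2 3)`). -/
theorem bud_log_eq_of_le_three {m : ℕ} (hm : m ≤ 3) : Bud m (Nat.log 2 m) = {1} := by
  have hlog : Nat.log 2 m ≤ 1 := by
    interval_cases m <;> decide
  ext ρ
  simp only [Bud, mem_pointStabiliserBudget_iff, Set.mem_singleton_iff]
  constructor
  · intro h
    refine Equiv.ext fun i => ?_
    show ρ i = i
    by_cases hi : (i : ℕ) + Nat.log 2 m < m
    · exact h i hi
    · by_contra hne
      have hj : ((ρ i : Fin m) : ℕ) + Nat.log 2 m < m := by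
        have h1 : ((ρ i : Fin m) : ℕ) ≠ (i : ℕ) := fun e => hne (Fin.ext e)
        have h2 := (ρ i).2
        have h3 := i.2
        omega
      exact hne (ρ.injective (h (ρ i) hj))
  · rintro rfl i _
    rfl

/-- The swap of the two free vertices lies in `Bud(4, ⌊log₂ 4⌋) = Bud(4,2)`: first non-trivial
budget. -/
theorem swap_mem_bud_four : Equiv.swap (2 : Fin 4) 3 ∈ Bud 4 (Nat.log 2 4) := by
  have : Nat.log 2 4 = 2 := by decide
  rw [this]
  intro i hi
  have hi' : (i : ℕ) < 2 := by omega
  have hne2 : i ≠ 2 := fun e => by subst e; simp at hi'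
  have hne3 : i ≠ 3 := fun e => by subst e; simp at hi'
  exact Equiv.swap_apply_of_ne_of_ne hne2 hne3

/-- `HAM_0 = false`: `Fin 0` has `card ≠ 1` and no vertex. -/
theorem hamFn_zero : hamFn 0 = fun _ => false := by
  funext x
  simp only [hamFn, decide_eq_false_iff_not, SimpleGraph.IsHamiltonian]
  intro h
  obtain ⟨a, -⟩ := h (by simp)
  exact a.elim0

/-- `HAM_1 = true` by Mathlib's convention (`card = 1`). -/
theorem hamFn_one : hamFn 1 = fun _ => true := by
  funext x
  simp only [hamFn, decide_eq_true_eq, SimpleGraph.IsHamiltonian]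
  intro h
  simp at h

/-- `HAM_2 = false`: a Hamiltonian cycle is a cycle, of length ≥ 3, but has length `card = 2`. -/
theorem hamFn_two : hamFn 2 = fun _ => false := by
  funext x
  simp only [hamFn, decide_eq_false_iff_not, SimpleGraph.IsHamiltonian]
  intro h
  obtain ⟨a, p, hp⟩ := h (by simp)
  have h3 := hp.isCycle.three_le_length
  have h2 := hp.length_eq
  simp at h2
  omega

/-- The arity-0 conjunction is the constant `true` gate. -/
theorem gateFn_const_true_eq : (⟨0, fun _ => true⟩ : GateFn) = GateFn.and 0 := by
  simp only [GateFn.and]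
  exact Sigma.ext rfl (heq_of_eq (funext fun v => by simp))

/-- The arity-0 disjunction is the constant `false` gate. -/
theorem gateFn_const_false_eq : (⟨0, fun _ => false⟩ : GateFn) = GateFn.or 0 := by
  simp only [GateFn.or]
  exact Sigma.ext rfl (heq_of_eq (funext fun v => by simp))

/-- Constant gates are in `tcBasis` (as `∧₀`, `∨₀`). -/
theorem gateFn_const_mem_tcBasis (b : Bool) : (⟨0, fun _ => b⟩ : GateFn) ∈ tcBasis := by
  refine acBasis_subset_tcBasis (Or.inr (Set.mem_iUnion.2 ⟨0, ?_⟩))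
  cases b
  · rw [gateFn_const_false_eq]; exact Or.inr rfl
  · rw [gateFn_const_true_eq]; exact Or.inl rfl

/-- The one-gate constant circuit is symmetric under EVERY set of permutations (it has no input
wires; `σ = 1`). -/
theorem const_isSymmetricUnder (m : ℕ) (b : Bool) (Γ : Set (Equiv.Perm (Fin m))) :
    (Circuit.const (Fin m × Fin m) b).IsSymmetricUnder Γ := by
  intro ρ _
  refine ⟨1, rfl, fun j => ?_⟩
  have hlen : (Circuit.const (Fin m × Fin m) b).gates.length = 1 := rfl
  have hj : j = ⟨0, hlen ▸ Nat.zero_lt_one⟩ := Fin.ext (by have := j.2; omega)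
  subst hj
  exact ⟨rfl, by simp [Circuit.const]⟩

/-- A constant is computed by a size-1 circuit symmetric under every `Γ`. -/
theorem hasSymCircuit_const (m : ℕ) (Γ : Set (Equiv.Perm (Fin m))) (b : Bool) :
    HasSymCircuit tcBasis Γ 1 (fun _ : Fin m × Fin m → Bool => b) := by
  refine ⟨Circuit.const (Fin m × Fin m) b, ?_, le_rfl, const_isSymmetricUnder m b Γ,
    fun x => Circuit.eval_const b x⟩
  intro g hg
  simp only [Circuit.const, List.mem_singleton] at hg
  subst hg
  exact gateFn_const_mem_tcBasis b

/-- Corners: `HAM_0, HAM_1, HAM_2` are constants, of symmetric size `1` under any budget — the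
`∀ m` of the conclusion costs nothing at the corners (a polynomial absorbs them). -/
theorem hasSymCircuit_hamFn_corners :
    HasSymCircuit tcBasis (Bud 0 (Nat.log 2 0)) 1 (hamFn 0) ∧
    HasSymCircuit tcBasis (Bud 1 (Nat.log 2 1)) 1 (hamFn 1) ∧
    HasSymCircuit tcBasis (Bud 2 (Nat.log 2 2)) 1 (hamFn 2) := by
  refine ⟨?_, ?_, ?_⟩
  · rw [hamFn_zero]; exact hasSymCircuit_const 0 _ false
  · rw [hamFn_one]; exact hasSymCircuit_const 1 _ true
  · rw [hamFn_two]; exact hasSymCircuit_const 2 _ false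

/-! ### §6 The general side needs no hypothesis: `WindowHam ↔ HAM ∉ SIZE^tc(poly)` under NU -/

/-- The plain non-uniform circuit lower bound for Hamiltonicity (matrix inputs, threshold basis):
for every polynomial `p`, infinitely often NO `tcBasis` circuit of size `≤ p m` computes `HAM_m`.
This is `HAMCIRCUIT ∉ P/poly` in the route's input convention. -/
def HamHardIO : Prop :=
  ∀ p : Polynomial ℕ, ∃ᶠ m in Filter.atTop, ¬ ∃ C : Circuit (Fin m × Fin m),
    C.IsOver tcBasis ∧ C.size ≤ p.eval m ∧ C.Computes (hamFn m)

/-- `{∧₂, ∨₂, ¬} ⊆ tcBasis`. -/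
theorem deMorganBasis_subset_tcBasis : deMorganBasis ⊆ tcBasis := by
  intro f hf
  simp only [deMorganBasis, Set.mem_insert_iff, Set.mem_singleton_iff] at hf
  refine acBasis_subset_tcBasis ?_
  rcases hf with rfl | rfl | rfl
  · exact Or.inr (Set.mem_iUnion.2 ⟨2, Or.inl rfl⟩)
  · exact Or.inr (Set.mem_iUnion.2 ⟨2, Or.inr rfl⟩)
  · exact Or.inl rfl

/-- Per-`m` existence of SOME general threshold circuit for `HAM_m` (a proved tree fact:
`exists_computes_deMorgan_holds`, plus the constant circuit at `m = 0`). -/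
theorem exists_circuit_hamFn (m : ℕ) : ∃ s : ℕ, ∃ C : Circuit (Fin m × Fin m),
    C.IsOver tcBasis ∧ C.size ≤ s ∧ C.Computes (hamFn m) := by
  rcases Nat.eq_zero_or_pos m with rfl | hm
  · obtain ⟨C, hB, hs, -, hf⟩ := hasSymCircuit_hamFn_corners.1
    exact ⟨1, C, hB, hs, hf⟩
  · haveI : Nonempty (Fin m × Fin m) := ⟨(⟨0, hm⟩, ⟨0, hm⟩)⟩
    obtain ⟨C, hB, hf⟩ := exists_computes_deMorgan_holds (hamFn m)
    exact ⟨C.size, C, hB.mono deMorganBasis_subset_tcBasis, le_rfl, hf⟩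

/-- Padding on the general side: the `∃ m` lower bound `¬HamPolySize` is the `∃ᶠ m` lower bound
`HamHardIO` (unconditionally). -/
theorem hamHardIO_iff_not_hamPolySize : HamHardIO ↔ ¬ HamPolySize := by
  constructor
  · rintro h ⟨p, hp⟩
    obtain ⟨m, hm⟩ := (h p).exists
    exact hm (hp m)
  · intro h p
    rw [Filter.frequently_atTop]
    intro M
    choose s hs using exists_circuit_hamFn
    obtain ⟨p', hpp', hsp'⟩ := exists_poly_cover p M s
    have hex : ∃ m, ¬ ∃ C : Circuit (Fin m × Fin m),
        C.IsOver tcBasis ∧ C.size ≤ p'.eval m ∧ C.Computes (hamFn m) := by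
      by_contra hall
      push Not at hall
      exact h ⟨p', fun m => by
        obtain ⟨C, hB, hs', hf⟩ := hall m
        exact ⟨C, hB, hs', hf⟩⟩
    obtain ⟨m, hm⟩ := hex
    refine ⟨m, ?_, ?_⟩
    · by_contra hlt
      obtain ⟨C, hB, hsC, hf⟩ := hs m
      exact hm ⟨C, hB, hsC.trans (hsp' m (Nat.lt_of_not_le hlt)), hf⟩
    · rintro ⟨C, hB, hsC, hf⟩
      exact hm ⟨C, hB, hsC.trans (hpp' m), hf⟩

/-- A general lower bound is a symmetric one, pointwise in `m` (no padding needed). -/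
theorem windowHam_of_hamHardIO (h : HamHardIO) : WindowHam := by
  rw [windowHam_iff]
  intro p
  refine (h p).mono fun m hm hS => hm ?_
  obtain ⟨C, hB, hs, -, hf⟩ := hS
  exact ⟨C, hB, hs, hf⟩

/-- **COLLAPSE, clean form.** Under the non-uniform compilation `HamCompilesNU` (which every
circuit-based proof of the crux establishes), crux #2 `WindowHam` is EQUIVALENT to the plain
circuit lower bound `HamHardIO` for Hamiltonicity: the symmetry restriction of the window then
buys no logical room, and the route `WindowHam → HamCompiles → PneNP` is
`HAM ∉ SIZE(poly) → P ≠ NP` re-phrased. -/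
theorem windowHam_iff_hamHardIO_of_NU (hNU : HamCompilesNU) : WindowHam ↔ HamHardIO :=
  ⟨fun hW => hamHardIO_iff_not_hamPolySize.2 (not_hamPolySize_of_NU_of_windowHam hNU hW),
    windowHam_of_hamHardIO⟩

/-! ### §7 Symmetric DNF: per-`m` existence is unconditional; `¬Concl ↔ WindowHam`;
### `HamCompiles ↔ (WindowHam → PneNP)` -/

section SymDnf

variable {m : ℕ}

/-- The diagonal permutation of matrix positions induced by a vertex permutation. -/
def diagPerm (ρ : Equiv.Perm (Fin m)) : Equiv.Perm (Fin m × Fin m) := Equiv.prodCongr ρ ρ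

@[simp] theorem diagPerm_apply (ρ : Equiv.Perm (Fin m)) (q : Fin m × Fin m) :
    diagPerm ρ q = (ρ q.1, ρ q.2) := rfl

/-- Gate type of the symmetric DNF: one `¬` gate per variable, one `∧` gate per satisfying
assignment, one `∨` gate. -/
abbrev DnfGate (m : ℕ) (f : (Fin m × Fin m → Bool) → Bool) : Type :=
  (Fin m × Fin m) ⊕ {a : Fin m × Fin m → Bool // f a = true} ⊕ Unit

/-- An enumeration of the variables. -/
noncomputable def varEquiv (m : ℕ) : Fin (Fintype.card (Fin m × Fin m)) ≃ Fin m × Fin m :=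
  (Fintype.equivFin _).symm

/-- An enumeration of the satisfying assignments. -/
noncomputable def satEquiv (f : (Fin m × Fin m → Bool) → Bool) :
    Fin (Fintype.card {a : Fin m × Fin m → Bool // f a = true}) ≃
      {a : Fin m × Fin m → Bool // f a = true} :=
  (Fintype.equivFin _).symm

/-- Gate functions of the DNF. -/
def dnfFn (f : (Fin m × Fin m → Bool) → Bool) : DnfGate m f → GateFn
  | Sum.inl _ => GateFn.not
  | Sum.inr (Sum.inl _) => GateFn.and (Fintype.card (Fin m × Fin m))
  | Sum.inr (Sum.inr _) => GateFn.or (Fintype.card {a : Fin m × Fin m → Bool // f a = true})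

/-- Wires of the DNF. -/
noncomputable def dnfArgs (f : (Fin m × Fin m → Bool) → Bool) :
    (l : DnfGate m f) → Fin (dnfFn f l).1 → (Fin m × Fin m) ⊕ DnfGate m f
  | Sum.inl q => fun _ => Sum.inl q
  | Sum.inr (Sum.inl a) => fun k =>
      if a.1 (varEquiv m k) = true then Sum.inl (varEquiv m k)
      else Sum.inr (Sum.inl (varEquiv m k))
  | Sum.inr (Sum.inr _) => fun l => Sum.inr (Sum.inr (Sum.inl (satEquiv f l)))

/-- The canonical DNF of `f` as a labelled DAG. -/
noncomputable def dnfDAG (f : (Fin m × Fin m → Bool) → Bool) :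
    GateDAG (Fin m × Fin m) (DnfGate m f) where
  fn := dnfFn f
  args := dnfArgs f
  out := Sum.inr (Sum.inr (Sum.inr ()))
  wf := by
    let rank : DnfGate m f → ℕ := Sum.elim (fun _ => 0) (Sum.elim (fun _ => 1) (fun _ => 2))
    refine Subrelation.wf (r := InvImage (· < ·) rank) ?_ (InvImage.wf rank Nat.lt_wfRel.wf)
    intro l' l ⟨a, ha⟩
    rcases l with q | a₀ | u
    · exact absurd ha Sum.inl_ne_inr
    · change (if a₀.1 (varEquiv m a) = true then Sum.inl (varEquiv m a)
        else Sum.inr (Sum.inl (varEquiv m a))) = Sum.inr l' at ha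
      split_ifs at ha with h
      cases ha
      exact Nat.zero_lt_one
    · change (Sum.inr (Sum.inr (Sum.inl (satEquiv f a))) : (Fin m × Fin m) ⊕ DnfGate m f) =
        Sum.inr l' at ha
      cases ha
      exact Nat.lt_succ_self 1

/-! #### Semantics -/

theorem dnfDAG_val_not (f : (Fin m × Fin m → Bool) → Bool) (x : Fin m × Fin m → Bool)
    (q : Fin m × Fin m) : (dnfDAG f).val x (Sum.inl q) = !(x q) := by
  rw [GateDAG.val_eq]; rfl

theorem dnfDAG_val_and (f : (Fin m × Fin m → Bool) → Bool) (x : Fin m × Fin m → Bool)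
    (a : {a : Fin m × Fin m → Bool // f a = true}) :
    (dnfDAG f).val x (Sum.inr (Sum.inl a)) = decide (x = a.1) := by
  rw [GateDAG.val_eq]
  change decide (∀ k, GateDAG.wire x ((dnfDAG f).val x)
      (if a.1 (varEquiv m k) = true then Sum.inl (varEquiv m k)
        else Sum.inr (Sum.inl (varEquiv m k))) = true) = decide (x = a.1)
  refine decide_eq_decide.2 ⟨fun h => funext fun q => ?_, fun h k => ?_⟩
  · have hk := h ((varEquiv m).symm q)
    rw [Equiv.apply_symm_apply] at hk
    by_cases ha : a.1 q = true
    · rw [if_pos ha, GateDAG.wire_inl] at hk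
      rw [hk, ha]
    · rw [if_neg ha, GateDAG.wire_inr, dnfDAG_val_not] at hk
      rw [Bool.not_eq_true] at ha
      rw [ha]
      simpa using hk
  · subst h
    by_cases ha : a.1 (varEquiv m k) = true
    · rw [if_pos ha, GateDAG.wire_inl, ha]
    · rw [if_neg ha, GateDAG.wire_inr, dnfDAG_val_not]
      simpa using ha

theorem dnfDAG_val_or (f : (Fin m × Fin m → Bool) → Bool) (x : Fin m × Fin m → Bool) :
    (dnfDAG f).val x (Sum.inr (Sum.inr ())) = f x := by
  rw [GateDAG.val_eq]
  change decide (∃ l, GateDAG.wire x ((dnfDAG f).val x)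
      (Sum.inr (Sum.inr (Sum.inl (satEquiv f l)))) = true) = f x
  simp only [GateDAG.wire_inr, dnfDAG_val_and, decide_eq_true_eq]
  cases hfx : f x
  · rw [decide_eq_false_iff_not]
    rintro ⟨l, hl⟩
    have := (satEquiv f l).2
    rw [← hl, hfx] at this
    exact Bool.false_ne_true this
  · rw [decide_eq_true_iff]
    exact ⟨(satEquiv f).symm ⟨x, hfx⟩, by simp⟩

theorem dnfDAG_evalOut (f : (Fin m × Fin m → Bool) → Bool) (x : Fin m × Fin m → Bool) :
    (dnfDAG f).evalOut x = f x :=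
  dnfDAG_val_or f x

/-! #### Basis and size -/

theorem dnfDAG_fn_mem (f : (Fin m × Fin m → Bool) → Bool) (l : DnfGate m f) :
    (dnfDAG f).fn l ∈ tcBasis := by
  refine acBasis_subset_tcBasis ?_
  rcases l with q | a | u
  · exact Or.inl rfl
  · exact and_mem_acBasis _
  · exact or_mem_acBasis _

theorem card_dnfGate_le (f : (Fin m × Fin m → Bool) → Bool) :
    Fintype.card (DnfGate m f) ≤ 2 ^ (m * m) + m * m + 1 := by
  have h1 : Fintype.card (Fin m × Fin m) = m * m := by simp
  have h2 : Fintype.card {a : Fin m × Fin m → Bool // f a = true} ≤ 2 ^ (m * m) := by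
    refine (Fintype.card_subtype_le _).trans ?_
    rw [Fintype.card_fun, Fintype.card_bool, h1]
  simp only [Fintype.card_sum, Fintype.card_unit, h1]
  omega

/-! #### Symmetry -/

/-- The action of a vertex permutation on satisfying assignments of an invariant `f`. -/
noncomputable def satPerm (f : (Fin m × Fin m → Bool) → Bool) (ρ : Equiv.Perm (Fin m))
    (hinv : ∀ x : Fin m × Fin m → Bool, f (fun q => x (ρ q.1, ρ q.2)) = f x) :
    Equiv.Perm {a : Fin m × Fin m → Bool // f a = true} where
  toFun a := ⟨a.1 ∘ (diagPerm ρ).symm, by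
    have h := hinv (a.1 ∘ (diagPerm ρ).symm)
    have : (fun q => (a.1 ∘ ⇑(diagPerm ρ).symm) (ρ q.1, ρ q.2)) = a.1 := by
      funext q
      show a.1 ((diagPerm ρ).symm (diagPerm ρ q)) = a.1 q
      rw [Equiv.symm_apply_apply]
    rw [this] at h
    rw [← h]; exact a.2⟩
  invFun a := ⟨a.1 ∘ diagPerm ρ, by
    have h := hinv a.1
    exact h.trans a.2⟩
  left_inv a := by
    ext q
    show a.1 ((diagPerm ρ).symm (diagPerm ρ q)) = a.1 q
    rw [Equiv.symm_apply_apply]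
  right_inv a := by
    ext q
    show a.1 (diagPerm ρ ((diagPerm ρ).symm q)) = a.1 q
    rw [Equiv.apply_symm_apply]

@[simp] theorem satPerm_apply_val (f : (Fin m × Fin m → Bool) → Bool) (ρ : Equiv.Perm (Fin m))
    (hinv : ∀ x : Fin m × Fin m → Bool, f (fun q => x (ρ q.1, ρ q.2)) = f x)
    (a : {a : Fin m × Fin m → Bool // f a = true}) (q : Fin m × Fin m) :
    (satPerm f ρ hinv a).1 q = a.1 ((diagPerm ρ).symm q) := rfl

/-- The gate bijection extending `ρ`: variables by `ρ × ρ`, `∧` gates by the action on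
assignments, the `∨` gate fixed. -/
noncomputable def dnfAut (f : (Fin m × Fin m → Bool) → Bool) (ρ : Equiv.Perm (Fin m))
    (hinv : ∀ x : Fin m × Fin m → Bool, f (fun q => x (ρ q.1, ρ q.2)) = f x) :
    DnfGate m f ≃ DnfGate m f :=
  Equiv.sumCongr (diagPerm ρ) (Equiv.sumCongr (satPerm f ρ hinv) (Equiv.refl Unit))

theorem dnfDAG_isAut (f : (Fin m × Fin m → Bool) → Bool) (ρ : Equiv.Perm (Fin m))
    (hinv : ∀ x : Fin m × Fin m → Bool, f (fun q => x (ρ q.1, ρ q.2)) = f x) :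
    (dnfDAG f).IsAut (fun q : Fin m × Fin m => (ρ q.1, ρ q.2)) (dnfAut f ρ hinv) := by
  refine ⟨rfl, ?_, ?_⟩
  · rintro (q | a | u) <;> rfl
  · rintro (q | a | u)
    · -- `¬` gate of `q` ↦ `¬` gate of `ρ q`
      show (List.ofFn fun _ : Fin 1 => (Sum.inl (diagPerm ρ q) : (Fin m × Fin m) ⊕ DnfGate m f)).Perm
        ((List.ofFn fun _ : Fin 1 => (Sum.inl q : (Fin m × Fin m) ⊕ DnfGate m f)).map
          (Sum.map (fun q : Fin m × Fin m => (ρ q.1, ρ q.2)) (dnfAut f ρ hinv)))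
      rw [List.map_ofFn]
      exact List.Perm.refl _
    · -- `∧` gate of `a` ↦ `∧` gate of `a ∘ (ρ×ρ)⁻¹`; arguments re-indexed by `τ`
      let e := varEquiv m
      let a' := satPerm f ρ hinv a
      let G : Fin (Fintype.card (Fin m × Fin m)) → (Fin m × Fin m) ⊕ DnfGate m f := fun j =>
        if a'.1 (e j) = true then Sum.inl (e j) else Sum.inr (Sum.inl (e j))
      let τ : Equiv.Perm (Fin (Fintype.card (Fin m × Fin m))) :=
        e.trans ((diagPerm ρ).trans e.symm)
      show (List.ofFn G).Perm ((List.ofFn fun k =>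
          if a.1 (e k) = true then (Sum.inl (e k) : (Fin m × Fin m) ⊕ DnfGate m f)
          else Sum.inr (Sum.inl (e k))).map
            (Sum.map (fun q : Fin m × Fin m => (ρ q.1, ρ q.2)) (dnfAut f ρ hinv)))
      rw [List.map_ofFn]
      have hfun : (Sum.map (fun q : Fin m × Fin m => (ρ q.1, ρ q.2)) ⇑(dnfAut f ρ hinv)) ∘
          (fun k => if a.1 (e k) = true then (Sum.inl (e k) : (Fin m × Fin m) ⊕ DnfGate m f)
            else Sum.inr (Sum.inl (e k))) = G ∘ τ := by
        funext k
        have hτ : e (τ k) = diagPerm ρ (e k) := by simp [τ]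
        have ha' : a'.1 (diagPerm ρ (e k)) = a.1 (e k) := by
          rw [satPerm_apply_val, Equiv.symm_apply_apply]
        simp only [Function.comp_apply, G, hτ, ha']
        by_cases h : a.1 (e k) = true
        · rw [if_pos h, if_pos h]; rfl
        · rw [if_neg h, if_neg h]; rfl
      rw [hfun]
      exact (Equiv.Perm.ofFn_comp_perm τ G).symm
    · -- the `∨` gate is fixed; its arguments are permuted by the action on assignments
      let eS := satEquiv f
      let H : Fin (Fintype.card {a : Fin m × Fin m → Bool // f a = true}) →
          (Fin m × Fin m) ⊕ DnfGate m f := fun l => Sum.inr (Sum.inr (Sum.inl (eS l)))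
      let τ : Equiv.Perm (Fin (Fintype.card {a : Fin m × Fin m → Bool // f a = true})) :=
        eS.trans ((satPerm f ρ hinv).trans eS.symm)
      show (List.ofFn H).Perm ((List.ofFn H).map
        (Sum.map (fun q : Fin m × Fin m => (ρ q.1, ρ q.2)) (dnfAut f ρ hinv)))
      rw [List.map_ofFn]
      have hfun : (Sum.map (fun q : Fin m × Fin m => (ρ q.1, ρ q.2)) ⇑(dnfAut f ρ hinv)) ∘ H =
          H ∘ τ := by
        funext l
        simp [H, τ, dnfAut]
      rw [hfun]
      exact (Equiv.Perm.ofFn_comp_perm τ H).symm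

theorem dnfDAG_isSymm (f : (Fin m × Fin m → Bool) → Bool) (Γ : Set (Equiv.Perm (Fin m)))
    (hinv : ∀ ρ ∈ Γ, ∀ x : Fin m × Fin m → Bool, f (fun q => x (ρ q.1, ρ q.2)) = f x) :
    (dnfDAG f).IsSymm (GateDAG.diagMaps Γ) := by
  rintro π ⟨ρ, hρ, rfl⟩
  exact ⟨dnfAut f ρ (hinv ρ hρ), dnfDAG_isAut f ρ (hinv ρ hρ)⟩

/-- **Symmetric DNF.** Every `Γ`-invariant Boolean function of an `m × m` matrix has a
`Γ`-symmetric threshold circuit (indeed an `{¬, ∧, ∨}`-circuit) with at most `2^(m²) + m² + 1`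
gates: the canonical DNF, on which `ρ ∈ Γ` acts by permuting variables and minterms. Hence
`HasSymCircuit` is never vacuous for invariant functions, at exponential size. -/
theorem hasSymCircuit_of_invariant (f : (Fin m × Fin m → Bool) → Bool)
    (Γ : Set (Equiv.Perm (Fin m)))
    (hinv : ∀ ρ ∈ Γ, ∀ x : Fin m × Fin m → Bool, f (fun q => x (ρ q.1, ρ q.2)) = f x) :
    HasSymCircuit tcBasis Γ (2 ^ (m * m) + m * m + 1) f := by
  refine ⟨(dnfDAG f).compile, GateDAG.compile_isOver _ (dnfDAG_fn_mem f), ?_,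
    (GateDAG.isSymmetricUnder_compile_iff _ Γ).2 (dnfDAG_isSymm f Γ hinv), fun x => ?_⟩
  · rw [Circuit.size, GateDAG.compile_gates_length]
    exact card_dnfGate_le f
  · rw [GateDAG.compile_eval, dnfDAG_evalOut]

end SymDnf

/-- Relabelling the matrix by `ρ` yields an isomorphic graph (`ρ` is the isomorphism). -/
def grRelabelIso {m : ℕ} (ρ : Equiv.Perm (Fin m)) (x : Fin m × Fin m → Bool) :
    (SimpleGraph.fromRel fun u v => (fun q : Fin m × Fin m => x (ρ q.1, ρ q.2)) (u, v) = true :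
      SimpleGraph (Fin m)) ≃g
    (SimpleGraph.fromRel fun u v => x (u, v) = true : SimpleGraph (Fin m)) where
  toEquiv := ρ
  map_rel_iff' := by
    intro a b
    simp [SimpleGraph.fromRel_adj, ρ.injective.ne_iff]

/-- `HAM_m` is invariant under every vertex permutation. -/
theorem hamFn_invariant {m : ℕ} (ρ : Equiv.Perm (Fin m)) (x : Fin m × Fin m → Bool) :
    hamFn m (fun q => x (ρ q.1, ρ q.2)) = hamFn m x :=
  decide_eq_decide.2
    (Literature.Combinatorics.SimpleGraph.isHamiltonian_iff_of_iso (grRelabelIso ρ x))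

/-- **Per-`m` existence is a theorem**: HAM_m has a Bud-symmetric (indeed fully symmetric)
threshold circuit of size `≤ 2^(m²) + m² + 1` at every `m`. -/
theorem perMExists : PerMExists := fun m =>
  ⟨_, hasSymCircuit_of_invariant (hamFn m) _ fun ρ _ x => hamFn_invariant ρ x⟩

/-- Hence the conclusion for all `m` is the conclusion for all large `m` (provers may discard any
finite set of `m`). -/
theorem concl_iff_eventually :
    Concl ↔ ∃ p : Polynomial ℕ, ∀ᶠ m in Filter.atTop,
      HasSymCircuit tcBasis (Bud m (Nat.log 2 m)) (p.eval m) (hamFn m) :=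
  ⟨fun ⟨p, hp⟩ => ⟨p, Filter.Eventually.of_forall hp⟩, concl_of_eventually perMExists⟩

/-- **Crux #2 is exactly the negation of the hypothesis-free conclusion of crux #3.** -/
theorem windowHam_iff_not_concl : WindowHam ↔ ¬ Concl := by
  refine ⟨not_concl_of_windowHam, fun h => windowHam_of_windowHamE perMExists fun p => ?_⟩
  by_contra hall
  push Not at hall
  exact h ⟨p, hall⟩

/-- **`HamCompiles ↔ (WindowHam → PneNP)`.** Crux #3 is literally the statement that crux #2
suffices for the summit — the route's transfer claim and nothing else (kernel-checked; uses the
symmetric DNF for the padding `∃ m ↝ ∃ᶠ m`). -/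
theorem hamCompiles_iff_windowHam_imp_pneNP : HamCompiles ↔ (WindowHam → PneNP) := by
  rw [hamCompiles_iff_pneNP_or_concl, windowHam_iff_not_concl]
  tauto

/-- The collapse of §6 without the per-`m` hypothesis: under the non-uniform compilation,
`WindowHam ↔ ¬HamPolySize ↔ HamHardIO`. -/
theorem windowHam_iff_not_hamPolySize_of_NU' (hNU : HamCompilesNU) : WindowHam ↔ ¬ HamPolySize :=
  windowHam_iff_not_hamPolySize hNU perMExists

/-! ### §8 Positive lines under adversarial test (cycle 1, 2026-08-16T01:40Z) — no kill

Two independent ideators (`Ideas/kotzig-cutspan.md`, k=1; `Ideas/cut-rank-twin-interface.md`, k=2)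
converged on ONE compilation mechanism, and both accept §3/§6 (their line proves `HamCompilesNU`,
so on landing `WindowHam ↔ HamHardIO` becomes unconditional):

* KOTZIG INTERFACE. `HAM(G) ⟺ ∃ e, ∃ spanning path cover of G[F] with class-margins e and
  component partition π_F of supp e, ∃ TYPED spanning path cover of G[O] (ends typed by twin classes
  a with u ∈ W_a) with the same margins and partition π_O, such that π_F ∨ π_O = 1̂` (closed
  alternating Euler trail, Kotzig 1968 / Bergougnoux–Kanté–Kwon 2017 Lemmas 4.3–4.5; the lift works
  because W_a = N_O(v) for EVERY v ∈ T_a, and for m ≥ 3 the lifted closed walk is a Hamiltonian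
  cycle). ADVERSARIAL CHECK (this seat, independent implementation `toy/kotzig_check.py`): brute-force
  HAM versus the interface on random O ⊔ F graphs with planted twin classes, m ≤ 11, r ≤ 6 classes:
  local smoke 36 832 instances, 0 disagreements; kit job j009638 (longer run, auto-attached to the
  item). Paper check of the lift's degenerate configurations (singleton F-segment next to singleton
  O-segment): harmless for m ≥ 3 (each edge of the trail is used once, so no vertex repeats).
* CUT-RANK COMPRESSION. `[π_F ∨ π_O = 1̂] = ⟨A_{π_F}, A_{π_O}⟩ (mod 2)` over anchored cuts
  (Cut&Count; Bodlaender–Cygan–Kratsch–Nederlof 2013 §3), hence the O-side needs only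
  `V_e = span_{GF(2)} {A_{π_F}}` (≤ 2^{r-1} ≤ m/2 dimensions) per margin vector e; margin vectors
  number ≤ ∏(2t_a+1) ≤ 3^g per class-size composition t and ≤ 2^{g-1}·3^g = m^{2.59} over all t —
  polynomial for EVERY r, which removes the (g+1)^{Θ(r²)} profile explosion of the WHY-IT-RESISTS
  paragraph above. Checked in the same toy (span test = set test on all instances) and on paper
  (masks u ↦ u ⊙ m_{ab} are linear, unions are sums: the subset DP commutes with spans).
* SYMMETRIC REALISATION. Sums of subspaces over free predecessors are aggregated by the SUBSET
  TOWER `U_B = RREF(U_{B∖w} + T_w)` computed for every w ∈ B by identical fixed elimination blocks and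
  OR-ed (all copies equal as canonical RREF bit-matrices): the OR gate (B,i,j) has its arguments
  permuted among themselves by Stab(B) — exactly the aggregation pattern of the `∨` gate of the
  symmetric DNF of §7 (`dnfDAG_isAut`, the `Sum.inr (Sum.inr _)` case), so the inline `Sym` predicate
  supports it. Orbits: subsets of F × free vertices × ordered data ≤ 2^g·g·poly.

ASSESSMENT (adversary): no step of the mechanism broke under paper scrutiny or computation; the
remaining risks are formalisation-size (Ψ ∈ NP as a TM2 checking relation, or a Karp reduction of Ψ
to HAMCIRCUIT; the equivariant layout bookkeeping), not truth. EXPECTED OUTCOME: the crux is settled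
POSITIVELY, in its non-uniform form; by `windowHam_iff_hamHardIO_of_NU` the route's remaining crux
`WindowHam` is then EQUIVALENT to the plain circuit lower bound `HamHardIO` for Hamiltonicity (route
Circuit's territory, `HAMCIRCUIT ∉ PPoly` up to the matrix/string encoding), and every barrier to
general circuit lower bounds (natural proofs, locality) bears on `WindowHam` with full force. This is
the disprover's deliverable for the tenure planner: HamCompiles true ⇒ the symmetry window buys no
logical room for HAM.
-/


/-! ### §9 The budget is the load-bearing PARAMETER (cycle 2): the crux along the scale `g`

The crux has one hypothesis (`NP ⊆ P`, irremovable by §1–§2) and one parameter, the budget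
`g(m) = ⌊log₂ m⌋`. Dual to the sibling disprover's analysis of `WindowHam`
(`Cruxes/WindowHam/Disproof.lean`, F3): the compilation claim gets STRONGER as `g` grows. -/

section Budget

/-- The conclusion at an arbitrary budget function `g`. -/
def ConclAt (g : ℕ → ℕ) : Prop :=
  ∃ p : Polynomial ℕ, ∀ m : ℕ, HasSymCircuit tcBasis (Bud m (g m)) (p.eval m) (hamFn m)

/-- Crux #2 at an arbitrary budget function `g` (the sibling file's `WindowHamAt`). -/
def WindowHamAt (g : ℕ → ℕ) : Prop :=
  ∀ p : Polynomial ℕ, ∃ᶠ m in Filter.atTop,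
    ¬ HasSymCircuit tcBasis (Bud m (g m)) (p.eval m) (hamFn m)

/-- The crux at an arbitrary budget function `g`. -/
def HamCompilesAt (g : ℕ → ℕ) : Prop := NPsubP → ConclAt g

theorem concl_iff_conclAt : Concl ↔ ConclAt (Nat.log 2) := Iff.rfl

theorem windowHam_iff_windowHamAt : WindowHam ↔ WindowHamAt (Nat.log 2) := Iff.rfl

theorem hamCompiles_iff_hamCompilesAt : HamCompiles ↔ HamCompilesAt (Nat.log 2) := Iff.rfl

/-- The support item `PolylogHam` is crux #2 at the over-budget `⌊log₂ m⌋²`. -/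
theorem polylogHam_iff_windowHamAt : PolylogHam ↔ WindowHamAt (fun m => Nat.log 2 m ^ 2) :=
  Iff.rfl

/-- Less budget = less symmetry demanded: `HasSymCircuit` is antitone in the budget. -/
theorem hasSymCircuit_budget_anti {m g g' s : ℕ} {f : (Fin m × Fin m → Bool) → Bool}
    (h : g ≤ g') (hS : HasSymCircuit tcBasis (Bud m g') s f) :
    HasSymCircuit tcBasis (Bud m g) s f := by
  obtain ⟨C, hB, hs, hΓ, hf⟩ := hS
  exact ⟨C, hB, hs, hΓ.mono (pointStabiliserBudget_mono m h), hf⟩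

/-- The conclusion is ANTITONE in the budget. -/
theorem conclAt_anti {g g' : ℕ → ℕ} (h : ∀ m, g m ≤ g' m) (hc : ConclAt g') : ConclAt g := by
  obtain ⟨p, hp⟩ := hc
  exact ⟨p, fun m => hasSymCircuit_budget_anti (h m) (hp m)⟩

/-- Crux #2 is MONOTONE in the budget. -/
theorem windowHamAt_mono {g g' : ℕ → ℕ} (h : ∀ m, g m ≤ g' m) (hW : WindowHamAt g) :
    WindowHamAt g' :=
  fun p => (hW p).mono fun m hm hS => hm (hasSymCircuit_budget_anti (h m) hS)

/-- The crux is ANTITONE in the budget: demanding more symmetry of the compiled circuit is a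
stronger claim. -/
theorem hamCompilesAt_anti {g g' : ℕ → ℕ} (h : ∀ m, g m ≤ g' m) (hc : HamCompilesAt g') :
    HamCompilesAt g := fun hsub => conclAt_anti h (hc hsub)

/-- Per-`m` existence at every budget (symmetric DNF, §7). -/
theorem perMExistsAt (g : ℕ → ℕ) (m : ℕ) :
    ∃ s : ℕ, HasSymCircuit tcBasis (Bud m (g m)) s (hamFn m) :=
  ⟨_, hasSymCircuit_of_invariant (hamFn m) _ fun ρ _ x => hamFn_invariant ρ x⟩

/-- Padding at budget `g`: the conclusion from some `m` on is the conclusion at every `m`. -/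
theorem conclAt_of_eventually {g : ℕ → ℕ}
    (h : ∃ p : Polynomial ℕ, ∀ᶠ m in Filter.atTop,
      HasSymCircuit tcBasis (Bud m (g m)) (p.eval m) (hamFn m)) : ConclAt g := by
  obtain ⟨p, hp⟩ := h
  obtain ⟨M, hM⟩ := Filter.eventually_atTop.1 hp
  choose s hs using perMExistsAt g
  obtain ⟨p', hpp', hsp'⟩ := exists_poly_cover p M s
  refine ⟨p', fun m => ?_⟩
  by_cases hm : m < M
  · exact (hs m).mono (hsp' m hm)
  · exact (hM m (Nat.not_lt.1 hm)).mono (hpp' m)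

theorem conclAt_iff_eventually (g : ℕ → ℕ) :
    ConclAt g ↔ ∃ p : Polynomial ℕ, ∀ᶠ m in Filter.atTop,
      HasSymCircuit tcBasis (Bud m (g m)) (p.eval m) (hamFn m) :=
  ⟨fun ⟨p, hp⟩ => ⟨p, Filter.Eventually.of_forall hp⟩, conclAt_of_eventually⟩

/-- `WindowHamAt g ↔ ¬ ConclAt g` at EVERY budget (generalises `windowHam_iff_not_concl`). -/
theorem windowHamAt_iff_not_conclAt (g : ℕ → ℕ) : WindowHamAt g ↔ ¬ ConclAt g := by
  constructor
  · rintro hW ⟨p, hp⟩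
    obtain ⟨m, hm⟩ := (hW p).exists
    exact hm (hp m)
  · intro h p
    rw [Filter.frequently_atTop]
    intro M
    choose s hs using perMExistsAt g
    obtain ⟨p', hpp', hsp'⟩ := exists_poly_cover p M s
    have hex : ∃ m, ¬ HasSymCircuit tcBasis (Bud m (g m)) (p'.eval m) (hamFn m) := by
      by_contra hall
      push Not at hall
      exact h ⟨p', hall⟩
    obtain ⟨m, hm⟩ := hex
    refine ⟨m, ?_, fun hms => hm (hms.mono (hpp' m))⟩
    by_contra hlt
    exact hm ((hs m).mono (hsp' m (Nat.lt_of_not_le hlt)))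

/-- At every budget the crux is exactly "crux #2 at that budget suffices for the summit". -/
theorem hamCompilesAt_iff (g : ℕ → ℕ) : HamCompilesAt g ↔ (WindowHamAt g → PneNP) := by
  rw [HamCompilesAt, windowHamAt_iff_not_conclAt, pneNP_iff_not_NPsubP]
  tauto

/-- **Budget 0** (no symmetry demanded): `ConclAt 0 ↔ HamPolySize`. -/
theorem conclAt_zero_iff_hamPolySize : ConclAt (fun _ => 0) ↔ HamPolySize := by
  constructor
  · rintro ⟨p, hp⟩
    refine ⟨p, fun m => ?_⟩
    obtain ⟨C, hB, hs, -, hf⟩ := hp m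
    exact ⟨C, hB, hs, hf⟩
  · rintro ⟨p, hp⟩
    refine ⟨p, fun m => ?_⟩
    obtain ⟨C, hB, hs, hf⟩ := hp m
    refine ⟨C, hB, hs, ?_, hf⟩
    rw [Bud, pointStabiliserBudget_zero]
    exact Circuit.isSymmetricUnder_one C

/-- Hence at budget 0 the crux is the bare non-uniform bridge `NP ⊆ P → HAM ∈ SIZE^tc(poly)`
(theorem-level: `P ⊆ P/poly` plus encoding plumbing; no symmetry content). -/
theorem hamCompilesAt_zero_iff : HamCompilesAt (fun _ => 0) ↔ (NPsubP → HamPolySize) := by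
  rw [HamCompilesAt, conclAt_zero_iff_hamPolySize]

/-- … and crux #2 at budget 0 is the plain circuit lower bound `HamHardIO`. -/
theorem windowHamAt_zero_iff : WindowHamAt (fun _ => 0) ↔ HamHardIO := by
  rw [windowHamAt_iff_not_conclAt, hamHardIO_iff_not_hamPolySize, conclAt_zero_iff_hamPolySize]

/-- **Over-budget** `g = ⌊log₂ m⌋²`: there crux #2 is the support item `PolylogHam` — a printed
theorem modulo formalisation (Dawar–Wilsenach support theorem + linear counting width of HAM) —
so the compilation claim at that budget IS the summit. Demanding polylog symmetry of the
compiled circuit over-shoots: `HamCompilesAt log²` is as hard as `P ≠ NP` itself. -/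
theorem hamCompilesAt_logSq_iff_pneNP (hPH : PolylogHam) :
    HamCompilesAt (fun m => Nat.log 2 m ^ 2) ↔ PneNP := by
  rw [hamCompilesAt_iff]
  exact ⟨fun h => h (polylogHam_iff_windowHamAt.1 hPH), fun h _ => h⟩

/-- `⌊log₂ m⌋ ≤ ⌊log₂ m⌋²`. -/
theorem log_le_log_sq (m : ℕ) : Nat.log 2 m ≤ Nat.log 2 m ^ 2 := Nat.le_self_pow two_ne_zero _

/-- The scale sandwich of the crux: `HamCompilesAt log² → HamCompiles → HamCompilesAt 0`, i.e.
(modulo `PolylogHam` and the P/poly plumbing) `PneNP → HamCompiles → (NP ⊆ P → HAM ∈ SIZE(poly))`: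
the crux sits between the summit and a theorem, and ALL of its content is in the choice of scale. -/
theorem hamCompiles_sandwich :
    (HamCompilesAt (fun m => Nat.log 2 m ^ 2) → HamCompiles) ∧
    (HamCompiles → HamCompilesAt (fun _ => 0)) :=
  ⟨fun h => hamCompiles_iff_hamCompilesAt.2 (hamCompilesAt_anti log_le_log_sq h),
   fun h => hamCompilesAt_anti (fun _ => Nat.zero_le _) (hamCompiles_iff_hamCompilesAt.1 h)⟩

end Budget

/-! ### §10 Window arithmetic (cycle 2): subsets fit the window, symmetrisation does not

Two kernel-checked numbers behind the route's "window": at `g = ⌊log₂ m⌋` there is a gate for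
every subset of the free part (`2^g ≤ m`), but the `g!` relabelled copies of item `Symmetrise`
are superpolynomially many (`⌊log₂ m⌋!` eventually exceeds every polynomial, along `m = 2^n`).
So the NAIVE compilation `NP ⊆ P ⇒ HAM ∈ SIZE(poly) ⇒ symmetrise` proves `HamCompilesAt g` exactly
for `g! ≤ poly` (`conclAt_of_symmetrise`) and is dead by count at the window: any proof of the
crux needs a HAM-specific equivariant construction (the ideators' Kotzig/cut-rank lines, §8). -/

section WindowArithmetic

open scoped Nat

/-- Subset-indexed gates fit the budget: `2^{⌊log₂ m⌋} ≤ m` for `m ≠ 0`. -/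
theorem two_pow_log_le {m : ℕ} (hm : m ≠ 0) : 2 ^ Nat.log 2 m ≤ m := Nat.pow_log_le_self 2 hm

/-- … so `2^g · g^a · m^b` gate families (subsets × tuples of free vertices × ordered data) are
polynomial at the window: `2^{⌊log₂ m⌋} * ⌊log₂ m⌋^a ≤ m^(a+1)`. -/
theorem two_pow_log_mul_log_pow_le {m : ℕ} (hm : m ≠ 0) (a : ℕ) :
    2 ^ Nat.log 2 m * Nat.log 2 m ^ a ≤ m ^ (a + 1) := by
  have h1 : 2 ^ Nat.log 2 m ≤ m := two_pow_log_le hm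
  have h2 : Nat.log 2 m ≤ m := (Nat.log_lt_self 2 hm).le
  calc 2 ^ Nat.log 2 m * Nat.log 2 m ^ a ≤ m * m ^ a :=
        Nat.mul_le_mul h1 (Nat.pow_le_pow_left h2 a)
    _ = m ^ (a + 1) := by ring

/-- Factorials beat `c · 2^{k n} + c` from some `n` on. -/
theorem exists_factorial_gt (c k : ℕ) : ∃ N : ℕ, ∀ n ≥ N, c * 2 ^ (k * n) + c < n ! := by
  -- `a + 1 = 2^(k+1)`, and `n! ≥ (a+1)^(n-a) = 2^{(k+1)(n-a)}`
  obtain ⟨a, ha⟩ : ∃ a : ℕ, a + 1 = 2 ^ (k + 1) :=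
    ⟨2 ^ (k + 1) - 1, Nat.sub_add_cancel Nat.one_le_two_pow⟩
  refine ⟨a + (k * a + c + 1), fun n hn => ?_⟩
  obtain ⟨n', rfl⟩ : ∃ n', n = a + n' := ⟨n - a, by omega⟩
  have hn' : k * a + c + 1 ≤ n' := by omega
  have h1 : (a + 1) ^ n' ≤ (a + n')! :=
    le_trans (Nat.le_mul_of_pos_left _ (Nat.factorial_pos a)) Nat.factorial_mul_pow_le_factorial
  rw [ha, ← pow_mul] at h1
  have h2 : c * 2 ^ (k * (a + n')) + c ≤ 2 * c * 2 ^ (k * (a + n')) := by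
    have : 1 ≤ 2 ^ (k * (a + n')) := Nat.one_le_two_pow
    nlinarith
  have h3 : 2 * c < 2 ^ (c + 1) := by
    have := Nat.lt_two_pow_self (n := c)
    rw [pow_succ]
    omega
  have h4 : (c + 1) + k * (a + n') ≤ (k + 1) * n' := by
    have e1 : (k + 1) * n' = k * n' + n' := by ring
    have e2 : k * (a + n') = k * a + k * n' := by ring
    omega
  calc c * 2 ^ (k * (a + n')) + c ≤ 2 * c * 2 ^ (k * (a + n')) := h2
    _ < 2 ^ (c + 1) * 2 ^ (k * (a + n')) :=
        Nat.mul_lt_mul_of_pos_right h3 (Nat.two_pow_pos _)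
    _ = 2 ^ ((c + 1) + k * (a + n')) := (pow_add 2 _ _).symm
    _ ≤ 2 ^ ((k + 1) * n') := Nat.pow_le_pow_right (by norm_num) h4
    _ ≤ (a + n')! := h1

/-- **`⌊log₂ m⌋!` is superpolynomial**: every polynomial is beaten infinitely often (along the
powers of two). -/
theorem log_factorial_superpoly (p : Polynomial ℕ) :
    ∃ᶠ m in Filter.atTop, p.eval m < (Nat.log 2 m)! := by
  obtain ⟨c, k, hck⟩ := exists_eval_le_mul_pow_add p
  obtain ⟨N, hN⟩ := exists_factorial_gt c k
  rw [Filter.frequently_atTop]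
  intro M
  refine ⟨2 ^ max M N, (le_max_left M N).trans Nat.lt_two_pow_self.le, ?_⟩
  rw [Nat.log_pow (by norm_num : 1 < 2)]
  calc p.eval (2 ^ max M N) ≤ c * (2 ^ max M N) ^ k + c := hck _
    _ = c * 2 ^ (k * max M N) + c := by rw [← pow_mul, Nat.mul_comm (max M N) k]
    _ < (max M N)! := hN _ (le_max_right M N)

/-- Equivalently: no polynomial eventually dominates `⌊log₂ m⌋!`. -/
theorem not_log_factorial_polyBounded :
    ¬ ∃ p : Polynomial ℕ, ∀ᶠ m in Filter.atTop, (Nat.log 2 m)! ≤ p.eval m := by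
  rintro ⟨p, hp⟩
  exact ((log_factorial_superpoly p).and_eventually hp).exists.elim fun m hm =>
    absurd hm.2 (not_le.2 hm.1)

/-- Hence NO `Symmetrise`-shaped size bound `c · (⌊log₂ m⌋! · (s m + 1))` (`c ≥ 1`, any general
sizes `s m`) is polynomially bounded: the `g!`-symmetrisation of item `Symmetrise` cannot deliver
`Concl` at the window scale, whatever poly-size general circuits `NP ⊆ P` provides. -/
theorem symmetrise_bound_superpoly {c : ℕ} (hc : 0 < c) (s : ℕ → ℕ) (p : Polynomial ℕ) :
    ∃ᶠ m in Filter.atTop, p.eval m < c * ((Nat.log 2 m)! * (s m + 1)) :=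
  (log_factorial_superpoly p).mono fun _ hm =>
    hm.trans_le ((Nat.le_mul_of_pos_right _ (Nat.succ_pos _)).trans
      (Nat.le_mul_of_pos_left _ hc))

/-- Poly-size GENERAL `B2`-circuits for HAM at every `m` (the form item `Symmetrise` consumes;
`HAMCIRCUIT ∈ P/poly` in the route's input convention, fan-in-2 basis). -/
def HamPolySizeB2 : Prop :=
  ∃ p : Polynomial ℕ, ∀ m : ℕ, ∃ C : Circuit (Fin m × Fin m),
    C.IsOver B2 ∧ C.size ≤ p.eval m ∧ C.Computes (hamFn m)

/-- Item `Symmetrise` over the landed vocabulary (definitional). -/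
theorem symmetrise_iff :
    Symmetrise ↔ ∃ c : ℕ, ∀ (m g : ℕ) (f : (Fin m × Fin m → Bool) → Bool),
      (∀ ρ ∈ Bud m g, ∀ x : Fin m × Fin m → Bool,
          f (fun q : Fin m × Fin m => x (ρ q.1, ρ q.2)) = f x) →
        ∀ C : Circuit (Fin m × Fin m), C.IsOver B2 → C.Computes f →
          HasSymCircuit tcBasis (Bud m g) (c * (Nat.factorial g * (C.size + 1))) f :=
  Iff.rfl

/-- **Bridge edge, kernel-checked plumbing.** Below the window — any budget `g` with
`(g m)! ≤ r m` for a polynomial `r`, e.g. `g = O(log m / log log m)` — item `Symmetrise` turns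
poly-size general `B2`-circuits for HAM into `ConclAt g`. With `NP ⊆ P ⇒ HamPolySizeB2`
(P ⊆ P/poly, theorem-level) this PROVES `HamCompilesAt g` there: the crux at sub-window budget
has no content beyond `P ⊆ P/poly`. By `symmetrise_bound_superpoly` the same argument is void at
`g = ⌊log₂ m⌋`. -/
theorem conclAt_of_symmetrise (hS : Symmetrise) {g : ℕ → ℕ} (r : Polynomial ℕ)
    (hg : ∀ m, (g m)! ≤ r.eval m) (hH : HamPolySizeB2) : ConclAt g := by
  obtain ⟨c, hc⟩ := symmetrise_iff.1 hS
  obtain ⟨p, hp⟩ := hH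
  refine ⟨Polynomial.C c * (r * (p + 1)), fun m => ?_⟩
  obtain ⟨C, hB, hs, hf⟩ := hp m
  refine (hc m (g m) (hamFn m) (fun ρ _ x => hamFn_invariant ρ x) C hB hf).mono ?_
  simp only [Polynomial.eval_mul, Polynomial.eval_C, Polynomial.eval_add, Polynomial.eval_one]
  exact Nat.mul_le_mul_left _ (Nat.mul_le_mul (hg m) (Nat.succ_le_succ hs))

/-- The sub-window crux from `Symmetrise` and the bare bridge `NP ⊆ P → HamPolySizeB2`. -/
theorem hamCompilesAt_of_symmetrise (hS : Symmetrise) {g : ℕ → ℕ} (r : Polynomial ℕ)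
    (hg : ∀ m, (g m)! ≤ r.eval m) (bridge : NPsubP → HamPolySizeB2) : HamCompilesAt g :=
  fun hsub => conclAt_of_symmetrise hS r hg (bridge hsub)

end WindowArithmetic

/-! ### §11 The `P/poly` form that every proposed line proves (cycle 2)

All four surviving crux ideas (`Ideas/kotzig-cutspan.md`, `cut-rank-twin-interface.md`,
`hankel-forward-kernel.md`, `bbbkv-dialogue.md`; triage r1: 3/3 panels) use the hypothesis
`NP ⊆ P` only as `NP ⊆ P/poly` ("one NP query on Bud-invariant wires, answered by an advice
circuit"). Name that form `HamCompilesPPoly`. Kernel-checked: it implies the crux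
(`P ⊆ P/poly` and the two model bridges are proved tree facts), and it is EQUIVALENT to
`WindowHam → NP ⊄ P/poly`. So if a line lands, crux #2 `WindowHam` becomes at least as strong as
the Karp–Lipton circuit lower bound `NPNotSubsetPPoly` (conjecture leaf of this summit), and with
the sibling disprover's F10 (`NP ⊆ P/poly → ¬WindowHam`, same statement read backwards) the
route `SymmetryBudget` re-keys onto route `Circuit`. -/

section PPolyForm

/-- `NP ⊆ P/poly` (Mathlib-TM2 classes of the tree). -/
def NPsubPPoly : Prop := Nondeterministic.NP ⊆ PPoly

/-- The summit's conjecture leaf `NPNotSubsetPPoly` is `¬ NPsubPPoly` (definitional). -/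
theorem npNotSubsetPPoly_iff : NPNotSubsetPPoly ↔ ¬ NPsubPPoly := Iff.rfl

/-- `NP ⊆ P → NP ⊆ P/poly`, through the PROVED tree facts `NP_bool_eq_holds`, `P_bool_eq_holds`
(model bridges Cook ↔ Mathlib-TM2 classes) and `P_subset_PPoly_holds` (Arora–Barak Thm 6.6). -/
theorem npsubPPoly_of_NPsubP (h : NPsubP) : NPsubPPoly := by
  intro L hL
  have hNP : L ∈ PNPWave0.NP Bool := by
    rw [show PNPWave0.NP Bool = Nondeterministic.NP from NP_bool_eq_holds]; exact hL
  have hP : L ∈ PNPWave0.P Bool := h hNP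
  rw [show PNPWave0.P Bool = Classes.P from P_bool_eq_holds] at hP
  exact P_subset_PPoly_holds hP

/-- Contrapositive: the conjecture leaf implies the summit (re-derived here for bookkeeping). -/
theorem pneNP_of_npNotSubsetPPoly (h : NPNotSubsetPPoly) : PneNP :=
  pneNP_iff_not_NPsubP.2 fun hsub => h (npsubPPoly_of_NPsubP hsub)

/-- **The P/poly form of the crux**: `NP ⊆ P/poly ⇒` poly-size Bud(m,⌊log₂ m⌋)-symmetric
threshold circuits for HAM at every `m`. This is what the ideators' lines establish. -/
def HamCompilesPPoly : Prop := NPsubPPoly → Concl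

/-- The P/poly form implies the crux (unconditionally: the bridge is proved). -/
theorem hamCompiles_of_hamCompilesPPoly (h : HamCompilesPPoly) : HamCompiles :=
  hamCompiles_iff.2 fun hsub => h (npsubPPoly_of_NPsubP hsub)

/-- `HamCompilesPPoly ↔ NPNotSubsetPPoly ∨ Concl`. -/
theorem hamCompilesPPoly_iff_or : HamCompilesPPoly ↔ NPNotSubsetPPoly ∨ Concl :=
  imp_iff_not_or

/-- **`HamCompilesPPoly ↔ (WindowHam → NPNotSubsetPPoly)`**: the P/poly form is literally the
statement that crux #2 is at least the Karp–Lipton circuit lower bound. -/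
theorem hamCompilesPPoly_iff : HamCompilesPPoly ↔ (WindowHam → NPNotSubsetPPoly) := by
  rw [hamCompilesPPoly_iff_or, windowHam_iff_not_concl]
  tauto

/-- Consequence for crux #2 once a line lands: `WindowHam → NP ⊄ P/poly`. -/
theorem npNotSubsetPPoly_of_windowHam (h : HamCompilesPPoly) (hW : WindowHam) :
    NPNotSubsetPPoly :=
  hamCompilesPPoly_iff.1 h hW

/-- The P/poly form versus the non-uniform form of §3, modulo the two ENCODING bridges between
matrix-input HAM circuits and the string language classes (HAMCIRCUIT ∈ NP is the tree theorem
`HAMCIRCUIT_mem_NP`; Karp-hardness of HAMCIRCUIT under P/poly-closed reductions and the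
matrix ↔ string transcoding circuits are formalisation debt, not doubt). -/
theorem hamCompilesPPoly_of_NU (bridge : NPsubPPoly → HamPolySize) (h : HamCompilesNU) :
    HamCompilesPPoly := fun hsub => h (bridge hsub)

theorem hamCompilesNU_of_PPoly (bridge : HamPolySize → NPsubPPoly) (h : HamCompilesPPoly) :
    HamCompilesNU := fun hP => h (bridge hP)

/-- Under the P/poly form AND the hardness bridge `NPNotSubsetPPoly → HamHardIO` (HAM is NP-hard
under reductions computable by poly-size circuits), crux #2 is EQUIVALENT to `NP ⊄ P/poly`. -/
theorem windowHam_iff_npNotSubsetPPoly (h : HamCompilesPPoly)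
    (hard : NPNotSubsetPPoly → HamHardIO) : WindowHam ↔ NPNotSubsetPPoly :=
  ⟨npNotSubsetPPoly_of_windowHam h, fun hN => windowHam_of_hamHardIO (hard hN)⟩

end PPolyForm


/-! ### §12 Mechanical Sym-check of the compilation idioms (cycle 2, 2026-08-16T02:50Z) — no kill

Toy `symcheck_rank.py` (this seat's folder; attached as item evidence) builds, for small `(m, g)`,
the two gate families every proposed line uses and checks the route's INLINE `Sym` predicate
clause by clause (gate permutation `σ` = relabelling of gate NAMES by `ρ ∈ Sym(F)`; output fixed;
`fn` labels equal; argument multisets equal after relabelling inputs by `ρ × ρ` and gate wires by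
`σ`), plus functional correctness and Bud-invariance of the designated invariant wires:

* RANK CANONISATION WITH MULTIPLICITIES: `adj(v,o) = x(v,o) ∨ x(o,v)`; `eq(v,w,o)`; prefix-AND
  comparisons `less(v,w)` indexed by the ORDERED coordinate `o`; twin test `ceq(v,w)`; ranks
  `[#{w : less(w,v)} ≥ k]` as `MAJ_{2n}` gates padded with the constant gates `∧₀ / ∨₀`; position
  indicators `pos(v,k)`; sorted rows `srow(k,o) = ⋁_v pos(v,k) ∧ adj(v,o)` (Bud-invariant outputs).
* SUBSET-INDEXED HELD–KARP over the free part: `HP(B,u,v) = ⋁_w HP(B∖v,u,w) ∧ adj(w,v)`, gates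
  indexed by `(B ⊆ F, u, v)`, `σ : (B,u,v) ↦ (ρB, ρu, ρv)`.

Result: `(m,g) ∈ {(4,2),(5,2),(5,3),(6,3),(7,3),(7,4)}`, up to 522 gates; 35 verbatim Sym checks
(adjacent transpositions, the `g`-cycle, random elements), 900 random inputs with planted twins ×
(sorted rows correct, invariant under `ρ`, HK = brute force): 0 failures. So the inline predicate
supports exactly the idioms the lines need (ordered-coordinate indexing, threshold-by-padding,
subset orbits, OR-aggregation over an orbit); the symmetric-realisation step is not where a line
could break. (Not a proof: the Lean layout goes through `CircuitDAG.GateDAG.compile` /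
`isSymmetricUnder_compile_iff`, as in §7.)
-/

/-! ### §13 Targets — the stubs of the picked line `kotzig-cutspan` (cycle 2, 2026-08-16T03:20Z)

`PICKED.md`: line `kotzig-cutspan`; skeleton `Lines/kotzig-cutspan.lean` (lead's reshape, 7 stubs;
`HamCompiles_of` kernel-checked modulo the stubs). Attack = MISSTATEMENT hunt on each stub signature
(degenerate parameters, index conventions, truncated subtraction, dropped loops) by paper audit and
verbatim-definition brute force (toys in this seat's folder, attached as item evidence). Verdicts:

* `stub_kotzig` (arbitrary finite `V`, `|V| ≥ 3`, `F, Fᶜ ≠ ∅`) — SURVIVES. Checked degenerate shapes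
  on paper (`|F| = 1` / `|A| = 1`: runs flanked by the same vertex, loops in the junction multigraph
  count 2 slots; labels that are not class keys are excluded by slot equality; `fromRel` drops loops
  but reachability is unaffected; a singleton path contributes both ends). Brute force of the FORMAL
  predicate vs Hamiltonicity (`kotzig_formal.py`): all graphs on `n ≤ 5` × every `F` (31 664 checks)
  + 400 random `n ∈ {6,7}`: 0 failures.
* `stub_rref` — SURVIVES. (1) reduced rows (lowest-`skey` pivot convention, existential `rrefBit`)
  are unique per pivot (difference of two would be a nonzero element vanishing at every pivot) and
  span `W`; (2) `insertRow` is exactly one step of reduced-echelon maintenance (remainder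
  `v' = v + Σ v_c R_c` vanishes at old pivots; new pivot `lead v'`; old rows fixed by
  `R c + R c ℓ • v'`, which is `R c` whenever `skey ℓ < skey c` since `R c` vanishes below `c`);
  (3) `sbCode` bars sit at `i + d₀+⋯+dᵢ < 3g`, strictly increasing, differences recover `d`.
  `rref_check.py`: (1),(2) on all 67 subspaces of `GF(2)^4` × all 16 `v` and 2 400 random pairs at
  `g = 3`; (3) for all `d` with `Σd ≤ 2g`, `g ≤ 6`: 0 failures.
* `stub_spanRecursion` (`WF m x d = Cspan m x (freeSet m) d`, ALL `m, x, d`) — SURVIVES.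
  `uF PF = ⊙_p mask(rk first p, rk last p)` (consF is a conjunction over paths), so the closed/open
  recursion is a Held–Karp identity on products of masks; guards `δᵢ+δⱼ ≤ e` make the truncated
  subtraction exact; `m ≤ 3` corners (`g ∈ {0,1}`, `F = ∅`: both sides `span{𝟙}` at `d = 0`) agree;
  ranks of free vertices are `< r ≤ g`, so `fSlots` at `i : Fin g` sees every end. `spanrec_check.py`
  implements `dpLevel` VERBATIM (including `⨆ w ∈ P.erase v`, the `v ∈ P` guard, `e - δ i - δ j`) and
  compares with brute-force `WF` for every graph on `F`, every rank function `rk < g` and every `d`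
  with `Σd ≤ 2g`: `g ≤ 4`, 2 140 827 d-checks, 0 mismatches (kit j011383/j011386: `g = 5` samples).
* `stub_cutspan` (`m ≥ 4`) — SURVIVES on paper: labels ↔ ranks is a bijection on the classes present
  (`key` injective ⇒ `rankOf` injective on `classes`; used labels have positive slots hence are keys of
  path ends hence ranked `< g`); cut parity counts unions of components containing the anchor
  (`2^{c-1}`, every vertex of `supp d` carries an edge end); `dsupp d ≠ ∅` because `F ≠ ∅` forces
  `PF ≠ []`; the anchored graph read off `aData ∘ inl` has `Gr`'s adjacency on anchored vertices and
  the A-paths live there. (Informal interface checked ×5 toys earlier, §8.)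
* `stub_symmetricA` — SURVIVES: `inl` bits are input wires fixed by Bud or constants; `inr (i,a)` is
  `⋁_u RANK_i(u) ∧ adj(u,a)` with dense ranks by chains of the fixed comparator — the §12 idiom,
  mechanically Sym-checked.
* `stub_symmetricF` (XL) — NOT REFUTED; necessary condition holds (`fData` is Bud-invariant: `ρ` is an
  isomorphism `Gr(x∘ρ) ≅ Gr x` fixing `A` pointwise, so classes, ranks, margins, `uF`, `WF`, `Cspan`
  are carried along). PITFALLS for the lead (none fatal): (i) `⊕`/parity is NOT in `tcBasis` — the sums
  `v + Σ_c v_c R_c` of `reduceBy` are parities over the INVARIANT coordinate set `Fin g → Bool`, so a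
  fixed XOR ladder of `{∧,∨,¬}` gates (4 gates per ⊕) is legitimate there, but any sum over FREE
  indices (`⨆ v ∈ P`, `⨆ w ∈ P.erase v`) must go through the subset tower / sort-by-counting, never a
  fixed-order ladder; (ii) `lead` is `Classical.choose` — the circuit computes the least-`skey` nonzero
  coordinate and equality with `lead` needs the uniqueness lemma (skey injective); (iii) selections
  `[rk v = i]·C`, `[adj w v]·O` are bitwise ANDs of a matrix with one wire — fine; (iv) the stub
  quantifies over ALL `i : FIdx m` (non-code-words ↦ constant false) and all `m ≥ 4` with ONE
  polynomial `q`; (v) subset-tower copies are equal only because RREF over the FIXED `skey` order is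
  canonical — insert rows in `skey` order inside each copy.
* `stub_residueNP` — SURVIVES on paper: certificate `(d, PA, S₀)` has size `poly(m)` (`|PA| ≤ m`
  because covers are duplicate-free and spanning; `Σd ≤ 2g`), all checks are polynomial (`2^g ≤ m`
  coordinates), `m` is decoded from `|s|` by `ell_strictMono` (proved in the skeleton).

Standing offer to the lead: signatures of sub-stubs of `stub_symmetricF` (the `GateDAG`, its `IsAut`,
the semantics of the tower) will be Sym-checked mechanically (`symcheck_rank.py` harness) and
brute-forced (`spanrec_check.py` harness) within one cycle of appearing in the skeleton.
-/

/-! ### §14 THE HARDNESS BRIDGE IS A THEOREM (cycle 3, 2026-08-16): `HamPolySize ↔ NP ⊆ P/poly`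

Kernel-checked in §Lib-14 (`HamMatrixLib.np_subset_PPoly_iff_polySize_tcBasis`; proposed as the Literature file
`Literature/Computability/Complexity/HamMatrixCircuits.lean`): poly-size matrix-input `tcBasis` circuits for `HAM_m` at
every `m` ⟺ `HAMCIRCUIT ∈ P/poly` ⟺ `NP ⊆ P/poly` — string→matrix by hard-wiring the code header and reading the
adjacency block off the matrix; matrix `tcBasis`→`B₂` by the Muroga gadget of `TC⁰ ⊆ NC¹` (this pays for the unbounded
multiplicities of majority wires, the sibling disprover's F4); matrix→string by a validity check of graph codes; and Karp's
NP-completeness of `HAMILTON CIRCUIT` + closure of `P/poly` under Karp reductions (both proved tree facts). CONSEQUENCES,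
all unconditional now: the "formalisation debt" bridges of §3, §6, §10, §11 are discharged —
`HamCompilesNU ↔ HamCompilesPPoly`, `HamHardIO ↔ NPNotSubsetPPoly`, the budget-0 crux `HamCompilesAt 0` is a THEOREM, the
sub-window crux is a theorem modulo the support item `Symmetrise`, crux #2 follows from the summit's conjecture leaf
(`NPNotSubsetPPoly → WindowHam`), and the P/poly form of the crux that every line proves is LITERALLY the statement
"crux #2 is Karp–Lipton's hypothesis negated": `HamCompilesPPoly ↔ (WindowHam ↔ NPNotSubsetPPoly)`. -/

section HardnessBridge

/-- `HamPolySize` is §Lib-14's `PolySize tcBasis` (definitional). -/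
theorem hamPolySize_iff_polySize : HamPolySize ↔ HamMatrixLib.PolySize tcBasis := Iff.rfl

/-- `HamPolySizeB2` is §Lib-14's `PolySize B2` (definitional). -/
theorem hamPolySizeB2_iff_polySize : HamPolySizeB2 ↔ HamMatrixLib.PolySize B2 := Iff.rfl

/-- **The hardness bridge**: HAM has poly-size matrix threshold circuits iff `NP ⊆ P/poly`. -/
theorem hamPolySize_iff_npsubPPoly : HamPolySize ↔ NPsubPPoly :=
  HamMatrixLib.np_subset_PPoly_iff_polySize_tcBasis.symm

/-- … and over `B₂`. -/
theorem hamPolySizeB2_iff_npsubPPoly : HamPolySizeB2 ↔ NPsubPPoly :=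
  (HamMatrixLib.mem_PPoly_iff_polySize_B2.symm.trans
    (NP_subset_PPoly_iff_of_isNPComplete isNPComplete_HAMCIRCUIT_holds).symm)

/-- **The general circuit lower bound for HAM is Karp–Lipton's hypothesis negated**:
`HamHardIO ↔ NP ⊄ P/poly` (unconditional). -/
theorem hamHardIO_iff_npNotSubsetPPoly : HamHardIO ↔ NPNotSubsetPPoly := by
  rw [hamHardIO_iff_not_hamPolySize, hamPolySize_iff_npsubPPoly]
  exact Iff.rfl

/-- **The non-uniform form of the crux IS its P/poly form** (§3 = §11, unconditionally). -/
theorem hamCompilesNU_iff_hamCompilesPPoly : HamCompilesNU ↔ HamCompilesPPoly := by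
  unfold HamCompilesNU HamCompilesPPoly
  rw [hamPolySize_iff_npsubPPoly]

/-- **Budget 0 of the crux is a THEOREM**: `NP ⊆ P → HAM ∈ SIZE^tc(poly)` holds unconditionally
(Cook/Mathlib model bridges + `P ⊆ P/poly` + the hardness bridge). The bottom of the scale sandwich
`HamCompilesAt log² → HamCompiles → HamCompilesAt 0` (§9) is thereby anchored in a proved statement. -/
theorem hamCompilesAt_zero : HamCompilesAt (fun _ => 0) :=
  hamCompilesAt_zero_iff.2 fun hsub => hamPolySize_iff_npsubPPoly.2 (npsubPPoly_of_NPsubP hsub)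

/-- The conclusion at budget 0 is `NP ⊆ P/poly`. -/
theorem conclAt_zero_iff_npsubPPoly : ConclAt (fun _ => 0) ↔ NPsubPPoly :=
  conclAt_zero_iff_hamPolySize.trans hamPolySize_iff_npsubPPoly

/-- Crux #2 at budget 0 is `NP ⊄ P/poly`. -/
theorem windowHamAt_zero_iff_npNotSubsetPPoly : WindowHamAt (fun _ => 0) ↔ NPNotSubsetPPoly :=
  windowHamAt_zero_iff.trans hamHardIO_iff_npNotSubsetPPoly

/-- **Crux #2 follows from the summit's conjecture leaf**: `NP ⊄ P/poly → WindowHam`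
(unconditionally; "implied by NP ⊄ P/poly" in the route text is now a kernel fact). -/
theorem windowHam_of_npNotSubsetPPoly (h : NPNotSubsetPPoly) : WindowHam :=
  windowHam_of_hamHardIO (hamHardIO_iff_npNotSubsetPPoly.2 h)

/-- … at every budget. -/
theorem windowHamAt_of_npNotSubsetPPoly (g : ℕ → ℕ) (h : NPNotSubsetPPoly) : WindowHamAt g :=
  windowHamAt_mono (fun _ => Nat.zero_le _) (windowHamAt_zero_iff_npNotSubsetPPoly.2 h)

/-- **The P/poly form of the crux is EXACTLY "crux #2 = Karp–Lipton"**: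
`HamCompilesPPoly ↔ (WindowHam ↔ NPNotSubsetPPoly)`. Every proposed line (kotzig-cutspan,
bbbkv-dialogue, the sibling's powerset–Held–Karp collapse) proves the left side; on landing, the
route `SymmetryBudget` is route `Circuit` (target `NP ⊄ P/poly`) in costume — kernel-certified. -/
theorem hamCompilesPPoly_iff_windowHam_iff_npNotSubsetPPoly :
    HamCompilesPPoly ↔ (WindowHam ↔ NPNotSubsetPPoly) :=
  hamCompilesPPoly_iff.trans
    ⟨fun h => ⟨h, windowHam_of_npNotSubsetPPoly⟩, fun h => h.1⟩

/-- Equivalently with the general lower bound: `HamCompilesNU ↔ (WindowHam ↔ HamHardIO)`. -/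
theorem hamCompilesNU_iff_windowHam_iff_hamHardIO : HamCompilesNU ↔ (WindowHam ↔ HamHardIO) := by
  refine ⟨windowHam_iff_hamHardIO_of_NU, fun h hP => ?_⟩
  by_contra hc
  exact (hamHardIO_iff_not_hamPolySize.1 (h.1 (windowHam_iff_not_concl.2 hc))) hP

/-- At every budget: the P/poly form at `g` is "crux #2 at `g` = Karp–Lipton". -/
theorem ppolyFormAt_iff (g : ℕ → ℕ) :
    (NPsubPPoly → ConclAt g) ↔ (WindowHamAt g ↔ NPNotSubsetPPoly) := by
  rw [windowHamAt_iff_not_conclAt, npNotSubsetPPoly_iff]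
  constructor
  · intro h
    exact ⟨fun hW hN => hW (h hN), fun hN hc =>
      (windowHamAt_iff_not_conclAt g).1 (windowHamAt_of_npNotSubsetPPoly g hN) hc⟩
  · intro h hN
    by_contra hc
    exact h.1 hc hN

/-- **The sub-window crux modulo `Symmetrise` only**: for any budget with `(g m)! ≤ poly`, item
`Symmetrise` alone proves `HamCompilesAt g` — the bridge `NP ⊆ P → HamPolySizeB2` of §10 is now
discharged. -/
theorem hamCompilesAt_subwindow_of_symmetrise (hS : Symmetrise) {g : ℕ → ℕ} (r : Polynomial ℕ)
    (hg : ∀ m, (g m).factorial ≤ r.eval m) : HamCompilesAt g :=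
  hamCompilesAt_of_symmetrise hS r hg fun hsub =>
    hamPolySizeB2_iff_npsubPPoly.2 (npsubPPoly_of_NPsubP hsub)

/-- **What a refutation of the crux now means, exactly**: `¬HamCompiles ↔ NP ⊆ P ∧ WindowHam`, and
then `NP ⊆ P/poly` holds while HAM has NO poly-size window-symmetric circuits although it HAS
poly-size general ones (`HamPolySize`): a refutation exhibits a superpolynomial gap between
symmetric and general circuit size for HAM inside `P = NP`. -/
theorem not_hamCompiles_iff_gap :
    ¬ HamCompiles ↔ NPsubP ∧ HamPolySize ∧ ¬ Concl := by
  rw [not_hamCompiles_iff]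
  constructor
  · rintro ⟨hsub, hc⟩
    exact ⟨hsub, hamPolySize_iff_npsubPPoly.2 (npsubPPoly_of_NPsubP hsub), hc⟩
  · rintro ⟨hsub, -, hc⟩
    exact ⟨hsub, hc⟩

end HardnessBridge


/-! ### §15 The exact room between the crux and what the lines prove; scale and basis remarks (cycle 3)

(a) KERNEL: `HamCompilesPPoly ↔ HamCompiles ∧ (NPsubPPoly → PneNP → Concl)` — the P/poly form exceeds the crux by
exactly the Karp–Lipton world "NP ⊆ P/poly but P ≠ NP", in which the crux is vacuous and the P/poly form still
demands the compilation. So a proof of `HamCompiles` that does NOT prove `HamCompilesPPoly` would have to use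
`NP ⊆ P` beyond `NP ⊆ P/poly`, i.e. uniformity; for circuit EXISTENCE statements no such use is known (both give
`PH ⊆ P/poly`), and none of the five idea cards / two skeletons does. At every budget: `hamCompilesNUAt_iff`.

(b) SCALE (paper, search-degraded: local index and OpenAlex/S2/arXiv unavailable 2026-08-16T05Z; quoted from the
materialised arXiv text of Anderson–Dawar, ToCS 2017 = arXiv:1401.1125, p.10 "Theorem 21 (Support Theorem). For any
ε and n with 2/3 ≤ ε ≤ 1 and n > 2^{56/ε²}, if C is a rigid symmetric circuit over universe U with |U| = n and
s := max_g |orb(g)| ≤ 2^{n^{1-ε}}, then SP(C) ≤ (33/ε) log s / log n", and from the route's own citation of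
Dawar–Wilsenach ToCL 2022 Thm 4.10 = ToC 2025 Thm 6.2 "orbit ≤ C(g,k), k ≤ g/4 ⇒ support < k"): at budget
`g = c·log₂ m` a circuit of `m^k = 2^{(k/c) g}` gates has orbits ≤ 2^{(k/c) g} ≤ C(g, k') as soon as
H(k'/g) > k/c, so the support method refutes polynomial size of DEGREE k < c·H(δ/c') only (δ = counting-width
fraction of HAM, c' = support-to-C^k loss) — never all degrees at once. Hence the printed lower bounds give
`WindowHamAt g` exactly for g = ω(log m), the lines give `ConclAt g` (size 2^{a g}·m^b) for every g = O(log m),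
and the only consistency constraint between them is `a ≥ H(δ/c')`, void since a ≥ 1 for any subset-indexed
construction and H ≤ 1. The scale has NO gap and NO overlap: the window g = ⌊log₂ m⌋ lies inside the lines'
range, which is why (§14) it collapses onto `NP ⊄ P/poly` rather than contradicting a theorem.

(c) BASIS MUTATION (paper): (i) MAJ is not load-bearing FOR THE LINES — they use majority only on ≤ 2g = 2 log₂ m
wires (rank thresholds), replaceable by the subset-indexed symmetric DNF `⋁_{|S|=t} ⋀_{w∈S}` of C(2g,t) ≤ m² gates;
so the lines prove the crux even over `acBasis`. As a STATEMENT mutation `tcBasis ↦ acBasis` the crux gets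
stronger (fewer circuits) and stays irrefutable (¬ ⊢ NP ⊆ P). (ii) UNBOUNDED FAN-IN IS load-bearing — now a THEOREM, §16: over a symmetric fan-in-2
basis a Bud-symmetric circuit cannot even read a free entry (3 ≤ g ≤ m), so `HasSym deMorganBasis … (hamFn m)` fails
at every size and the mutated crux is the summit itself; provers must keep unbounded ∨/∧ (every aggregation over a
free orbit sits in ONE gate).
(iii) Multiplicities: `size` counts gates, so MAJ gates carry arbitrary weights (sibling F4); §14's Muroga step is
exactly what makes `HamPolySize ↔ NP ⊆ P/poly` true despite this. -/

section Room

/-- **The exact excess of the P/poly form over the crux** is the Karp–Lipton world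
`NP ⊆ P/poly ∧ P ≠ NP`: there the crux is vacuous and the P/poly form still demands `Concl`. -/
theorem hamCompilesPPoly_iff_hamCompiles_and :
    HamCompilesPPoly ↔ HamCompiles ∧ (NPsubPPoly → PneNP → Concl) := by
  constructor
  · intro h
    exact ⟨hamCompiles_of_hamCompilesPPoly h, fun hN _ => h hN⟩
  · rintro ⟨hC, hKL⟩ hN
    by_cases hP : PneNP
    · exact hKL hN hP
    · exact hamCompiles_iff.1 hC (not_not.1 ((not_congr pneNP_iff_not_NPsubP).1 hP))

/-- The non-uniform form of the crux at an arbitrary budget. -/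
def HamCompilesNUAt (g : ℕ → ℕ) : Prop := HamPolySize → ConclAt g

/-- `ConclAt g → HamPolySize` at every budget (symmetric circuits are circuits). -/
theorem hamPolySize_of_conclAt {g : ℕ → ℕ} (hc : ConclAt g) : HamPolySize :=
  conclAt_zero_iff_hamPolySize.1 (conclAt_anti (fun _ => Nat.zero_le _) hc)

/-- **At every budget, the non-uniform form is "crux #2 at that budget = the general lower bound"**
(generalises `hamCompilesNU_iff_windowHam_iff_hamHardIO`). -/
theorem hamCompilesNUAt_iff (g : ℕ → ℕ) : HamCompilesNUAt g ↔ (WindowHamAt g ↔ HamHardIO) := by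
  rw [HamCompilesNUAt, windowHamAt_iff_not_conclAt, hamHardIO_iff_not_hamPolySize]
  constructor
  · intro h
    exact ⟨fun hW hP => hW (h hP), fun hH hc => hH (hamPolySize_of_conclAt hc)⟩
  · intro h hP
    by_contra hc
    exact h.1 hc hP

/-- … and it is the P/poly form at that budget (§14 at every `g`). -/
theorem hamCompilesNUAt_iff_ppolyFormAt (g : ℕ → ℕ) :
    HamCompilesNUAt g ↔ (NPsubPPoly → ConclAt g) := by
  rw [HamCompilesNUAt, hamPolySize_iff_npsubPPoly]

/-- The crux at budget `g` follows from its non-uniform form at `g` (the bridge is a theorem). -/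
theorem hamCompilesAt_of_NUAt {g : ℕ → ℕ} (h : HamCompilesNUAt g) : HamCompilesAt g :=
  fun hsub => h (hamPolySize_iff_npsubPPoly.2 (npsubPPoly_of_NPsubP hsub))

end Room


/-! ### §16 BASIS MUTATION REFUTED (cycle 3): with fan-in `≤ 2` the window collapses the OTHER way

KERNEL (§Lib-16, `FanInLib`; proposed as `Literature/Computability/Complexity/SymmetricCircuitFanIn.lean`): a
`Bud(m,g)`-symmetric circuit (verbatim `Sym`, rigid or not) whose gates are SYMMETRIC gate functions of fan-in `≤ 2`
has the same value on any two matrices agreeing on the ORDERED block, as soon as `3 ≤ g ≤ m`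
(`FanInLib.eval_eq_of_fanIn_two_of_agree`). Proof: reduce to a rigid circuit (Anderson–Dawar Lemma 7, tree); the
output is fixed by the automorphism `θ_c` of every 3-cycle `c` of free vertices; a gate fixed by `θ_c` with `≤ 2`
children has its children permuted by an involution which is also of order dividing 3 (`θ_{c³} = θ_c³ = 1` by
rigidity), hence fixed; by induction every gate below the output is fixed by every `θ_c` and reads no position moved
by a 3-cycle of free vertices, i.e. none outside the ordered block. CONSEQUENCES for the crux family: replacing
`tcBasis` by `{∧₂, ∨₂, ¬}` (or any symmetric fan-in-2 basis) in `HasSym` makes `Concl` FALSE outright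
(`not_conclDeMorgan`, indeed `¬HasSym` at EVERY size for m ≥ 8), `WindowHam` TRUE trivially (`windowHamDeMorgan`),
and the mutated crux EQUIVALENT TO THE SUMMIT (`hamCompilesDeMorgan_iff_pneNP`). So the unbounded fan-in of the
threshold basis is load-bearing in the strongest sense — the symmetric window exists only because ∨/∧/MAJ gates may
aggregate a whole orbit in one step — and §15(c)(ii)'s heuristic is now a theorem (sharper: such circuits cannot even
READ a free entry). Any compilation line must place every free-orbit aggregation in a single unbounded gate. -/

section FanIn

/-- The conclusion of the crux with the threshold basis replaced by `{∧₂, ∨₂, ¬}`. -/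
def ConclDeMorgan : Prop :=
  ∃ p : Polynomial ℕ, ∀ m : ℕ,
    HasSymCircuit deMorganBasis (Bud m (Nat.log 2 m)) (p.eval m) (hamFn m)

/-- Crux #2 with the threshold basis replaced by `{∧₂, ∨₂, ¬}`. -/
def WindowHamDeMorgan : Prop :=
  ∀ p : Polynomial ℕ, ∃ᶠ m in Filter.atTop,
    ¬ HasSymCircuit deMorganBasis (Bud m (Nat.log 2 m)) (p.eval m) (hamFn m)

/-- The crux with the threshold basis replaced by `{∧₂, ∨₂, ¬}`. -/
def HamCompilesDeMorgan : Prop := NPsubP → ConclDeMorgan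

/-- **No window-symmetric `{∧₂, ∨₂, ¬}`-circuit of ANY size computes `HAM_m`** (`m ≥ 8`). -/
theorem not_hasSym_deMorgan_ham {m : ℕ} (hm : 8 ≤ m) (s : ℕ) :
    ¬ HasSymCircuit deMorganBasis (Bud m (Nat.log 2 m)) s (hamFn m) :=
  FanInLib.not_hasSymCircuit_deMorgan_ham hm s

/-- More generally: at every budget `3 ≤ g ≤ m`, no `Bud(m,g)`-symmetric circuit with symmetric
gates of fan-in `≤ 2` computes `HAM_m`, whatever its size. -/
theorem not_computes_ham_fanIn_two {m g : ℕ} (hg : 3 ≤ g) (hgm : g ≤ m)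
    (C : Circuit (Fin m × Fin m)) (h2 : ∀ gt ∈ C.gates, gt.arity ≤ 2)
    (hsym : ∀ gt ∈ C.gates, gt.fn.IsSymmetric) (hS : C.IsSymmetricUnder (Bud m g)) :
    ¬ C.Computes (hamFn m) :=
  FanInLib.not_computes_ham_of_fanIn_two hg hgm C h2 hsym hS

/-- **The fan-in-2 conclusion is FALSE** (refutation of the basis mutation of the crux's
conclusion; witness `m = 8`). -/
theorem not_conclDeMorgan : ¬ ConclDeMorgan := fun ⟨_, hp⟩ =>
  not_hasSym_deMorgan_ham (le_refl 8) _ (hp 8)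

/-- **The fan-in-2 crux #2 is TRUE**, trivially (from `m = 8` on, at every size bound). -/
theorem windowHamDeMorgan : WindowHamDeMorgan := fun _ =>
  Filter.Eventually.frequently (Filter.eventually_atTop.2 ⟨8, fun _ hm => not_hasSym_deMorgan_ham hm _⟩)

/-- **The fan-in-2 crux is the summit**: `HamCompilesDeMorgan ↔ PneNP` (its conclusion being
false, it is the bare negation of its hypothesis). -/
theorem hamCompilesDeMorgan_iff_pneNP : HamCompilesDeMorgan ↔ PneNP := by
  rw [HamCompilesDeMorgan, pneNP_iff_not_NPsubP]
  exact ⟨fun h hsub => not_conclDeMorgan (h hsub), fun h hsub => absurd hsub h⟩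

/-- Contrast with the threshold basis: there `Concl` holds at exponential size at every `m`
(symmetric DNF, §7) — the DNF's single `∨` gate of fan-in `#{satisfying assignments}` is exactly
what fan-in 2 forbids. -/
theorem hasSym_tc_not_deMorgan {m : ℕ} (hm : 8 ≤ m) :
    (∃ s, HasSymCircuit tcBasis (Bud m (Nat.log 2 m)) s (hamFn m)) ∧
      ∀ s, ¬ HasSymCircuit deMorganBasis (Bud m (Nat.log 2 m)) s (hamFn m) :=
  ⟨perMExists m, not_hasSym_deMorgan_ham hm⟩

/-- **Quantitative form (prime order): a window-symmetric threshold circuit for `HAM_m` has a gate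
of fan-in `> ⌊log₂ m⌋ / 2`** (`m ≥ 8`; fan-in below a prime `p ≤ g` ⇒ blind, Bertrand). So in
`Concl` every witness circuit aggregates some free orbit in a single gate of fan-in `Ω(log m)`. -/
theorem exists_wide_gate_of_sym_ham {m : ℕ} (hm : 8 ≤ m) (C : Circuit (Fin m × Fin m))
    (hB : C.IsOver tcBasis) (hS : C.IsSymmetricUnder (Bud m (Nat.log 2 m)))
    (hC : C.Computes (hamFn m)) : ∃ gt ∈ C.gates, Nat.log 2 m / 2 < gt.arity :=
  FanInLib.exists_gate_arity_gt_half_log_of_computes_ham hm C hB hS hC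

end FanIn

end Summit.PneNP.PneNP.Cruxes.HamCompiles.Disproof
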